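import Summits.SmoothPoincare4.SmoothPoincare4.Theses.ConvexBisection
import Summits.SmoothPoincare4.SmoothPoincare4.Theorems.ContractibleTwistedDoubleStandard.Negative.SphereAcyclicBisection
import Literature.Geometry.Symplectic.SteinBoundaryContactProofs
import Literature.Topology.FourManifolds.HomotopyS4CompactProofs
import Literature.Topology.FourManifolds.CerfGammaFourProofs
import Literature.Topology.FourManifolds.CorkDecompositionSplitting
import Literature.Topology.FourManifolds.GluingProofs
import HarnessLib

/-!
# Disproof of `AcyclicBisectionRigidity` — findings (cdisprove, crux stmt-SmoothPoincare4-10507)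

Standing adversary's work file for crux `ConvexBisection.AcyclicBisectionRigidity`
(route `route-SmoothPoincare4-ConvexBisection`, rank 2):

> for every Hausdorff second-countable `C^∞` 4-manifold `M` with `M ≃ₕ S⁴`: if `M` is covered by
> two smoothly embedded compact Stein domains `(W₁,J₁)`, `(W₂,J₂)` meeting exactly along the images
> of their boundaries, with equal pushed-forward complex tangencies on the seam and with
> `H_k(Wᵢ; ℚ) = 0` for `k > 0`, then `M ≅ S⁴`.

Generation 2 (cycle 2). The generation-1 file (v1–v5, evidence `Disproof.lean` sha256
`63b9279b…` on the item, never written to the tree) is not readable from this seat; its FORMAL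
content (§§0–4) is re-derived here from the evidence notes and its INFORMAL census (§5) is
summarised with credit. Everything in this file is `sorry`-free; prose is in docstrings.

Generation 3 (cycle 3, v9, 2026-08-16): §8 gaps (i) non-vacuity and (ii) transport are now CLOSED
by tree lemmas (`Negative.acyclicBisection_sphere`, p70210; `IsSmoothEmbedding.comp_diffeomorph`)
and re-exported here (`acyclicBisection_sphere`, `crux_holds_at_sphere`); §9 TARGETS = the three
registered stubs of `Lines/minimal-factorisation-rigidity.lean` (the two twisted-double stubs are
crux- and SPC4-implied, hence exactly as unrefutable as the crux; the lever
`stub_minimalFactorisationTwins` is NOT SPC4-shielded, holds trivially on twin data, and is reduced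
to three independent one-construction questions in print, §9c); §9d (v10) the POSITRON DICHOTOMY
from Hayden 2021: an unconditional cork-twist member of the crux class on which Stub 1 either fails
or produces a contact Stein cork; §10 REDUCIBLE SEAMS split (Eliashberg filling-by-discs + Colin):
WLOG the seam is prime, and `Σ° × I` halves are never Stein; §10b (v10) Brieskorn seams after the
2026 classifications (Alfieri–Cavallo–Matkovič, Cavallo): essentially excluded.

Generation 4 (cycle 4, v11, 2026-08-16): four additions, all formal parts `sorry`-free.
§9e TWIN / NON-TWIN DECOMPOSITION (formal): `crux ↔ TwinSector ∧ NonTwinSector`,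
`TwinSector ↔ Stub2 ∧ Stub3` WITHOUT the lever, `Stub1 → NonTwinSector` (the lever says exactly
"the non-twin sector is empty") — so if Stub 1 dies the line still proves `TwinSector` and the
crux's exact residue is `NonTwinSector` (`crux_iff_nonTwinSector_of_stub23`), where every kill
candidate of §§9c–d lives. §9f (informal) the SLICE–BENNEQUIN `tb`-TEST: a one-Legendrian-knot
certificate that a cork twist is NOT isotopic to a contactomorphism of a Stein-induced structure,
and the mapping-class refinement of the positron dichotomy (if `Diff(P) → π₀ Diff(∂P)` is trivial,
horn 2 forces `τ` ITSELF to be isotopic to a `ξ_{J_B}`-contactomorphism, testable by `tb`).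
§11 TRANSPORT & CHARACTERISATION (formal): `AcyclicBisection.transport` along any `M ≅ N`
(target-side composition of smooth embeddings, tree lemma `IsSmoothEmbedding.diffeomorph_comp`),
`acyclicBisection_of_diffeomorph_sphere` (EVERY standard sphere is acyclically bisected — the
converse of the crux's implication is a theorem), `crux_iff_characterisation` (crux ⟺ among
homotopy 4-spheres, "acyclically Stein-bisectable" ⟺ "diffeomorphic to `S⁴`"),
`counterexample_transport` (counterexamples are whole diffeomorphism classes). §12 THE DOUBLE
SECTOR (formal + informal): `doubleSector_of_crux` (crux ⇒ homotopy-sphere doubles `D(W)` of ONE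
ℚ-acyclic Stein domain are `S⁴`, via the sibling tree theorem `steinBisection_of_isDouble`), and
the observation that a simply connected double of a ℚ-acyclic compact `W` forces `W` CONTRACTIBLE
(`π₁ W` embeds in `π₁ D(W) = G ∗_H G`; then `H₂ = 0` by duality) — so the `ψ = id` slice of the
crux is literally the `ψ = id` slice of crux 4 (presentation spheres), and Stub 3's torsion sector
consists ENTIRELY of doubles twisted by contactomorphisms that extend over neither half. §12b
(v12) THREE-SECTOR DECOMPOSITION (formal): seam-compatible twins present `M` as an `IsDouble`
and are contact twins, whence `crux ↔ DoubleSector ∧ CorkTwistSector ∧ NonTwinSector` and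
`Stub2 ∧ Stub3 ↔ DoubleSector ∧ CorkTwistSector`. LANDED (gen 4, `--supports` the crux item):
`Theorems/AcyclicBisectionRigidity/Negative/Transport.lean` (p74021), `…/DoubleSector.lean`
(p74611), `…/TwinDecomposition.lean` (p74638), `…/SeamCompatible.lean` (p75201: the two seam
lemmas and `crux_iff_threeSectors`); gen 3: `…/LoadBearing.lean`, `…/Targets.lean` (p71941). Print
sweep of gen 4 ran under DEGRADED SEARCH (searchd down, OpenAlex/S2/arXiv 429): only direct reads;
Wahl 2011 Thm 2.4 checked (two ℚHD smoothing components of type `𝒜⁴`, Milnor fibres diffeomorphic —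
no non-twin pair there either, §6 (N2)); EOT arXiv:2408.09292 Lemma 38 read for §5d, the computed
census of small Seifert torsion seams (survivor family `Y(p)` ⊋ `{S³/Q₈}`).

Generation 5 (cycle 5, v17, 2026-08-16): round 1 is over — all three lines died at a TWINS lever
(Hayden arXiv:2003.13681 Thm 1.3: `NonTwinSector` is INHABITED), as §9c predicted by other routes —
and two round-2 cards act on the glued manifold. §13 grades them: (§13a, formal) the Transfer
`C⁺ = DoubleReduction` of `achiral-relator-reduction` is crux-implied with `W = 𝔻⁴`, hence
crux-equivalent modulo crux 4 — a costume as a statement, all content in the method `T`; (§13b)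
`exchange-recognition`'s typed lemma is a tree theorem (formal), its exchange lemma, its
`M_Hayden ≅ S⁴` (the lead's Q3; Hayden p. 5 re-read here) and `Σ_P ≅ S⁴` are CORRECT, its
falsifier (2) passes by §5d (d); (§13c) **the lever `T` (monotone achiral reducibility) is FALSE on
the planar page at `k = 5`**: an explicit balanced relation `t₂₃₄t₁₂₃t*₁₃₄t₃ = t₂₃t_∂t₃₄t*₁₃` in
`Mod(P₅, ∂)` between two minimal positive factorisations with DISJOINT type multisets, glued
manifold a homotopy 4-sphere with seam `S³/Q₈` (engine `modpk.py`, lantern-validated; kit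
j011482); the abelian analysis (`H₁(Mod(P_k,∂)) = ℤ^{C(k,2)}`, Gram invariant) shows the
obstruction is silent in the unimodular sector and bites only for `|det| ≥ 2`; the type-count
invariant of the move set is formal (`typeCount_eq_zero_of_monotoneReducible`); escape routes
priced; (§13d) 324 new explicit torsion test spheres with aspherical `(ℤ/2)²`-seams (T6).

## Findings (index)

* §0 `AcyclicBisection M` — the ∃-hypothesis verbatim; `crux_iff` (`Iff.rfl`).
* §1 RESISTANCE. `of_spc4 : SmoothPoincare4 → crux`; `shielded_of_spc4` (EVERY statement of the
  shape `∀ M ≃ₕ S⁴, P M → M ≅ S⁴` follows from SPC4, so deleting any conjunct of the bisection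
  hypothesis keeps the statement SPC4-implied and unrefutable); `not_spc4_of_not`,
  `exotic_of_not` (a kill of the crux IS an exotic 4-sphere carrying an acyclic bisection);
  `iff_spc4_of_exists` (given the sibling crux `AcyclicBisectionExists`, the crux is EQUIVALENT
  to the summit); `crux_iff_normalForm` (WLOG `M` compact and path connected — proved tree
  facts). Verdict: no Lean refutation exists short of `¬ SmoothPoincare4`.
* §2 JUNK EXCLUSION (the hypothesis is honest). `steinStructure_isEmpty_of_boundary_empty`
  (compact nonempty `W` with a Stein structure has `∂W ≠ ∅` — tree lemma
  `SteinStructure.exists_isBoundaryPoint`), `left_nonempty` / `right_nonempty` / `seam_nonempty`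
  (in a Stein bisection of a NONEMPTY `M` neither half and not the seam is empty), so the readings
  `M = M ∪ ∅`, `W₂ = closed manifold` are excluded by the statement itself; the only junk
  inhabitant of `SteinStructure` is on the empty carrier (`steinStructureOfIsEmpty`).
* §3 LOAD-BEARING HYPOTHESES. `WithoutHomotopyEquiv` (the crux with `M ≃ₕ S⁴` deleted) is FALSE:
  `false_without_homotopyEquiv`, witness `M = ∅` bisected into two empty Stein halves
  (`acyclicBisection_of_isEmpty`). Honest (non-degenerate) witnesses on paper, not formalisable
  with the present Literature: `S⁴ ⊔ S⁴`; the double `D(B_{p,q}) = B_{p,q} ∪_id B̄_{p,q}` of a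
  Stein rational ball (Lekili–Maydanskiy arXiv:1202.5625: `B_{p,q}` Stein; `π₁ D(B_{p,q}) = ℤ/p`),
  which also kills the variant "nonempty connected compact `M`" (`proof_wanted` below). Every OTHER
  single-conjunct deletion (Stein, contact matching, acyclicity, embedding, covering, seam
  conditions) is SPC4-implied (§1 `shielded_of_spc4`), hence carries no refutation; deleting
  acyclicity collapses the crux onto SPC4 modulo the KNOWN support `SteinBisectionExists`
  (Baykur 2006 Thm 5.1) — `collapse_without_acyclic`.
* §4 SECTORS. `isZero_singularHomology_of_contractibleSpace` (contractible ⇒ ℚ-acyclic, from the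
  tree's homotopy invariance) and `contractibleSector_of_crux` : crux ⇒ `ContractibleSector`
  (= crux 4 `ContractibleTwistedDoubleStandard` restricted to homotopy spheres;
  `contractibleSector_of_crux4` gives the other inclusion), so a Stein-compatible exotic cork
  re-gluing of `S⁴` kills cruxes 2 and 4 at once. INFORMAL (E1 of the ideator evidence,
  re-checked here): the `ψ = id` corner of `ContractibleSector` already contains EVERY presentation
  homotopy sphere `Σ(P,ε) = ∂H⁵(P,ε)` (realise `P` by a Legendrian link with framings `tb − 1`,
  Gompf 1998 Thm 1.3 ⇒ contractible Stein `W` with `W × I = H⁵(P,ε)`, `D(W) = Σ(P,ε)`), i.e. the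
  crux implies `PresentationSpheresStandard` (typed in routes ConvexityLadder/EntropyLadder,
  item stmt-SmoothPoincare4-3717) — the Andrews–Curtis frontier
  (`Literature.Barriers.SmoothPoincare4.StrictPropertyTwoRBarrier` neighbourhood).
* §5 CENSUS OF THE FINITE-π₁ SECTOR (generation 1, informal, credited; finite bookkeeping
  re-proved here: `zmod_sq_not_prod`). Lens-space seams are excluded (`H₁(Γ) ≅ H₁(W₁) ⊕ H₁(W₂)`,
  `|H₁(Wᵢ)|² = |H₁(Γ)|`, `ℤ/n²` is not a product of two groups of order `n`); but the sector is
  INHABITED by `S⁴` itself with seam `S³/Q₈` (halves `N₋₂(ℝP²)`, Gompf 1998 Ex. 4.14, glued by a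
  contactomorphism in the class of a transposition of exceptional fibres; GLS 2007, Price 1977 /
  Kim–Miller 2020, Choe–Park 2020), so the route's foreseen glue "finite-π₁ halves cannot occur"
  is false as stated and contact matching bites only through `Spin^c`/`Γ`-data. §5c (generation
  2, print read at page level): lens-SUM seams exist smoothly in `S⁴` but are Stein on neither
  side for any contact structure (Etnyre–Tosun 2022 Thm 8) — the first census entry where the
  Stein hypothesis itself bites; Brieskorn seams of the contractible sector are constrained with
  orientation (`−Σ(2,3,12n+1)` never, Mark–Tosun 2018 Cor. 1.4; with Mazur-type halves never,
  conjecturally, Gompf); the planar ∩ contractible sector is infinite already for 4 binding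
  components (Oba 2014 Thm 1.1, Mazur-type fillings).
* §5d SMALL SEIFERT TORSION SEAMS, COMPUTED (gen 4, `seifert_census.py`): necessary conditions
  (A ⊕ A; complementary metabolisers; Donaldson with BOTH kernels realised by diagonal
  embeddings) over all 3-fibre Seifert ℚHS with `aᵢ ≤ 7`: 22 pass A ⊕ A, 8 + 4 excluded,
  survivors = the family `Y(p) = S²(0; 1/p, −1/p, −1/p)` (`p = 2..5`; `Y(2) = S³/Q₈`) and three
  `e₀ = −1` spaces; worked out by hand: `−Y(p)` is Legendrian surgery on a stabilised regular
  fibre of `(S¹×S², ξ_std)` (EOT Lemma 36), so bounds a STEIN rational ball `X_p` (`π₁ = ℤ/p`)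
  for EVERY `p`, and the fibre-swap twist `M_p = X_p ∪_{τ_p} X̄_p` is a HOMOTOPY 4-SPHERE for
  every `p` (`π₁`/homology computed) and is STANDARD for every `p` (1-handle cancellation +
  Property R, §5d (d)) — an infinite family of standard test spheres (T5), in the crux class iff
  `τ_p` matches two EOT structures (open for `p ≥ 3`; yes for `p = 2`).
* §6 NATURAL STRENGTHENINGS (targets for triage of the ideators' first lemmas). "The two halves
  are diffeomorphic" (`AcyclicTwinsDiffeomorphic`, card minimal-factorisation-rigidity) and
  "ℚ-acyclic Stein fillings are unique rel boundary" (UQF*, ideator 1): exotic contractible STEIN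
  pairs with common boundary are in print (Akbulut–Yildiz 2019 Thm 1; Hayden–Mark–Piccirillo 2021
  §6.0.1), their induced contact structures are NOT compared in print — both lemmas are one
  contact-class computation from refutation, and cannot be cheaply confirmed either.
* §7 TEST SPHERES: what a kill would have to be — presentation spheres, cork twists of `S⁴`
  along non-standard Mazur-cork embeddings (Akbulut–Yildiz / HMP unions `W₁ ∪ W̄₂`), Gompf's
  infinite-order cork twists, a second ℚ-acyclic filling of `S³/Q₈`; none believed exotic.
* §8 FORMAL GAPS (gen 2) — (i) non-vacuity and (ii) transport CLOSED in gen 3: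
  `acyclicBisection_sphere : AcyclicBisection S⁴`, `crux_holds_at_sphere`, and the tree lemma
  `Manifold.IsSmoothEmbedding.comp_diffeomorph`; (iii) `H₀` still open formally.
* §9 TARGETS (gen 3) = the registered stubs of `Lines/minimal-factorisation-rigidity.lean`:
  `Stub1/2/3` verbatim; `stub2_of_crux`, `stub3_of_crux`, `stub2_of_spc4`, `stub3_of_spc4`
  (the two twisted-double stubs are consequences of the crux itself — unrefutable short of an
  exotic `S⁴`); `crux_of_stubs` (the line's composition, re-derived) hence
  `crux_iff_stub23_of_stub1`; `stub1_of_twins` (Stub 1 is TRIVIAL whenever `(W₁,J₁) = (W₂,J₂)`: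
  its entire content is the existence of a contact-diffeomorphism of the halves, so it is killed by
  ONE pair of non-diffeomorphic ℚ-acyclic Stein fillings of one contact ℚHS³ glued to a homotopy
  sphere, with NO exotic `S⁴` needed); `stub1_hypotheses_at_sphere` (non-vacuous). §9c (informal,
  the adversary's verdict on Stub 1): the Karakurt–Oba–Ukida pair `(W¹, J₁), (W¹, J₂)` CANNOT kill
  it (`ξ₂` planar, `ξ₁` not ⇒ not contactomorphic; `τ_*ξ₁ ≄ ξ₁` by Akbulut–Karakurt), but each of
  three constructions one step beyond print kills it: (Q1) a Stein cork whose twist is a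
  contactomorphism of the induced structure (first test `τ_*ξ₂ ≟ ξ₂` on the Akbulut cork) — then
  the Akbulut–Ruberman/Akbulut–Yildiz enlargement gives non-diffeomorphic contractible Stein
  fillings with AUTOMATICALLY contactomorphic boundaries (contact-surgery naturality); (Q2) two
  non-diffeomorphic ℤ-acyclic Stein fillings of some `+Σ(2,3,6m+1)`, `Σ(2,5,7)`, `Σ(3,4,5)` (ONE
  tight plane field: Mark–Tosun 2018 Thm 1.7, Alfieri–Cavallo–Matkovič 2026 Prop 1.7); (Q3) Stein
  structures on Akbulut–Ruberman's infinite family `V_j` (Thm 5.3, hyperbolic common boundary) —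
  Colin–Giroux–Honda finiteness + pigeonhole.
* §9d THE POSITRON DICHOTOMY (gen 3): by Hayden 2021 (corks = double covers of `B⁴` branched along
  HOLOMORPHIC discs `D`, `D′ = ι̂(D)`, Thms 1.2/1.4) the positron cork `P` carries Stein structures
  `J_A`, `J_B` with `ξ_{J_A} ≃ τ_*ξ_{J_B}`; hence the cork twist `P ∪_τ P̄` of `S⁴` is
  UNCONDITIONALLY an acyclic common-contact Stein bisection (a test sphere of the crux), and
  EITHER Stub 1 fails on it OR `(P, τ⁻¹Φ|∂, J_B)` is a contact Stein cork — which with (Q1) kills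
  Stub 1 anyway, modulo a Weinstein AR cobordism. Decisive: `τ_* c(ξ_K) ∈ Diff(P)|∂ · c(ξ_K)`?
* §9e TWIN / NON-TWIN DECOMPOSITION (gen 4, formal): `ContactTwins J₁ J₂` (= Stub 1's conclusion),
  `TwinSector`, `NonTwinSector`; `crux_iff_twin_and_nonTwin`; `twinSector_iff_stub23` (the two
  residual stubs prove EXACTLY the twin sector, lever or no lever); `nonTwinSector_of_stub1`;
  `crux_iff_nonTwinSector_of_stub23` (given Stubs 2–3 the crux IS the non-twin sector — the
  statement the route inherits when Stub 1 dies); `twin_and_nonTwin_of_spc4` (both shielded).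
* §9f THE `tb`-TEST AND THE MCG REFINEMENT (gen 4, informal): slice–Bennequin in a Stein filling
  turns "is the cork twist `f` isotopic to a contactomorphism of `ξ_J`?" into a one-knot
  certificate — `γ` slice in `C`, ONE Legendrian representative of `f(γ)` with `tb ≥ 0` ⇒ no; and
  if `Diff(P) → π₀Diff(∂P)` is trivial (e.g. `MCG(∂P) = ⟨τ⟩`), horn 2 of §9d makes `τ` ITSELF
  isotopic to a `ξ_{J_B}`-contactomorphism, so the positron dichotomy becomes decidable by `tb`.
* §10 REDUCIBLE SEAMS (gen 3, informal theorem): if the seam is `Γ₁ # Γ₂` then BOTH halves split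
  as boundary sums of fillings of `Γ₁`, `Γ₂` (Eliashberg 1990 filling by discs; Colin 1997) and
  `M = M₁ # M₂` with `Mⱼ` acyclic-Stein-bisected along `Γⱼ` — WLOG the seam is prime; corollary:
  `Σ° × I` (Σ ≠ S³ a ℤHS) carries no Stein structure, so the smooth non-twin bisections
  `S⁴ = (A ♮ B) ∪ (Σ° × I)` (every ℤHS `Σ ⊂ S⁴`) are NOT in the class — the second census entry
  (after lens sums, §5c) where the Stein hypothesis, not homology, is what bites.
* §10b BRIESKORN SEAMS (gen 3, ACM arXiv:2605.13812 / Cavallo arXiv:2605.15095, 2026): `−Σ(a,b,c)`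
  never; `+Σ` with `ξ_can` only in `{Σ(3,4,5), Σ(2,5,7), Σ(2,3,6k+1)}`, where `ξ_can`, `ξ̄_can` are
  the only tight structures and NO ℚHB symplectic filling is known (AK Mazur fillings are not
  symplectic): the Brieskorn sector is empty as far as print knows.
* §11 TRANSPORT & CHARACTERISATION (gen 4, formal): `AcyclicBisection.transport`,
  `acyclicBisection_iff_of_diffeomorph`, `acyclicBisection_of_diffeomorph_sphere`,
  `crux_iff_characterisation`, `counterexample_transport`.
* §12 THE DOUBLE SECTOR (gen 4): `DoubleSector`, `doubleSector_of_crux` (formal, from the sibling's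
  `steinBisection_of_isDouble`), `doubleSector_contractible_of_crux4`; informal theorem: a simply
  connected double `D(W)` of a ℚ-acyclic compact `W` has `W` contractible — the identity-glued
  slice of the crux is the presentation-sphere slice of crux 4, nothing more.
* §12b THREE-SECTOR DECOMPOSITION (gen 4, formal): `SeamCompatible e₁ e₂`;
  `isDouble_of_seamCompatible` (seam-compatible twins present `M` as an `IsDouble` of `W₁`);
  `contactTwins_of_seamCompatible` (and are contact twins); `DoubleLikeSector`,
  `CorkTwistSector`; `doubleLikeSector_iff_doubleSector`;
  **`crux_iff_three_sectors : crux ↔ DoubleSector ∧ CorkTwistSector ∧ NonTwinSector`** and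
  **`stub23_iff_double_and_corkTwist : Stub2 ∧ Stub3 ↔ DoubleSector ∧ CorkTwistSector`** —
  presentation spheres ∧ contact cork twists of doubles ∧ exotic-pair regluings.
* §13 ROUND-2 LEVERS (gen 5). §13a (formal) `DoubleReduction` (card achiral-relator-reduction's
  `C⁺`), `doubleReduction_of_crux` (`W = 𝔻⁴`), `doubleReduction_of_spc4`, `crux_of_doubleReduction`,
  `crux_iff_doubleReduction_of_crux4`. §13b (formal) `complementRecognition` (card
  exchange-recognition's typed lemma = uniqueness of gluings); (informal, checked) exchange lemma,
  `M_Hayden ≅ S⁴`, `Σ_P ≅ S⁴`, `K2′` passes falsifier (2). §13c **`T` FALSE at `k = 5`** (explicit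
  relation in `Mod(P₅,∂)`, disjoint types, `π₁Σ = 1`, seam `S³/Q₈`; 19/153 buckets; Gram analysis:
  silent iff unimodular; escapes (a) no ∂-parallel cycles — DEAD at `k = 6` (372 explicit simply connected boundary-parallel-free pairs, session 2), (b)
  stabilise — unfalsifiable, (c) `det = ±1` only — drops the torsion sector); (formal)
  `MonotoneReducible`, `typeCount`, `typeCount_eq_zero_of_monotoneReducible`,
  `not_monotoneReducible_of_typeCount_ne_zero`. §13d (T6) 324 explicit torsion homotopy spheres
  with aspherical `(ℤ/2)²`-homology-sphere seams.
* §13e (gen 5, session 2) AFTER THE KILL: `T_ℤ` (v2 card, unimodular sector; lattice lemma: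
  `T` fails on the WHOLE torsion sector) and `HN^{stab}` (stable deletion lever) survive; status and
  decisive tests (deep mixed BFS on certified-inequivalent unimodular pairs; the (S2) word after one
  stabilisation — needs a genus MCG engine: ops request `flipper`/`curver`); (formal)
  **first-deletion criterion** `exists_conj_inv_of_monotoneReducible`: a monotone-reducible word has
  letters `x, y` with `y = h x⁻¹ h⁻¹`, `h ∈ ⟨letters⟩` ⇒ some `c′ⱼ ∈ H·cᵢ` — the non-abelian
  necessary condition for `T_ℤ`.

## Why it resists (one paragraph for the provers)

`¬ crux` is literally an exotic `S⁴` (§1), so the adversary can only map the terrain: the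
hypothesis block is honest (§2), `M ≃ₕ S⁴` is the only conjunct whose deletion is refutable (§3),
and inside the statement sit, in increasing difficulty, the seam-`S³` sector (known: Eliashberg +
Cerf), the finite-π₁ sector (inhabited, standard in the one computed case, §5), the contractible
sector = crux 4 ⊇ all presentation spheres (§4, Andrews–Curtis-hard in general but with no exotic
candidate believed), and Gompf's contact cork twists of `S⁴` (arXiv:1603.05090 Q2.2, open) — of
which the positron twist `P ∪_τ P̄` is now an UNCONDITIONAL member (§9d). The picked LINE is more
fragile than the crux: its lever Stub 1 forces contact Stein corks to exist (§9d) and dies by any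
of (Q1)–(Q3) (§9c); the seam census keeps shrinking to twin-type examples (§§5c, 10, 10b).
Structurally (gen 4): the converse of the crux is a theorem and the crux is a CHARACTERISATION
claim invariant under diffeomorphism (§11); it splits as `TwinSector ∧ NonTwinSector` with the
line's residual stubs worth exactly `TwinSector` (§9e); its identity-glued slice is crux 4's
presentation-sphere slice and no more (§12); formally `crux ↔ DoubleSector ∧ CorkTwistSector ∧
NonTwinSector` and `Stub2 ∧ Stub3 ↔ DoubleSector ∧ CorkTwistSector` (§12b): the open core is
(a) presentation spheres, (b) contact cork twists of doubles `W ∪_ĉ W̄` (inhabited: `S³/Q₈`; its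
contractible part inhabited iff contact Stein corks exist), (c) the non-twin sector, empty iff
Stub 1 — and the adversary's kill candidates all sit in (c).
Gen 5: (c) is inhabited but its inhabitant is the round sphere (exchange pair, §13b), as are the
symmetric cork twists of (b); the round-2 lever that could die cheaply (`T`) did, at `k = 5` in the
torsion sector, on spheres that are almost certainly standard; the other (`w = 1` / exchange normal
form) survives its first torsion test by §5d. What is left for the adversary are the aspherical-seam
torsion spheres (T6) and Gompf's `f^k` twists; what is left for provers is unchanged since gen 1:
presentation spheres, contact cork twists, and now explicitly non-twin gluings — all of `S⁴`.
-/

noncomputable section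

open scoped Manifold ContDiff Topology ContinuousMap
open Set Function
open Literature.Geometry.Symplectic Literature.AlgebraicTopology.SingularHomology CategoryTheory.Limits

-- The namespace is prescribed by the crux protocol (`Summit.<P>.<Sub>.Cruxes.<Crux>.Disproof`
-- with `P = Sub = SmoothPoincare4`), hence the duplicated component.
set_option linter.dupNamespace false

namespace Summit.SmoothPoincare4.SmoothPoincare4.Cruxes.AcyclicBisectionRigidity.Disproof

open Summit.SmoothPoincare4.SmoothPoincare4.Theses

/-- Local notation: the round 4-sphere with its Mathlib manifold structure. -/
local notation "𝕊⁴" => (Metric.sphere (0 : EuclideanSpace ℝ (Fin 5)) 1)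

/-- Local notation: the model space `ℝ⁴`. -/
local notation "E4" => EuclideanSpace ℝ (Fin 4)

/-! ## §0 The hypothesis, verbatim -/

/-- **The bisection hypothesis of the crux, verbatim**: `M` is covered by two smoothly embedded
compact Stein domains meeting exactly along the images of their boundaries, with equal
pushed-forward complex tangencies on the seam, both halves ℚ-acyclic in positive degrees.
[planner, route ConvexBisection rev 2] -/
def AcyclicBisection (M : Type) [TopologicalSpace M] [ChartedSpace E4 M] : Prop :=
  ∃ (W₁ : Type) (_ : TopologicalSpace W₁) (_ : ChartedSpace (EuclideanHalfSpace 4) W₁)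
    (_ : IsManifold (𝓡∂ 4) ∞ W₁) (_ : CompactSpace W₁) (W₂ : Type) (_ : TopologicalSpace W₂)
    (_ : ChartedSpace (EuclideanHalfSpace 4) W₂) (_ : IsManifold (𝓡∂ 4) ∞ W₂) (_ : CompactSpace W₂)
    (J₁ : SteinStructure W₁) (J₂ : SteinStructure W₂) (e₁ : W₁ → M) (e₂ : W₂ → M),
    Manifold.IsSmoothEmbedding (𝓡∂ 4) (𝓡 4) ∞ e₁ ∧ Manifold.IsSmoothEmbedding (𝓡∂ 4) (𝓡 4) ∞ e₂ ∧
    Set.range e₁ ∪ Set.range e₂ = Set.univ ∧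
    Set.range e₁ ∩ Set.range e₂ = e₁ '' (𝓡∂ 4).boundary W₁ ∧
    Set.range e₁ ∩ Set.range e₂ = e₂ '' (𝓡∂ 4).boundary W₂ ∧
    (∀ w₁ w₂, e₁ w₁ = e₂ w₂ →
      Submodule.map (mfderiv (𝓡∂ 4) (𝓡 4) e₁ w₁).toLinearMap (contactPlane J₁.J w₁) =
      Submodule.map (mfderiv (𝓡∂ 4) (𝓡 4) e₂ w₂).toLinearMap (contactPlane J₂.J w₂)) ∧
    (∀ k, 0 < k → IsZero (singularHomology ℚ ℚ W₁ k) ∧ IsZero (singularHomology ℚ ℚ W₂ k))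

/-- The crux is, definitionally, "`M ≃ₕ S⁴` and an acyclic bisection give `M ≅ S⁴`". -/
theorem crux_iff :
    ConvexBisection.AcyclicBisectionRigidity ↔
      ∀ (M : Type) [TopologicalSpace M] [T2Space M] [SecondCountableTopology M]
        [ChartedSpace E4 M] [IsManifold (𝓡 4) ∞ M],
        M ≃ₕ 𝕊⁴ → AcyclicBisection M → Nonempty (M ≃ₘ⟮𝓡 4, 𝓡 4⟯ 𝕊⁴) :=
  Iff.rfl

/-! ## §1 Resistance: the crux is SPC4-shielded -/

/-- **Every** statement "`∀ M ≃ₕ S⁴, P M → M ≅ S⁴`" follows from the summit, whatever `P` is.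
Consequence for the load-bearing analysis: deleting ANY conjunct of the bisection hypothesis
(Stein, contact matching, acyclicity, embedding, covering or seam conditions) yields a statement
that is still implied by SPC4 and therefore cannot be refuted short of an exotic 4-sphere. -/
theorem shielded_of_spc4 (P : ∀ (M : Type) [TopologicalSpace M] [ChartedSpace E4 M], Prop)
    (h : SmoothPoincare4) :
    ∀ (M : Type) [TopologicalSpace M] [T2Space M] [SecondCountableTopology M]
      [ChartedSpace E4 M] [IsManifold (𝓡 4) ∞ M],
      M ≃ₕ 𝕊⁴ → P M → Nonempty (M ≃ₘ⟮𝓡 4, 𝓡 4⟯ 𝕊⁴) :=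
  fun M _ _ _ _ _ e _ => h M inferInstance inferInstance e

/-- The crux follows from the summit (kill criterion of the route: a refutation of the crux is an
exotic `S⁴`). -/
theorem of_spc4 (h : SmoothPoincare4) : ConvexBisection.AcyclicBisectionRigidity :=
  shielded_of_spc4 (fun M _ _ => AcyclicBisection M) h

/-- Contrapositive: refuting the crux refutes the smooth 4-dimensional Poincaré conjecture. -/
theorem not_spc4_of_not (h : ¬ ConvexBisection.AcyclicBisectionRigidity) : ¬ SmoothPoincare4 :=
  mt of_spc4 h

/-- A counterexample to the crux is an exotic 4-sphere carrying an acyclic Stein bisection. -/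
theorem exotic_of_not (h : ¬ ConvexBisection.AcyclicBisectionRigidity) :
    ∃ (M : Type) (_ : TopologicalSpace M) (_ : T2Space M) (_ : SecondCountableTopology M)
      (_ : ChartedSpace E4 M) (_ : IsManifold (𝓡 4) ∞ M),
      Nonempty (M ≃ₕ 𝕊⁴) ∧ AcyclicBisection M ∧ IsEmpty (M ≃ₘ⟮𝓡 4, 𝓡 4⟯ 𝕊⁴) := by
  by_contra hc
  refine h fun M _ _ _ _ _ e hb => ?_
  by_contra hne
  exact hc ⟨M, inferInstance, inferInstance, inferInstance, inferInstance, inferInstance, ⟨e⟩, hb,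
    not_nonempty_iff.mp hne⟩

/-- Given the sibling crux `AcyclicBisectionExists` (every homotopy 4-sphere HAS an acyclic
bisection), the crux is equivalent to the summit: the route is tight, and the crux is then exactly
as hard as SPC4. (`←` is `of_spc4`; `→` is the route's deciding theorem `ConvexBisection.closes`.) -/
theorem iff_spc4_of_exists (hE : ConvexBisection.AcyclicBisectionExists) :
    ConvexBisection.AcyclicBisectionRigidity ↔ SmoothPoincare4 :=
  ⟨fun hR => ConvexBisection.closes hE hR, of_spc4⟩

/-- **Normal form.** It suffices to prove the crux for COMPACT, PATH-CONNECTED (hence nonempty)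
`M`: both properties follow from `M ≃ₕ S⁴` by PROVED tree facts
(`compactSpace_of_homotopyEquiv_sphere_four_holds`, `pathConnectedSpace_of_homotopyEquiv`), so a
prover may assume them at no cost — and the adversary gains nothing from non-compact or
disconnected `M`. -/
def NormalForm : Prop :=
  ∀ (M : Type) [TopologicalSpace M] [T2Space M] [SecondCountableTopology M]
    [ChartedSpace E4 M] [IsManifold (𝓡 4) ∞ M] [CompactSpace M] [PathConnectedSpace M],
    M ≃ₕ 𝕊⁴ → AcyclicBisection M → Nonempty (M ≃ₘ⟮𝓡 4, 𝓡 4⟯ 𝕊⁴)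

/-- The crux is equivalent to its normal form. -/
theorem crux_iff_normalForm : ConvexBisection.AcyclicBisectionRigidity ↔ NormalForm := by
  refine ⟨fun h M _ _ _ _ _ _ _ e hb => h M e hb, fun h M _ _ _ _ _ e hb => ?_⟩
  haveI : CompactSpace M :=
    Literature.Topology.FourManifolds.compactSpace_of_homotopyEquiv_sphere_four_holds M e
  haveI := Literature.Topology.FourManifolds.pathConnectedSpace_sphere_four
  haveI : PathConnectedSpace M :=
    Literature.Topology.FourManifolds.pathConnectedSpace_of_homotopyEquiv e
  exact h M e hb

/-! ## §2 Junk exclusion: the hypothesis is honest -/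

section Junk

variable {W : Type} [TopologicalSpace W] [ChartedSpace (EuclideanHalfSpace 4) W]
  [IsManifold (𝓡∂ 4) ∞ W] [CompactSpace W]

/-- A Stein structure on a compact NONEMPTY `W` has a boundary point (`φ` attains its maximum
exactly on `∂W`; tree lemma `SteinStructure.exists_isBoundaryPoint`): the boundary is nonempty. -/
theorem boundary_nonempty_of_steinStructure [Nonempty W] (S : SteinStructure W) :
    ((𝓡∂ 4).boundary W).Nonempty :=
  S.exists_isBoundaryPoint

/-- Hence there is NO Stein structure on a compact nonempty `W` without boundary points (a closed
4-manifold re-charted on the half-space): the degenerate readings "`W₂` closed", "`M = M ∪ ∅`" of a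
Stein bisection are excluded by `SteinStructure.boundary_eq` itself. -/
theorem steinStructure_isEmpty_of_boundary_empty [Nonempty W] (h : (𝓡∂ 4).boundary W = ∅) :
    IsEmpty (SteinStructure W) :=
  ⟨fun S => by simpa [h] using boundary_nonempty_of_steinStructure S⟩

omit [IsManifold (𝓡∂ 4) ∞ W] in
/-- The one junk inhabitant: on the EMPTY carrier every field of `SteinStructure` is vacuous
(tree: `isSteinDomain_of_isEmpty`). -/
def steinStructureOfIsEmpty [IsEmpty W] : SteinStructure W where
  J x := isEmptyElim x
  φ x := isEmptyElim x
  J_sq x := isEmptyElim x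
  J_smooth _ _ x := isEmptyElim x
  integrable _ _ _ _ x := isEmptyElim x
  φ_smooth x := isEmptyElim x
  convex x := isEmptyElim x
  boundary_eq x := isEmptyElim x
  regular x := isEmptyElim x

/-- In a Stein bisection of a NONEMPTY `M` the first half is nonempty: otherwise the second half
covers `M`, is nonempty, and the seam condition forces its boundary to be empty, contradicting
`boundary_nonempty_of_steinStructure`. (Only the covering and ONE seam condition are used.) -/
theorem left_nonempty {M W₁ W₂ : Type} [Nonempty M] [TopologicalSpace W₂]
    [ChartedSpace (EuclideanHalfSpace 4) W₂] [IsManifold (𝓡∂ 4) ∞ W₂] [CompactSpace W₂]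
    (J₂ : SteinStructure W₂) (e₁ : W₁ → M) (e₂ : W₂ → M)
    (hcover : range e₁ ∪ range e₂ = univ)
    (hseam : range e₁ ∩ range e₂ = e₂ '' (𝓡∂ 4).boundary W₂) : Nonempty W₁ := by
  by_contra h
  haveI : IsEmpty W₁ := not_nonempty_iff.mp h
  have h₁ : range e₁ = ∅ := range_eq_empty e₁
  rw [h₁, empty_union] at hcover
  rw [h₁, empty_inter, eq_comm, image_eq_empty] at hseam
  haveI : Nonempty W₂ := by
    obtain ⟨m⟩ := ‹Nonempty M›
    obtain ⟨w, -⟩ := (hcover ▸ mem_univ m : m ∈ range e₂)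
    exact ⟨w⟩
  simpa [hseam] using boundary_nonempty_of_steinStructure J₂

/-- Symmetrically, the second half is nonempty. -/
theorem right_nonempty {M W₁ W₂ : Type} [Nonempty M] [TopologicalSpace W₁]
    [ChartedSpace (EuclideanHalfSpace 4) W₁] [IsManifold (𝓡∂ 4) ∞ W₁] [CompactSpace W₁]
    (J₁ : SteinStructure W₁) (e₁ : W₁ → M) (e₂ : W₂ → M)
    (hcover : range e₁ ∪ range e₂ = univ)
    (hseam : range e₁ ∩ range e₂ = e₁ '' (𝓡∂ 4).boundary W₁) : Nonempty W₂ :=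
  left_nonempty J₁ e₂ e₁ (by rwa [union_comm]) (by rwa [inter_comm])

/-- And the seam is nonempty (it is the image of the nonempty boundary of the first half). -/
theorem seam_nonempty {M W₁ W₂ : Type} [Nonempty M] [TopologicalSpace W₁]
    [ChartedSpace (EuclideanHalfSpace 4) W₁] [IsManifold (𝓡∂ 4) ∞ W₁] [CompactSpace W₁]
    [TopologicalSpace W₂] [ChartedSpace (EuclideanHalfSpace 4) W₂] [IsManifold (𝓡∂ 4) ∞ W₂]
    [CompactSpace W₂] (J₁ : SteinStructure W₁) (J₂ : SteinStructure W₂)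
    (e₁ : W₁ → M) (e₂ : W₂ → M) (hcover : range e₁ ∪ range e₂ = univ)
    (hseam₁ : range e₁ ∩ range e₂ = e₁ '' (𝓡∂ 4).boundary W₁)
    (hseam₂ : range e₁ ∩ range e₂ = e₂ '' (𝓡∂ 4).boundary W₂) :
    (range e₁ ∩ range e₂).Nonempty := by
  haveI := left_nonempty J₂ e₁ e₂ hcover hseam₂
  rw [hseam₁]
  exact (boundary_nonempty_of_steinStructure J₁).image e₁

end Junk

/-! ## §3 Load-bearing hypotheses -/

/-- The empty map out of an empty manifold is a smooth embedding (vacuous immersion, embedding of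
a subsingleton). -/
theorem isSmoothEmbedding_of_isEmpty {M W : Type} [TopologicalSpace M] [ChartedSpace E4 M]
    [TopologicalSpace W] [ChartedSpace (EuclideanHalfSpace 4) W] [IsEmpty W] (e : W → M) :
    Manifold.IsSmoothEmbedding (𝓡∂ 4) (𝓡 4) ∞ e :=
  ⟨⟨E4, inferInstance, inferInstance, fun x => isEmptyElim x⟩,
    Topology.IsEmbedding.of_subsingleton e⟩

/-- **The empty manifold carries an acyclic Stein bisection** (two empty halves): every conjunct
is vacuous or an equation between subsets of an empty type, and `H_k(∅; ℚ) = 0`. -/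
theorem acyclicBisection_of_isEmpty (M : Type) [TopologicalSpace M] [ChartedSpace E4 M]
    [IsEmpty M] : AcyclicBisection M := by
  letI : ChartedSpace (EuclideanHalfSpace 4) Empty := ChartedSpace.empty _ _
  refine ⟨Empty, inferInstance, inferInstance, inferInstance, inferInstance,
    Empty, inferInstance, inferInstance, inferInstance, inferInstance,
    steinStructureOfIsEmpty, steinStructureOfIsEmpty, Empty.elim, Empty.elim,
    isSmoothEmbedding_of_isEmpty _, isSmoothEmbedding_of_isEmpty _,
    Subsingleton.elim _ _, Subsingleton.elim _ _, Subsingleton.elim _ _,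
    fun w => w.elim, fun k hk => ⟨?_, ?_⟩⟩ <;>
  exact isZero_singularHomology_of_subsingleton ℚ ℚ hk.ne'

/-- **The crux with the hypothesis `M ≃ₕ S⁴` deleted.** -/
def WithoutHomotopyEquiv : Prop :=
  ∀ (M : Type) [TopologicalSpace M] [T2Space M] [SecondCountableTopology M]
    [ChartedSpace E4 M] [IsManifold (𝓡 4) ∞ M],
    AcyclicBisection M → Nonempty (M ≃ₘ⟮𝓡 4, 𝓡 4⟯ 𝕊⁴)

/-- A point of the round 4-sphere. -/
def northPole : 𝕊⁴ :=
  ⟨EuclideanSpace.single 0 1, by simp⟩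

/-- **`M ≃ₕ S⁴` is load-bearing: any proof must use it.** Witness: the empty 4-manifold with its
empty acyclic Stein bisection is not diffeomorphic to `S⁴`. (Degenerate witness; the honest ones
— `S⁴ ⊔ S⁴`, and the double `D(B_{p,q})` of a Stein rational ball, `π₁ = ℤ/p` — are recorded in
`withoutHomotopyEquivConnected_false`, not formalisable with the present Literature.)
[refuter cdisprove, gen 1 v1 (re-derived gen 2)] -/
theorem false_without_homotopyEquiv : ¬ WithoutHomotopyEquiv := by
  intro h
  letI : ChartedSpace E4 Empty := ChartedSpace.empty _ _
  obtain ⟨e⟩ := h Empty (acyclicBisection_of_isEmpty Empty)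
  exact (e.symm northPole).elim

/-- The same deletion with the degenerate witnesses excluded: `M` nonempty, connected, compact.
FALSE on paper — `M = D(B_{p,q}) = B_{p,q} ∪_id B̄_{p,q}`, the double of the Stein rational ball
`B_{p,q}` (Lekili–Maydanskiy, arXiv:1202.5625, Thm 1.1: `B_{p,q}` carries a Stein structure; the
identity gluing matches the complex tangencies tautologically; `H_k(B_{p,q};ℚ) = 0`, `k > 0`;
`π₁ D(B_{p,q}) = ℤ/p ≠ 1`, so `D(B_{p,q}) ≄ S⁴`). Not formalisable now (no rational ball, no
gluing of manifolds with boundary in the tree); recorded as a wanted proof, not a `sorry`. -/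
def WithoutHomotopyEquivConnected : Prop :=
  ∀ (M : Type) [TopologicalSpace M] [T2Space M] [SecondCountableTopology M]
    [ChartedSpace E4 M] [IsManifold (𝓡 4) ∞ M] [Nonempty M] [ConnectedSpace M] [CompactSpace M],
    AcyclicBisection M → Nonempty (M ≃ₘ⟮𝓡 4, 𝓡 4⟯ 𝕊⁴)

/-- Wanted (informally refuted above): `¬ WithoutHomotopyEquivConnected`. -/
proof_wanted withoutHomotopyEquivConnected_false : ¬ WithoutHomotopyEquivConnected

/-- **Deleting ℚ-acyclicity collapses the crux onto the summit** modulo the KNOWN support item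
`SteinBisectionExists` (Baykur 2006 Thm 5.1 / Breen 2023 Thm 1.6): the mutation "without
acyclic" is SPC4 in a costume, so ℚ-acyclicity is the only conjunct that separates the crux from
the summit (generation-1 rattack lemma `mutation_drop_acyclic_collapses_to_spc4`, re-derived). -/
def WithoutAcyclic : Prop :=
  ∀ (M : Type) [TopologicalSpace M] [T2Space M] [SecondCountableTopology M]
    [ChartedSpace E4 M] [IsManifold (𝓡 4) ∞ M], M ≃ₕ 𝕊⁴ →
    (∃ (W₁ : Type) (_ : TopologicalSpace W₁) (_ : ChartedSpace (EuclideanHalfSpace 4) W₁)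
      (_ : IsManifold (𝓡∂ 4) ∞ W₁) (_ : CompactSpace W₁) (W₂ : Type) (_ : TopologicalSpace W₂)
      (_ : ChartedSpace (EuclideanHalfSpace 4) W₂) (_ : IsManifold (𝓡∂ 4) ∞ W₂) (_ : CompactSpace W₂)
      (J₁ : SteinStructure W₁) (J₂ : SteinStructure W₂) (e₁ : W₁ → M) (e₂ : W₂ → M),
      Manifold.IsSmoothEmbedding (𝓡∂ 4) (𝓡 4) ∞ e₁ ∧ Manifold.IsSmoothEmbedding (𝓡∂ 4) (𝓡 4) ∞ e₂ ∧
      Set.range e₁ ∪ Set.range e₂ = Set.univ ∧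
      Set.range e₁ ∩ Set.range e₂ = e₁ '' (𝓡∂ 4).boundary W₁ ∧
      Set.range e₁ ∩ Set.range e₂ = e₂ '' (𝓡∂ 4).boundary W₂ ∧
      (∀ w₁ w₂, e₁ w₁ = e₂ w₂ →
        Submodule.map (mfderiv (𝓡∂ 4) (𝓡 4) e₁ w₁).toLinearMap (contactPlane J₁.J w₁) =
        Submodule.map (mfderiv (𝓡∂ 4) (𝓡 4) e₂ w₂).toLinearMap (contactPlane J₂.J w₂))) →
    Nonempty (M ≃ₘ⟮𝓡 4, 𝓡 4⟯ 𝕊⁴)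

/-- `WithoutAcyclic ∧ SteinBisectionExists → SmoothPoincare4` (and conversely
`SmoothPoincare4 → WithoutAcyclic` by `shielded_of_spc4`). -/
theorem collapse_without_acyclic (h : WithoutAcyclic) (hB : ConvexBisection.SteinBisectionExists) :
    SmoothPoincare4 :=
  fun M _ _ _ _ _ e => h M e (hB M e)

/-- Converse direction of the collapse. -/
theorem withoutAcyclic_of_spc4 (h : SmoothPoincare4) : WithoutAcyclic :=
  fun M _ _ _ _ _ e _ => h M inferInstance inferInstance e

/-! ## §4 Sectors: contractible halves (crux 4) and presentation spheres -/

/-- Contractible spaces are ℚ-acyclic in positive degrees — now the TREE lemma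
`Literature.AlgebraicTopology.SingularHomology.isZero_singularHomology_of_contractibleSpace`
(homotopy invariance + `Hₙ(pt) = 0`); re-exported under the generation-2 name. -/
theorem isZero_singularHomology_of_contractible (W : Type) [TopologicalSpace W]
    [ContractibleSpace W] {n : ℕ} (hn : n ≠ 0) : IsZero (singularHomology ℚ ℚ W n) :=
  isZero_singularHomology_of_contractibleSpace ℚ ℚ (X := W) hn

/-- **The contractible sector of the crux** (= crux 4 `ContractibleTwistedDoubleStandard`
restricted to homotopy 4-spheres): common-contact Stein bisections with CONTRACTIBLE halves. -/
def ContractibleSector : Prop :=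
  ∀ (M : Type) [TopologicalSpace M] [T2Space M] [SecondCountableTopology M]
    [ChartedSpace E4 M] [IsManifold (𝓡 4) ∞ M], M ≃ₕ 𝕊⁴ →
    (∃ (W₁ : Type) (_ : TopologicalSpace W₁) (_ : ChartedSpace (EuclideanHalfSpace 4) W₁)
      (_ : IsManifold (𝓡∂ 4) ∞ W₁) (_ : CompactSpace W₁) (_ : ContractibleSpace W₁)
      (W₂ : Type) (_ : TopologicalSpace W₂) (_ : ChartedSpace (EuclideanHalfSpace 4) W₂)
      (_ : IsManifold (𝓡∂ 4) ∞ W₂) (_ : CompactSpace W₂) (_ : ContractibleSpace W₂)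
      (J₁ : SteinStructure W₁) (J₂ : SteinStructure W₂) (e₁ : W₁ → M) (e₂ : W₂ → M),
      Manifold.IsSmoothEmbedding (𝓡∂ 4) (𝓡 4) ∞ e₁ ∧ Manifold.IsSmoothEmbedding (𝓡∂ 4) (𝓡 4) ∞ e₂ ∧
      Set.range e₁ ∪ Set.range e₂ = Set.univ ∧
      Set.range e₁ ∩ Set.range e₂ = e₁ '' (𝓡∂ 4).boundary W₁ ∧
      Set.range e₁ ∩ Set.range e₂ = e₂ '' (𝓡∂ 4).boundary W₂ ∧
      (∀ w₁ w₂, e₁ w₁ = e₂ w₂ →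
        Submodule.map (mfderiv (𝓡∂ 4) (𝓡 4) e₁ w₁).toLinearMap (contactPlane J₁.J w₁) =
        Submodule.map (mfderiv (𝓡∂ 4) (𝓡 4) e₂ w₂).toLinearMap (contactPlane J₂.J w₂))) →
    Nonempty (M ≃ₘ⟮𝓡 4, 𝓡 4⟯ 𝕊⁴)

/-- crux ⇒ contractible sector (contractible halves are ℚ-acyclic). So an exotic homotopy sphere
of the form `W₁ ∪_ψ W̄₂` with `Wᵢ` contractible Stein and `ψ` a contactomorphism of the induced
structures — a Stein-compatible cork re-gluing, Gompf arXiv:1603.05090 Q2.2 — kills the crux. -/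
theorem contractibleSector_of_crux (h : ConvexBisection.AcyclicBisectionRigidity) :
    ContractibleSector := by
  intro M _ _ _ _ _ e hb
  obtain ⟨W₁, _, _, _, _, _, W₂, _, _, _, _, _, J₁, J₂, e₁, e₂, h₁, h₂, hc, hs₁, hs₂, hξ⟩ := hb
  exact h M e ⟨W₁, _, _, _, _, W₂, _, _, _, _, J₁, J₂, e₁, e₂, h₁, h₂, hc, hs₁, hs₂, hξ,
    fun k hk => ⟨isZero_singularHomology_of_contractible W₁ hk.ne',
      isZero_singularHomology_of_contractible W₂ hk.ne'⟩⟩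

/-- crux 4 ⇒ contractible sector (a homotopy 4-sphere is compact — the PROVED tree fact
`compactSpace_of_homotopyEquiv_sphere_four_holds` — so crux 4's closed-manifold hypotheses are
met). Together with `contractibleSector_of_crux`: `ContractibleSector` is a common consequence of
cruxes 2 and 4, and is the place where both die if a Stein-compatible exotic cork twist exists. -/
theorem contractibleSector_of_crux4 (h : ConvexBisection.ContractibleTwistedDoubleStandard) :
    ContractibleSector := by
  intro M _ _ _ _ _ e hb
  obtain ⟨W₁, _, _, _, _, _, W₂, _, _, _, _, _, J₁, J₂, e₁, e₂, h₁, h₂, hc, hs₁, hs₂, hξ⟩ := hb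
  haveI : CompactSpace M :=
    Literature.Topology.FourManifolds.compactSpace_of_homotopyEquiv_sphere_four_holds M e
  exact h M W₁ W₂ J₁ J₂ e₁ e₂ h₁ h₂ hc hs₁ hs₂ hξ

/-! ### §4b Presentation spheres (informal theorem; typed elsewhere)

**Claim (ideator evidence E1, re-verified by this seat).** For every balanced presentation `P` of
the trivial group and framing vector `ε ∈ (ℤ/2)^r` there is a compact CONTRACTIBLE STEIN
2-handlebody `W` with `W × I ≅ H⁵(P, ε)`, hence `D(W) = W ∪_id W̄ = ∂(W × I) = Σ(P, ε)`.
*Proof sketch.* In `∂(♮ᵍ S¹ × B³) = #ᵍ S¹ × S²` with its standard Stein-fillable structure, every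
free homotopy class of loops contains Legendrian knots, and Legendrian stabilisation lowers `tb`
by one; attach the `r = g` two-handles along Legendrian representatives of the relator classes
with framing `tb − 1` (Gompf 1998 Thm 1.3 ⇒ `W` Stein), choosing the parity of `tb − 1` so that the
induced 5-dimensional framing (`π₁ SO(3) = ℤ/2`) is `εᵢ`. In dimension 5 attaching circles are
determined by their homotopy classes, so `W × I ≅ H⁵(P, ε)` whatever the knotting/linking chosen in
dimension 4; `π₁ W = ⟨P⟩ = 1`, `χ(W) = 1 − g + r = 1` and `H₁ W = 0` give `H₂ W = 0`, so `W` is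
contractible. The double `D(W)` is an acyclic common-contact Stein bisection in the sense of
`AcyclicBisection` (both halves `(W, J)`, `e₁|∂W = e₂|∂W`, so the pushed-forward complex
tangencies coincide). ∎
**Consequence.** `AcyclicBisectionRigidity ⇒ ContractibleSector ⇒` (its `ψ = id` slice) `⇒`
every presentation sphere `Σ(P, ε)` is `S⁴` — the statement typed as
`ConvexityLadder.PresentationSpheresStandard` / `EntropyLadder.PresentationSpheresStandard`
(item stmt-SmoothPoincare4-3717, open; known for Andrews–Curtis-trivial `P` and for the
Akbulut–Kirby family by Gompf 1991). So the crux is at least Andrews–Curtis-hard in the sense of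
`Literature.Barriers.SmoothPoincare4.StrictPropertyTwoRBarrier`'s neighbourhood, although no
presentation sphere is believed exotic. Not formalisable now (needs Gompf's Legendrian criterion
as a named fact and `W × I` bookkeeping between `𝓡∂ 4` and `𝓡∂ 5` handlebodies). -/

/-! ## §5 Census of the finite-π₁ sector (generation 1, informal; bookkeeping re-proved) -/

/-- **Group-theoretic content of the lens-seam exclusion.** In an acyclic bisection of a
homology 4-sphere, Mayer–Vietoris gives `H₁(Γ) ≅ H₁(W₁) ⊕ H₁(W₂)` and the linking form forces
`|H₁(W₁)| = |H₁(W₂)|`, `|H₁(Γ)| = |H₁(Wᵢ)|²`; a lens space seam `L(m, q)` would need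
`ℤ/m ≅ A × B` with `|A| = |B|`, `|A|² = m`. The lemma: `ℤ/n²` is not isomorphic to a product of
two finite abelian groups of order `n > 1` (the generator has order `n²`, every element of the
product is killed by `n`). [generation 1 `zmod_sq_not_prod`, re-proved] -/
theorem zmod_sq_not_prod {n : ℕ} (hn : 1 < n) (A B : Type) [AddCommGroup A] [AddCommGroup B]
    [Fintype A] [Fintype B] (hA : Fintype.card A = n) (hB : Fintype.card B = n) :
    IsEmpty (ZMod (n ^ 2) ≃+ A × B) := by
  refine ⟨fun e => ?_⟩
  have h1 : addOrderOf (e 1) = n ^ 2 := by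
    rw [AddEquiv.addOrderOf_eq e, ZMod.addOrderOf_one]
  have h2 : addOrderOf (e 1) ∣ n := by
    refine addOrderOf_dvd_of_nsmul_eq_zero ?_
    ext
    · simpa [hA] using card_nsmul_eq_zero (x := (e 1).1)
    · simpa [hB] using card_nsmul_eq_zero (x := (e 1).2)
  rw [h1] at h2
  have : n ^ 2 ≤ n := Nat.le_of_dvd (by omega) h2
  nlinarith

/-! ### §5b The sector is inhabited (generation 1, vv3–5; informal, all inputs in print)

`S⁴ = ℂP²/conj = N₋₂(ℝP²) ∪_{S³/Q₈} N₊₂(ℝP²)` is a smooth ℚ-acyclic bisection of the ROUND sphere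
with `π₁ = ℤ/2` halves; `N₋₂(ℝP²)` is Gompf's Stein surface `X₁` (Gompf 1998, Ex. 4.14,
arXiv:math/9803019 p. 22: `∂X₁ = S³/Q₈`), `N₊₂(ℝP²)` is not Stein, but re-gluing `X₁ ∪_ψ X̄₁` by a
contactomorphism `ψ` in the mapping class of a transposition of two exceptional fibres of
`M(−1; ½, ½, ½)` (it fixes the `Spin^c` class of the tight structure and moves the kernel line
`ker(H₁ ∂ → H₁ X₁)`; Ghiggini–Lisca–Stipsicz arXiv:math/0509714 Cor. 4.11: three tight structures,
classified by `Spin^c`, all Stein fillable and contactomorphic) gives a HOMOTOPY 4-SPHERE carrying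
an `AcyclicBisection` with finite non-trivial `π₁` halves — and it is `S⁴` (Price 1977 /
Kim–Miller arXiv:1805.00429 §3.1: the outcomes are `S⁴`, the Gluck-type twist and the Price twist of
the unknotted `ℝP²`, all standard). Spherical candidate seams (Choe–Park arXiv:1803.08749 Thm 1.1):
lens spaces and `I₄₉` die by `zmod_sq_not_prod`, `T₃`, `T₂₇` by non-square `|H₁|`, leaving the
prism family `{±D(p,q)}` with `H₁ ≅ (ℤ/2)²`-type splittings, first member `S³/Q₈` (passes).
**Lessons for provers.** (i) The route's foreseen glue R-b ("finite-π₁ halves cannot occur") is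
FALSE as stated; (ii) `|H₁|` counting cannot empty the sector — contact matching bites only through
`Spin^c` / `Γ`-invariants of the plane field; (iii) for `PlanarBisectionRigidity` the gluing
contactomorphism may be a non-trivial symmetry of the boundary open book (the untwisted double of
`X₁` is not simply connected). **Residual question (v5).** Is `N₋₂(ℝP²)` the unique ℚ-acyclic
Stein filling of `(M(−1;½,½,½), ξ₁)` rel boundary? If yes the `S³/Q₈` sector is standard; if no,
`X₁ ∪_id W̄′` is a genuine test homotopy sphere. (Generation 2, read at page level: the paper
the route cites as arXiv:2004.07405 is Etnyre–Tosun, *Homology spheres bounding acyclic smooth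
manifolds and symplectic fillings*, Michigan Math. J. 2022 — it does not treat `S³/Q₈`; what it
does give is recorded in §5c. The uniqueness question stays open in our reading.)

### §5c More census facts from print (generation 2)

* **Lens-sum seams are smoothly present and Stein-absent.** For `p` odd the punctured lens space
  embeds in `S⁴` (Epstein, Zeeman), so `S⁴ = ν(L(p,q)°) ∪ (complement)` is a SMOOTH ℚ-acyclic
  bisection of the round sphere with seam `L(p,q) # L(p,p−q)` and `H₁` of both halves `ℤ/p`
  (Fintushel–Stern / Gilmer–Livingston: these are all the lens sums in `S⁴`); but Etnyre–Tosun
  2022, Thm 8 (arXiv:2004.07405 p. 5): *"No contact structure on `L(p,q)#L(p,p−q)` has a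
  symplectic filling by a rational homology ball"* (Remark 9: likewise for every sum of lens
  spaces `Y # −Y` embedding in `ℝ⁴`, Donald). So NEITHER half of such a bisection is Stein for ANY
  contact structure: here "Stein" removes a whole smooth sector that homology allows — the first
  place in the census where the Stein hypothesis, not `|H₁|` counting and not contact matching,
  is what bites. (Prop. 10 there, also Fossati and Golla–Starkston: a ℚHB symplectic filling of
  a lens space induces `ξ_std`.)
* **Brieskorn seams in the contractible sector are constrained, with orientation.** A twisted
  double `W₁ ∪_ψ W̄₂` needs both `Wᵢ` to be Stein fillings of the SAME oriented `(Γ, ξ)`.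
  Mark–Tosun 2018 (arXiv:1603.07710), Cor. 1.4 (p. 3): *"No acyclic oriented 4-manifold with
  boundary `−Σ(2,3,12n+1)` admits a Stein structure"* (θ-count: every Stein structure on an
  acyclic filling has `θ = c₁² − 3σ − 2χ = −2`, while all tight structures on `−Σ(2,3,6m+1)`
  have `θ = 2`, Thm 1.6), so `−Σ(2,3,12n+1)` is never such a seam, whereas `+Σ(2,3,6m+1)` has two
  tight structures, both Stein fillable with `θ = −2` (Thm 1.7) and is not excluded by homotopy
  data; Thm 1.8: the Akbulut–Kirby Mazur filling of `Σ(2,3,13)` is Stein in NEITHER orientation.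
  Gompf's Conjecture 1.1 (ibid.): no Brieskorn sphere, with either orientation, has a
  pseudoconvex embedding in `ℂ²` — this would exclude every Brieskorn seam whose halves are Stein
  of Mazur type (more generally with an Andrews–Curtis-trivial handle presentation: such
  contractible manifolds embed in `ℂ²` and Gompf's isotopy theorem makes a Stein one
  pseudoconvex, Mark–Tosun p. 3). (The Akbulut cork's boundary is hyperbolic — `+1` surgery on
  the pretzel knot `P(−3,3,−3)`, Etnyre–Tosun p. 4 — not a Brieskorn sphere.)
* **The planar ∩ contractible sector is infinite already with four binding components.** Oba
  2014, Thm 1.1 (arXiv:1405.3751 p. 3): infinitely many pairwise non-diffeomorphic contact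
  homology spheres `(M_n, ξ_n)`, each supported by an open book with page the 4-holed sphere and
  Stein-filled by a MAZUR-TYPE contractible manifold `X_n`. So the route's table "k = 4 ↦ B(2,1)
  (lantern)" is not exhaustive: `k = 4, n = 3` vanishing cycles also give contractible non-ball
  halves, and `D(X_n) = S⁴` (Mazur type) are planar acyclic bisections of the round sphere with
  seam `M_n ≠ S³`. Filling uniqueness for `(M_n, ξ_n)` = classification of length-3 positive
  factorisations of `φ_n ∈ Mod(P₄, ∂)` up to Hurwitz moves and conjugation (Wendl) — the
  smallest machine-checkable instance of the ideators' minimal-factorisation rigidity. -/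

/-! ### §5d Small Seifert torsion seams: a computed census (generation 4; `seifert_census.py`)

**What was computed** (script `seifert_census.py` + logs `census_a7.log`, `census_f4_a4.log`,
attached as item evidence; pure Python, run in-session, < 10 min). For every Seifert fibred ℚHS
`Y = S²(e₀; b₁/a₁, b₂/a₂, b₃/a₃)` with `aᵢ ≤ 7`, `−9 ≤ e₀ ≤ 7` (both orientations; the one with
`e < 0` carries the canonical negative definite star plumbing `P`), three NECESSARY conditions for
`Y` to be the seam of a ℚ-acyclic bisection of a smooth INTEGRAL HOMOLOGY 4-sphere (so of any
homotopy sphere), all valid without reference to `S⁴`: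
(T) `H₁(Y) ≅ A ⊕ A`, `|A| > 1` (Mayer–Vietoris + Alexander duality in the homology sphere give
`H₁(Y) ≅ H₁(W₁) ⊕ H₁(W₂)` with `H₁(W₁) ≅ Ext(H₁(W₂), ℤ) ≅ H₁(W₂)` and `H₂(Wᵢ) = H₃(Wᵢ) = 0`);
(M) the linking form has two COMPLEMENTARY metabolisers (the kernels `Kᵢ = ker(H₁Y → H₁Wᵢ)`);
(D) Donaldson for `P ∪ (−W₁)` and `P ∪ W₂'`: the lattice `Λ_P` embeds in the diagonal lattice
of its own rank, AND — refinement — the overlattices `ℤⁿ ⊇ Λ_P` so obtained realise, as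
`ℤⁿ/Λ_P ⊂ D(Λ_P) = H₁(Y)`, two complementary metabolisers (one per half).
**Result (3 fibres).** Only 22 spaces pass (T). EXCLUDED by (M)/(D): `S²(−2; ½,½,¾)`,
`S²(−1; ½,¼,⅙)`, `S²(−1; ¼,¼,¼)`, `S²(−1; ⅕,⅕,⅖)`, `S²(−2; ⅗,⅗,⅗)`, `S²(−1; 1/7,2/7,3/7)`,
`S²(−2; 3/7,5/7,5/7)`, `S²(−2; 4/7,4/7,5/7)`. SURVIVORS of all three (both kernels realised):
the family **`Y(p) := S²(−2; 1/p, (p−1)/p, (p−1)/p) = S²(0; 1/p, −1/p, −1/p)`, `H₁ = (ℤ/p)²`,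
for `p = 2, 3, 4, 5`** (`Y(2) = S³/Q₈`, the known seam of §5b; `p = 6, 7` inconclusive — the
embedding enumeration was capped at 20 000 solutions), and `S²(−1; ⅓,⅓,⅙)`, `S²(−1; 1/7,1/7,4/7)`,
`S²(−1; 2/7,2/7,2/7)`. WEAK (pass (M), (D), but only one kernel realised within the cap):
`S²(−2; ½,½,⅚)`, `S²(−2; ⅓,⅔,⅚)`, `S²(−2; ⅖,⅗,⅘)`, `S²(−2; 3/7,4/7,6/7)` (complete enumerations:
GENUINELY excluded by the refined (D)), `S²(−2; ⅙,⅚,⅚)`, `S²(−2; 1/7,6/7,6/7)`,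
`S²(−2; 2/7,5/7,6/7)` (capped: inconclusive). With a fourth fibre (`aᵢ ≤ 4`) four more survivors
appear, each a survivor above with one extra fibre: `S²(−2; ½,½,½,⅓)`, `S²(−2; ½,⅓,⅓,⅔)`,
`S²(−2; ⅓,⅔,⅔,¼)`, `S²(−2; ⅔,¼,¼,¾)`.
**Reading.** (i) The conditions are coarse (no Casson–Gordon/`d`-invariant input), so survivors
are CANDIDATES, exclusions are THEOREMS (for the searched range). (ii) The survivor family `Y(p)`
generalises `S³/Q₈` exactly: two equal exceptional fibres, swapped by an involution `τ_p` that
exchanges the two complementary realised metabolisers (checked from the output for `p = 3`), and a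
complementary pair `(1/p, −1/p)` — i.e. `Y(p)` is surgery on a regular fibre of a Seifert
fibration of `S¹ × S²`, precisely the shape of Etnyre–Ozbagci–Tosun's Lemma 38 (arXiv:2408.09292,
p. 14, read): *"the Seifert fibered space `S(p/q, −p/q, m²/(km²+mh+1))` admits a tight contact
structure that is symplectically filled by a rational homology ball … built by attaching a Stein
2-handle to `S¹ × D³` along a negative Legendrian cable of a Legendrian torus knot"* — STEIN ℚHB
fillings `X` with cyclic `π₁`, the rational analogues of `N₋₂(ℝP²)`. (iii) CONJECTURAL PICTURE, to
be checked (three finite tasks): `X_p = ν(P_p)` for a pseudo-projective plane `P_p ⊂ S⁴`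
(`p = 2`: `ν(ℝP²) =` Gompf's `X₁` ✓); `τ_p` is isotopic to a contactomorphism of the EOT
structure (`p = 2`: GLS ✓; for `p ≥ 3` no classification of tight structures on `Y(p)` is known
to this file); `π₁(X_p ∪_{τ_p} X̄_p) = 1` (`p = 2` ✓, §5b) — then `X_p ∪_{τ_p} X̄_p` is a homotopy
sphere in the CORK-TWIST SECTOR (§12b) with seam `Y(p)`, a rational contact cork `(X_p, τ_p)` and
a generalised Price twist, expected standard. **For Stub 3's provers: the torsion sector should
be expected to contain an infinite family `Y(p)`, not just `S³/Q₈`; for the adversary: each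
`Y(p)`, `p ≥ 3`, is a test sphere three checks away.** (iv) Not Seifert-specific: the same three
filters apply to any plumbed seam; graph-manifold and hyperbolic torsion seams are untouched.

**The family `Y(p)` worked out (by hand, after the run; two of the three checks done).**
Write `−Y(p) = S²(−1; (p−1)/p, 1/p, 1/p)` (`e₀ = −1`, `e = 1/p`; `−Y(2) = M(−1; ½,½,½) = S³/Q₈`
with the GLS orientation of §5b). (a) STEIN ℚHB FILLINGS FOR ALL `p`. `S¹ × S² = S²(−1; (p−1)/p,
1/p)` is Seifert fibred with two exceptional fibres; by EOT Lemma 36 and the framing lemma quoted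
in its proof (arXiv:2408.09292 p. 14: the regular fibre `F` is Legendrian with contact framing =
fibre framing, and *"any negative contact surgery on the fiber will have smooth surgery
coefficient less than 0 … when the surgery coefficient is less than −1, then the Seifert fibered
space will have `e₀ = −1`"*, coefficient `−1/r₃` producing the third fibre `r₃`), Legendrian
surgery on the `(p−1)`-fold stabilisation of `F` is smooth `(−p)`-surgery on `F` (fibre framing)
and yields `S²(−1; (p−1)/p, 1/p, 1/p) = −Y(p)`. Hence `−Y(p)` bounds the STEIN rational ball
`X_p = S¹ × D³ ∪` (one Weinstein 2-handle along `S^{p−1}(F)`), `H₁(X_p) = ℤ/p`, `H₂ = H₃ = 0`,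
with `p` Stein structures `J_0, …, J_{p−1}` (stabilisation signs; pairwise non-isotopic contact
boundaries by Lisca–Matić, EOT Thm "arbitmany") — the `m = 1` degenerate case of EOT's Lemma 38,
and for `p = 2` Gompf's `X₁ = N₋₂(ℝP²)`. (b) THE TWIST IS A HOMOTOPY SPHERE FOR ALL `p`. Use
the unnormalised form `Y(p) = S²(0; 1/p, −1/p, −1/p)`:
`π₁ Y(p) = ⟨c₁, c₂, c₃, h | h central, c₁^p h = c₂^p h^{−1} = c₃^p h^{−1} = 1, c₁c₂c₃ = 1⟩`.
The filling `X_p` built on the complementary pair `(c₁, c₂)` kills exactly the meridian of the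
surgered fibre: `π₁ X_p = π₁Y/⟨⟨c₃⟩⟩ = ⟨c₁ | c₁^p⟩ = ℤ/p` (from `c₃ = 1`:
`h = 1`, `c₂ = c₁⁻¹`). The fibre swap `τ_p : c₂ ↔ c₃` (a diffeomorphism of `Y(p)`: the two
fibres have equal invariants) carries `X_p` to the filling `X_p'` killing `c₂`. Then
`π₁(X_p ∪_{τ_p} X̄_p) = π₁Y/⟨⟨c₂, c₃⟩⟩ = 1` (`h = 1` from `c₂^p h^{−1}`, `c₁ = 1` from
`c₁c₂c₃`), `H₁ = 0` (the kernels `⟨c₁ + c₂⟩ = ⟨c₃⟩` and `⟨c₂⟩` of `H₁Y = (ℤ/p)²` are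
complementary), `H₂ = 0` (Mayer–Vietoris with `H₂ X_p = 0`), so **`M_p := X_p ∪_{τ_p} X̄_p` is a
homotopy 4-sphere for every `p ≥ 2`**, smoothly bisected into two copies of the Stein-able
rational ball `X_p` along `Y(p)`; `M_2 = S⁴` (§5b). (c) OPEN, decisive for membership in the crux
class: is `τ_p` isotopic to a contactomorphism `(Y(p), ξ_{J_j}) → (Y(p), ξ_{J_{j'}})` for some
`j, j'` — i.e. do the Legendrian-surgery structures with fibre 3 special and those with fibre 2
special meet up to isotopy (for `p = 2` yes: GLS classify tight structures on `M(−1;½,½,½)` by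
`Spin^c` and all three are of this kind)? What can be said now: the `p` structures `ξ_j` have
`Spin^c` classes in the coset `𝔰₀ + PD(K₃)` (`K₃ = ⟨c₃⟩` the kernel of the filling, `PD(K₃)` the
image of `H²(X_p) = ℤ/p ↪ H²(Y)`; `c₁(J_j) = rot(L_j) = r₀ − (p−1) + 2j mod p` takes every value
once for `p` odd, every even value twice for `p` even), the `τ_p^*ξ_j` lie in
`τ_p^*𝔰₀ + PD(K₂)`, and two cosets of COMPLEMENTARY order-`p` subgroups of `H²(Y) = (ℤ/p)²` meet
in exactly one point — so exactly one `Spin^c` class can carry a matching pair, with ONE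
candidate structure on each side for `p` odd (two for `p` even), for every `p`. Moreover `−Y(p) = M(−1; (p−1)/p, 1/p, 1/p)` is an L-SPACE (Lisca–Matić / Lisca–Stipsicz
III: an `e₀ = −1` small Seifert space is an L-space iff it carries no positive transverse
contact structure iff there are no coprime `m > a > 0` with `m r₁ < a < m(1 − r₂)` (and
`m r₃ < 1`) — here the interval is EMPTY, as `r₁ = (p−1)/p = 1 − r₂`), so
both structures of the matching pair have the unique non-zero contact invariant of their common
`Spin^c` class: Heegaard Floer cannot separate them, and (c) ⟺ "the tight structure on the
`e₀ = −1` L-space `M(−1; (p−1)/p, 1/p, 1/p)` in that `Spin^c` class is unique up to isotopy" — a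
classification question open for `p ≥ 3` to this file's knowledge (GLS math/0509714 needs
`r₁, r₂ ≥ ½`, i.e. `p = 2`; Tosun 2020 treats `e₀ = −2`). (d) **`M_p ≅ S⁴`
FOR EVERY `p` (informal theorem; 1-handle cancellation + Property R).** *Proof.* Handles of
`M_p = X_p ∪_{τ_p} X̄_p`: `X_p = h⁰ ∪ h¹ ∪ h²_a` (`h²_a` along the stabilised fibre `F` on the
Heegaard torus of `S¹×S² = ∂(S¹×D³)`), and the upside-down copy contributes `h²_b ∪ h³ ∪ h⁴`,
`h²_b` attached along the belt circle of the second copy's 2-handle transported by the gluing.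
That belt circle is the core of the surgery solid torus, i.e. the new exceptional fibre (fibre 3)
of the second copy; transported, it is `τ_p⁻¹(fibre 3) = fibre 2` of `Y(p) = ∂X_p`, and fibre 2
is the core `S¹ × {S}` of one Heegaard solid torus of `S¹×S² = ∂(S¹×D³)` (the two exceptional
fibres of `S²(−1; (p−1)/p, 1/p) = S¹×S²` ARE the two cores; the third fibre of `Y(p)` is the
surgered `F` on the middle torus). The core `S¹ × {S}` is disjoint from `ν(F)` and meets the belt
sphere `{θ₀} × S²` of `h¹` in ONE point. So both 2-handles attach to `∂(S¹×D³)` along the disjoint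
framed link `F ⊔ (S¹×{S})`, and `h¹`, `h²_b` cancel (any framing), leaving
`M_p = B⁴ ∪_K h²_a ∪ h³ ∪ h⁴` for some framed knot `K ⊂ S³`. As `M_p` is a homotopy sphere ((b)), `∂(B⁴ ∪_K h²) = S³_n(K)` must be `S¹×S²`, so
`n = 0` and `K` is the unknot (Gabai, Property R); thus `M_p = S²×D² ∪_φ S¹×B³`, and every
`φ ∈ Diff(S¹×S²)` extends over `S¹×B³` (Gluck: `π₀Diff(S¹×S²) = (ℤ/2)³`, reflections and the
rotation `(θ, x) ↦ (θ, rot_θ x)` all extend over `S¹ × B³`), so `M_p ≅ S⁴`. ∎ (For `p = 2` this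
re-proves the standardness of the `S³/Q₈` example of §5b without Price/KSTY.) The same proof
gives the general recognition lemma the provers of Stub 3 can use: **a homotopy 4-sphere of the
form `X ∪_ψ X̄`, `X = S¹×D³ ∪ h²`, is `S⁴` as soon as `ψ⁻¹`(belt circle of `h²`) is isotopic in
`∂X ∖` (belt circle) `= ∂(S¹×D³) ∖` (attaching region) to a curve meeting the belt sphere of the
1-handle once.**
CONCLUSION for the crux: IF (c) holds for some `p ≥ 3`, the cork-twist (torsion) sector contains
the infinite family `(M_p; X_p, X_p; τ_p)` of acyclic common-contact Stein bisections of the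
ROUND sphere with seams `Y(p)` — all standard, as the crux predicts, and all to be RECOGNISED by
any proof of Stub 3; if (c) fails for all `p ≥ 3`, the Seifert torsion sector with `aᵢ ≤ 7` is
`S³/Q₈` plus at most the three sporadic `e₀ = −1` candidates. -/

/-! ## §6 Natural strengthenings used by the ideators (targets)

* `AcyclicTwinsDiffeomorphic` (card minimal-factorisation-rigidity, First lemma): "the two halves
  of an acyclic common-contact bisection of a homotopy 4-sphere are diffeomorphic". SPC4 does NOT
  imply it, so it is refutable in principle WITHOUT an exotic sphere: ONE contact ℚHS³ `(Γ, ξ)`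
  with two ℚ-acyclic Stein fillings `W ≇ W′` whose union `W ∪ W̄′` is a homotopy sphere (automatic
  when both are contractible) kills it. PRINT, read at page level (generation 2): exotic
  CONTRACTIBLE STEIN pairs with a common boundary 3-manifold exist —
  Akbulut–Yildiz 2019, Thm 1 (arXiv:1901.00806 p. 3: *"There is a pair of compact contractible
  Stein 4-manifolds `W₁`, `W₂`, which are homeomorphic but not diffeomorphic to each other"*;
  Mazur type, related by a cork twist along a cork `(W, f) ⊂ Wᵢ`, Stein structures from explicit
  Legendrian pictures Figs. 11–12) and Hayden–Mark–Piccirillo 2021, §6.0.1 (arXiv:1908.05269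
  p. 17: *"we produce pairs of exotic contractible Stein manifolds"*, the Mazur manifolds of
  `P(k)`, `Q(k) ⊂ S¹ × S²` with framings `≤ t̄b − 1`, related by twisting an embedded Mazur cork,
  Prop. 2.2, same boundary `Y`). In NEITHER source are the two induced contact structures on `Y`
  compared. Hence the lemma is exactly ONE contact-topology computation away from dying: decide
  whether `ξ_{J₁}` and `ξ_{J₂}` are isotopic on `Y = ∂W₁ = ∂W₂` (compare the Ozsváth–Szabó
  contact classes `c⁺(ξ_{Jᵢ}) ∈ HF⁺(−Y)`, which are the relative invariants of the two ℚHB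
  cobordisms, or exhibit a Legendrian isotopy between the surgery diagrams modulo the cork
  twist); as plane fields they are already homotopic (`H₁ Y = 0` and `d₃` is the same for every
  Stein structure on a contractible filling). No cheap kill from degenerate readings: for
  `M = S⁴ = D(C)` the halves are `C` and `C` (unoriented), for `B⁴ ∪ B⁴` trivially equal.
  (N2, gen 4, read at page level.) The one in-print instance known to this file of a contact link
  with TWO genuinely different ℚ-acyclic Stein filling DATA — the two ℚHD smoothing components of
  Wahl's type-`𝒜⁴` valency-4 singularities (arXiv:1005.2199, Thm 2.4: "distinct one-dimensional
  smoothing components"; p. 4: "the two Milnor fibres are apparently diffeomorphic"; Remark 2.5: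
  they differ by a diffeomorphism of the link permuting two of the four branch points, i.e. by the
  choice of self-isotropic kernel in the discriminant group) — is a TWIN pair `X`, `X` glued by a
  link diffeomorphism, exactly like the `S³/Q₈` example of §5b, and the ideators' metaboliser
  computation (`Cruxes/…/WahlA4Metabolisers.md`, `p = 2, 3, 4`: the two kernels meet in `3p`
  elements) shows that no gluing `X ∪_ψ X̄` of them is even a ℚ-homology 4-sphere. So ℚHD
  smoothing theory supplies neither a kill of this lemma nor a new test sphere.
* `UQF*` (ideator 1: two compact ℚ-acyclic Stein domains with contactomorphic boundaries are
  diffeomorphic rel the contactomorphism): strictly stronger than the previous item; killed by any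
  CONTACT CORK (a cork `(C, τ)` with `τ^*ξ_C` isotopic to `ξ_C`) and by the Akbulut–Yildiz / HMP
  pairs as soon as their contact structures match. Decisive open computations: (ideator E3) the
  Karakurt–Oba–Ukida planar structure on the Akbulut cork, `τ^*ξ₂ ≟ ξ₂`; (this file)
  `ξ_{J₁} ≟ ξ_{J₂}` for the Akbulut–Yildiz pair.

## §7 Test homotopy spheres inside the crux class (what a kill would have to be)

By `exotic_of_not` a kill is an exotic `S⁴` with an acyclic common-contact Stein bisection. The
candidates that print puts inside (or one computation away from) the class, none believed exotic:
* (T1) presentation spheres `Σ(P, ε) = D(W_P)` (§4b; `ψ = id`, contractible halves) — standard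
  for Andrews–Curtis-trivial `P` and the Akbulut–Kirby family (Gompf 1991), open in general;
* (T2) `Σ = W₁ ∪_id W̄₂` for an exotic contractible Stein pair with common boundary
  (Akbulut–Yildiz; HMP): a homotopy sphere equal to the cork twist of `S⁴ = D(W₁)` along the
  embedded cork `W̄ ⊂ W̄₁ ⊂ S⁴`; in the class iff `ξ_{J₁} ≅ ξ_{J₂}` (§6); standardness NOT asserted
  in either source (it is an instance of "are cork twists of `S⁴` trivial?");
* (T3) Gompf's infinite-order cork twists of `S⁴` (arXiv:1603.05090 Q2.2): in the class iff some
  power of the twist map is isotopic to a contactomorphism of a Stein-induced structure;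
* (T4) the `S³/Q₈` sector (§5b): `X₁ ∪_id W̄′` for a second ℚ-acyclic Stein filling `W′` of
  `(M(−1;½,½,½), ξ₁)`, if one exists.
* (T5) (gen 4, §5d) the RATIONAL PRICE TWISTS `M_p = X_p ∪_{τ_p} X̄_p`, `p ≥ 3`: homotopy
  4-spheres (proved in §5d (b)) bisected along `Y(p) = S²(0; 1/p, −1/p, −1/p)` into two copies of
  the Stein-able rational ball `X_p = S¹×D³ ∪ h²` (`π₁ = ℤ/p`), `τ_p` the swap of the two equal
  exceptional fibres; in the crux class iff `τ_p` matches two of the EOT Legendrian-surgery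
  structures (§5d (c), open); ALL STANDARD (§5d (d): the fibre-2 handle cancels the 1-handle,
  then Property R) — so no kill here, but an infinite family the torsion sector must recognise.
A prover who standardises (T1)–(T2) has done Andrews–Curtis-type and cork-twist-of-`S⁴`-type
mathematics; nothing in the bisection formalism itself localises the difficulty further.

## §8 Formal gaps on the positive side (found while attacking; not defects of the statement)

* NON-VACUITY — CLOSED (generation 3). The sibling disprover of crux 4 landed
  `Theorems/ContractibleTwistedDoubleStandard/Negative/DoubleBisection.lean` (p69875: every double
  `D(W)` of a compact Stein domain satisfies the six bisection hypotheses; the hemisphere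
  bisection `S⁴ = 𝔻⁴ ∪_id 𝔻⁴`, `crux_hypotheses_at_sphere`) and `…/SphereAcyclicBisection.lean`
  (p70210: `acyclicBisection_sphere`, the body of `AcyclicBisectionExists` at `M = S⁴`). Imported
  and re-exported below in this file's vocabulary: `acyclicBisection_sphere : AcyclicBisection S⁴`,
  `crux_holds_at_sphere` (§9a). So the crux is non-vacuous and holds at the round sphere.
* TRANSPORT — CLOSED on the source side (generation 3): the tree lemma
  `Manifold.IsSmoothEmbedding.comp_diffeomorph` (CerfGammaFourProofs) composes a smooth embedding
  with a diffeomorphism OF ITS SOURCE (used by the line's composition, §9b); composition with a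
  diffeomorphism of the TARGET `M ≃ₘ N` is still Mathlib's `proof_wanted IsSmoothEmbedding.comp`.
* `H₀` IS NOT CONSTRAINED. Acyclicity is asked for `k > 0` only, so the TYPE allows disconnected
  halves; on paper they are excluded inside a homology 4-sphere (`H₄(M) → H₃(Γ) → H₃(W₁) ⊕ H₃(W₂)
  → 0` with `b₃(Γ) = #π₀Γ = #π₀W₁ + #π₀W₂ − 1` forces both halves connected), but a Lean proof
  must derive connectedness itself (no Mayer–Vietoris for `singularHomology` in the tree yet).
* NEGATIVE LEMMAS UNDER `Theorems/<Crux>/Negative/` — generation 1's bounce (`theorems.refuter`)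
  predates the `Negative/` target class; siblings have since landed such files (p69875, p70210),
  so the conclusive lemmas of this file are being proposed as
  `Theorems/AcyclicBisectionRigidity/Negative/*.lean` (`--supports` the crux item) from gen 3 on. -/

/-! ## §9 Targets — the registered stubs of `Lines/minimal-factorisation-rigidity.lean`

Skeleton `03fc640e9f23` (planner-cruxplan, 2026-08-15T23:48Z): three stubs, composition
`AcyclicBisectionRigidity_of` kernel-checked. The stub SIGNATURES are restated VERBATIM as
`Stub1`, `Stub2`, `Stub3` (∀-closures; the skeleton module is not imported because it carries the
stubs' `sorry`s). -/

section Targets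

/-- **Stub 1 of the line, verbatim (∀-closure): `stub_minimalFactorisationTwins`** — under the
crux hypotheses the halves are CONTACT TWINS: a diffeomorphism `Φ : W₁ ≅ W₂` carrying
`contactPlane J₁.J` to `contactPlane J₂.J` at every boundary point. -/
def Stub1 : Prop :=
  ∀ (M : Type) [TopologicalSpace M] [T2Space M] [SecondCountableTopology M] [ChartedSpace E4 M]
    [IsManifold (𝓡 4) ∞ M] (_hM : M ≃ₕ 𝕊⁴)
    (W₁ : Type) [TopologicalSpace W₁] [ChartedSpace (EuclideanHalfSpace 4) W₁] [IsManifold (𝓡∂ 4) ∞ W₁]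
    [CompactSpace W₁] (W₂ : Type) [TopologicalSpace W₂] [ChartedSpace (EuclideanHalfSpace 4) W₂]
    [IsManifold (𝓡∂ 4) ∞ W₂] [CompactSpace W₂] (J₁ : SteinStructure W₁) (J₂ : SteinStructure W₂)
    (e₁ : W₁ → M) (e₂ : W₂ → M)
    (_he₁ : Manifold.IsSmoothEmbedding (𝓡∂ 4) (𝓡 4) ∞ e₁)
    (_he₂ : Manifold.IsSmoothEmbedding (𝓡∂ 4) (𝓡 4) ∞ e₂)
    (_hcover : range e₁ ∪ range e₂ = univ)
    (_hseam₁ : range e₁ ∩ range e₂ = e₁ '' (𝓡∂ 4).boundary W₁)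
    (_hseam₂ : range e₁ ∩ range e₂ = e₂ '' (𝓡∂ 4).boundary W₂)
    (_hξ : ∀ w₁ w₂, e₁ w₁ = e₂ w₂ →
      Submodule.map (mfderiv (𝓡∂ 4) (𝓡 4) e₁ w₁).toLinearMap (contactPlane J₁.J w₁) =
      Submodule.map (mfderiv (𝓡∂ 4) (𝓡 4) e₂ w₂).toLinearMap (contactPlane J₂.J w₂))
    (_hac : ∀ k, 0 < k → IsZero (singularHomology ℚ ℚ W₁ k) ∧ IsZero (singularHomology ℚ ℚ W₂ k)),
    ∃ Φ : W₁ ≃ₘ⟮𝓡∂ 4, 𝓡∂ 4⟯ W₂, ∀ w, w ∈ (𝓡∂ 4).boundary W₁ →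
      Submodule.map (mfderiv (𝓡∂ 4) (𝓡∂ 4) Φ w).toLinearMap (contactPlane J₁.J w) =
        contactPlane J₂.J (Φ w)

/-- **Stub 2 of the line, verbatim (∀-closure): `stub_contractibleTwinTwistedDouble`** — a homotopy
4-sphere that is a contact twisted double `W ∪_ĉ W̄` of ONE contractible Stein domain is `S⁴`. -/
def Stub2 : Prop :=
  ∀ (M : Type) [TopologicalSpace M] [T2Space M] [SecondCountableTopology M] [ChartedSpace E4 M]
    [IsManifold (𝓡 4) ∞ M] (_hM : M ≃ₕ 𝕊⁴)
    (W : Type) [TopologicalSpace W] [ChartedSpace (EuclideanHalfSpace 4) W] [IsManifold (𝓡∂ 4) ∞ W]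
    [CompactSpace W] [ContractibleSpace W] (J : SteinStructure W) (e₁ e₂ : W → M)
    (_he₁ : Manifold.IsSmoothEmbedding (𝓡∂ 4) (𝓡 4) ∞ e₁)
    (_he₂ : Manifold.IsSmoothEmbedding (𝓡∂ 4) (𝓡 4) ∞ e₂)
    (_hcover : range e₁ ∪ range e₂ = univ)
    (_hseam₁ : range e₁ ∩ range e₂ = e₁ '' (𝓡∂ 4).boundary W)
    (_hseam₂ : range e₁ ∩ range e₂ = e₂ '' (𝓡∂ 4).boundary W)
    (_hξ : ∀ w w', e₁ w = e₂ w' →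
      Submodule.map (mfderiv (𝓡∂ 4) (𝓡 4) e₁ w).toLinearMap (contactPlane J.J w) =
      Submodule.map (mfderiv (𝓡∂ 4) (𝓡 4) e₂ w').toLinearMap (contactPlane J.J w')),
    Nonempty (M ≃ₘ⟮𝓡 4, 𝓡 4⟯ 𝕊⁴)

/-- **Stub 3 of the line, verbatim (∀-closure): `stub_nonContractibleTwinTwistedDouble`** — the same
with `W` ℚ-acyclic but NOT contractible. -/
def Stub3 : Prop :=
  ∀ (M : Type) [TopologicalSpace M] [T2Space M] [SecondCountableTopology M] [ChartedSpace E4 M]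
    [IsManifold (𝓡 4) ∞ M] (_hM : M ≃ₕ 𝕊⁴)
    (W : Type) [TopologicalSpace W] [ChartedSpace (EuclideanHalfSpace 4) W] [IsManifold (𝓡∂ 4) ∞ W]
    [CompactSpace W] (_hW : ¬ ContractibleSpace W) (J : SteinStructure W) (e₁ e₂ : W → M)
    (_he₁ : Manifold.IsSmoothEmbedding (𝓡∂ 4) (𝓡 4) ∞ e₁)
    (_he₂ : Manifold.IsSmoothEmbedding (𝓡∂ 4) (𝓡 4) ∞ e₂)
    (_hcover : range e₁ ∪ range e₂ = univ)
    (_hseam₁ : range e₁ ∩ range e₂ = e₁ '' (𝓡∂ 4).boundary W)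
    (_hseam₂ : range e₁ ∩ range e₂ = e₂ '' (𝓡∂ 4).boundary W)
    (_hξ : ∀ w w', e₁ w = e₂ w' →
      Submodule.map (mfderiv (𝓡∂ 4) (𝓡 4) e₁ w).toLinearMap (contactPlane J.J w) =
      Submodule.map (mfderiv (𝓡∂ 4) (𝓡 4) e₂ w').toLinearMap (contactPlane J.J w'))
    (_hac : ∀ k, 0 < k → IsZero (singularHomology ℚ ℚ W k)),
    Nonempty (M ≃ₘ⟮𝓡 4, 𝓡 4⟯ 𝕊⁴)

/-! ### §9a The two twisted-double stubs are consequences of the crux (and of SPC4) -/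

/-- **Stub 2 follows from the crux**: twin data `(W, J; e₁, e₂)` with `W` contractible IS an
acyclic bisection (`W₁ = W₂ = W`, `J₁ = J₂ = J`, acyclicity from contractibility). So Stub 2 is
no easier to refute than the crux: a kill is an exotic `S⁴` (`exotic_of_not`). -/
theorem stub2_of_crux (h : ConvexBisection.AcyclicBisectionRigidity) : Stub2 := by
  intro M _ _ _ _ _ hM W _ _ _ _ _ J e₁ e₂ he₁ he₂ hcover hseam₁ hseam₂ hξ
  exact h M hM ⟨W, _, _, _, _, W, _, _, _, _, J, J, e₁, e₂, he₁, he₂, hcover, hseam₁, hseam₂, hξ,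
    fun k hk => ⟨isZero_singularHomology_of_contractible W hk.ne',
      isZero_singularHomology_of_contractible W hk.ne'⟩⟩

/-- **Stub 3 follows from the crux** (same twin reading; acyclicity is a hypothesis of the stub,
and `¬ ContractibleSpace W` is simply not used). -/
theorem stub3_of_crux (h : ConvexBisection.AcyclicBisectionRigidity) : Stub3 := by
  intro M _ _ _ _ _ hM W _ _ _ _ _ J e₁ e₂ he₁ he₂ hcover hseam₁ hseam₂ hξ hac
  exact h M hM ⟨W, _, _, _, _, W, _, _, _, _, J, J, e₁, e₂, he₁, he₂, hcover, hseam₁, hseam₂, hξ,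
    fun k hk => ⟨hac k hk, hac k hk⟩⟩

/-- Hence Stub 2 is SPC4-implied (also directly: it has the shielded shape of §1). -/
theorem stub2_of_spc4 (h : SmoothPoincare4) : Stub2 :=
  stub2_of_crux (of_spc4 h)

/-- Hence Stub 3 is SPC4-implied. -/
theorem stub3_of_spc4 (h : SmoothPoincare4) : Stub3 :=
  stub3_of_crux (of_spc4 h)

/-- **Non-vacuity of the crux, formally (closes §8 (i)).** The round `S⁴` carries an acyclic
common-contact Stein bisection: the hemisphere bisection `S⁴ = 𝔻⁴ ∪_id 𝔻⁴` with the standard Stein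
ball on both halves (sibling tree theorem `Negative.acyclicBisection_sphere`, p70210). -/
theorem acyclicBisection_sphere : AcyclicBisection 𝕊⁴ :=
  Summit.SmoothPoincare4.SmoothPoincare4.Theorems.ContractibleTwistedDoubleStandard.Negative.acyclicBisection_sphere

/-- **The crux holds at the round sphere, non-vacuously**: hypothesis inhabited
(`acyclicBisection_sphere`), conclusion by `Diffeomorph.refl`. No refutation of the crux, of
Stub 2 or of Stub 3 can come from `M = S⁴` itself. -/
theorem crux_holds_at_sphere :
    AcyclicBisection 𝕊⁴ ∧ Nonempty (𝕊⁴ ≃ₘ⟮𝓡 4, 𝓡 4⟯ 𝕊⁴) :=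
  ⟨acyclicBisection_sphere, ⟨Diffeomorph.refl _ _ _⟩⟩

/-! ### §9b Stub 1 is the line's only new content: the composition, and triviality on twins -/

/-- **Re-parametrising a half (the line's `seamPlanes_comp_diffeomorph`, re-derived).** If
`Φ : W₁ ≅ W₂` carries `ξ₁` to `ξ₂` on `∂W₁` and the planes pushed forward by `e₁`, `e₂` agree on
the seam, then so do the planes pushed forward by `e₁` and `e₂ ∘ Φ`, both read with `ξ₁`. -/
theorem seamPlanes_comp_diffeomorph
    {M : Type} [TopologicalSpace M] [ChartedSpace E4 M]
    {W₁ : Type} [TopologicalSpace W₁] [ChartedSpace (EuclideanHalfSpace 4) W₁] [IsManifold (𝓡∂ 4) ∞ W₁]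
    {W₂ : Type} [TopologicalSpace W₂] [ChartedSpace (EuclideanHalfSpace 4) W₂] [IsManifold (𝓡∂ 4) ∞ W₂]
    (ξ₁ : W₁ → Submodule ℝ E4) (ξ₂ : W₂ → Submodule ℝ E4) {e₁ : W₁ → M} {e₂ : W₂ → M}
    (he₂ : Manifold.IsSmoothEmbedding (𝓡∂ 4) (𝓡 4) ∞ e₂)
    (hseam₂ : range e₁ ∩ range e₂ = e₂ '' (𝓡∂ 4).boundary W₂)
    (hξ : ∀ w₁ w₂, e₁ w₁ = e₂ w₂ →
      Submodule.map (mfderiv (𝓡∂ 4) (𝓡 4) e₁ w₁).toLinearMap (ξ₁ w₁) =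
      Submodule.map (mfderiv (𝓡∂ 4) (𝓡 4) e₂ w₂).toLinearMap (ξ₂ w₂))
    (Φ : W₁ ≃ₘ⟮𝓡∂ 4, 𝓡∂ 4⟯ W₂)
    (hΦ : ∀ w, w ∈ (𝓡∂ 4).boundary W₁ →
      Submodule.map (mfderiv (𝓡∂ 4) (𝓡∂ 4) Φ w).toLinearMap (ξ₁ w) = ξ₂ (Φ w)) :
    ∀ w w', e₁ w = (e₂ ∘ Φ) w' →
      Submodule.map (mfderiv (𝓡∂ 4) (𝓡 4) e₁ w).toLinearMap (ξ₁ w) =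
      Submodule.map (mfderiv (𝓡∂ 4) (𝓡 4) (e₂ ∘ Φ) w').toLinearMap (ξ₁ w') := by
  intro w w' h
  have hn : (∞ : WithTop ℕ∞) ≠ 0 := by simp
  have hmem : e₂ (Φ w') ∈ range e₁ ∩ range e₂ := ⟨⟨w, h⟩, ⟨Φ w', rfl⟩⟩
  rw [hseam₂] at hmem
  obtain ⟨v, hv, hve⟩ := hmem
  have hv' : v = Φ w' := he₂.isEmbedding.injective hve
  have hb₂ : Φ w' ∈ (𝓡∂ 4).boundary W₂ := hv' ▸ hv
  have hb₁ : w' ∈ (𝓡∂ 4).boundary W₁ := by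
    have : w' ∈ Φ ⁻¹' (𝓡∂ 4).boundary W₂ := hb₂
    rwa [Φ.preimage_boundary hn] at this
  have hd₂ : MDifferentiableAt (𝓡∂ 4) (𝓡 4) e₂ (Φ w') :=
    he₂.contMDiff.mdifferentiableAt (by simp)
  have hdΦ : MDifferentiableAt (𝓡∂ 4) (𝓡∂ 4) Φ w' := Φ.mdifferentiable (by simp) w'
  have hcomp : mfderiv (𝓡∂ 4) (𝓡 4) (e₂ ∘ Φ) w' =
      (mfderiv (𝓡∂ 4) (𝓡 4) e₂ (Φ w')).comp (mfderiv (𝓡∂ 4) (𝓡∂ 4) Φ w') :=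
    mfderiv_comp w' hd₂ hdΦ
  have key : Submodule.map (mfderiv (𝓡∂ 4) (𝓡 4) (e₂ ∘ Φ) w').toLinearMap (ξ₁ w') =
      Submodule.map (mfderiv (𝓡∂ 4) (𝓡 4) e₂ (Φ w')).toLinearMap
        (Submodule.map (mfderiv (𝓡∂ 4) (𝓡∂ 4) Φ w').toLinearMap (ξ₁ w')) := by
    rw [← Submodule.map_comp]
    congr 1
    rw [hcomp]
    rfl
  rw [key, hΦ w' hb₁]
  exact hξ w (Φ w') h

/-- **The line's composition, re-derived: the three stubs prove the crux** (re-parametrise the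
second half by `e₂ ∘ Φ`, a smooth embedding by the tree lemma
`Manifold.IsSmoothEmbedding.comp_diffeomorph` — this also closes §8 (ii) on the source side —
then case on `ContractibleSpace W₁`). -/
theorem crux_of_stubs (h₁ : Stub1) (h₂ : Stub2) (h₃ : Stub3) :
    ConvexBisection.AcyclicBisectionRigidity := by
  intro M _ _ _ _ _ hM hb
  obtain ⟨W₁, _, _, _, _, W₂, _, _, _, _, J₁, J₂, e₁, e₂, he₁, he₂, hcover, hseam₁, hseam₂, hξ, hac⟩ := hb
  obtain ⟨Φ, hΦ⟩ := h₁ M hM W₁ W₂ J₁ J₂ e₁ e₂ he₁ he₂ hcover hseam₁ hseam₂ hξ hac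
  have hn : (∞ : WithTop ℕ∞) ≠ 0 := by simp
  have he₂' : Manifold.IsSmoothEmbedding (𝓡∂ 4) (𝓡 4) ∞ (e₂ ∘ Φ) := he₂.comp_diffeomorph Φ
  have hsurj : Function.Surjective (Φ : W₁ → W₂) := fun y => ⟨Φ.symm y, Φ.apply_symm_apply y⟩
  have hrange : range (e₂ ∘ Φ) = range e₂ := by
    rw [range_comp, hsurj.range_eq, image_univ]
  have hcover' : range e₁ ∪ range (e₂ ∘ Φ) = univ := by rw [hrange]; exact hcover
  have hseam₁' : range e₁ ∩ range (e₂ ∘ Φ) = e₁ '' (𝓡∂ 4).boundary W₁ := by rw [hrange]; exact hseam₁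
  have hseam₂' : range e₁ ∩ range (e₂ ∘ Φ) = (e₂ ∘ Φ) '' (𝓡∂ 4).boundary W₁ := by
    rw [hrange, image_comp, Φ.image_boundary hn]; exact hseam₂
  have hξ' := seamPlanes_comp_diffeomorph (fun w => contactPlane J₁.J w) (fun w => contactPlane J₂.J w)
    he₂ hseam₂ hξ Φ hΦ
  have hac₁ : ∀ k, 0 < k → IsZero (singularHomology ℚ ℚ W₁ k) := fun k hk => (hac k hk).1
  by_cases hW : ContractibleSpace W₁
  · exact h₂ M hM W₁ J₁ e₁ (e₂ ∘ Φ) he₁ he₂' hcover' hseam₁' hseam₂' hξ'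
  · exact h₃ M hM W₁ hW J₁ e₁ (e₂ ∘ Φ) he₁ he₂' hcover' hseam₁' hseam₂' hξ' hac₁

/-- **Given Stub 1, the crux is EQUIVALENT to Stub 2 ∧ Stub 3** (`crux_of_stubs` one way,
`stub2_of_crux` / `stub3_of_crux` the other): the twisted-double stubs carry exactly the crux's
own (SPC4-level) difficulty, and Stub 1 is the line's only content that an adversary can attack
without producing an exotic `S⁴`. -/
theorem crux_iff_stub23_of_stub1 (h₁ : Stub1) :
    ConvexBisection.AcyclicBisectionRigidity ↔ (Stub2 ∧ Stub3) :=
  ⟨fun h => ⟨stub2_of_crux h, stub3_of_crux h⟩, fun h => crux_of_stubs h₁ h.1 h.2⟩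

/-- **Stub 1 is TRIVIAL on twin data.** Whenever the two halves are literally the same Stein
domain `(W, J)` — doubles `D(W)`, presentation spheres, the standard `S³/Q₈` bisection of `S⁴`
(§5b), every Stein-compatible cork twist `W ∪_τ W̄` of `S⁴` — the conclusion of Stub 1 holds with
`Φ = Diffeomorph.refl`, WHATEVER `M`, `e₁`, `e₂` are (no hypothesis is used). Consequence for the
adversary: Stub 1 is refuted by, and only by, an acyclic common-contact bisection of a homotopy
sphere whose halves `(W₁, ξ₁|∂)`, `(W₂, ξ₂|∂)` are not diffeomorphic as manifolds-with-boundary-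
plane-field — e.g. ONE contact ℚHS³ with two non-diffeomorphic ℚ-acyclic Stein fillings whose
union is a homotopy sphere (automatic for contractible fillings); NO exotic `S⁴` is needed (§9c). -/
theorem stub1_of_twins {W : Type} [TopologicalSpace W] [ChartedSpace (EuclideanHalfSpace 4) W]
    [IsManifold (𝓡∂ 4) ∞ W] [CompactSpace W] (J : SteinStructure W) :
    ∃ Φ : W ≃ₘ⟮𝓡∂ 4, 𝓡∂ 4⟯ W, ∀ w, w ∈ (𝓡∂ 4).boundary W →
      Submodule.map (mfderiv (𝓡∂ 4) (𝓡∂ 4) Φ w).toLinearMap (contactPlane J.J w) =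
        contactPlane J.J (Φ w) := by
  refine ⟨Diffeomorph.refl _ _ _, fun w _ => ?_⟩
  have h : ((Diffeomorph.refl (𝓡∂ 4) W ∞ : W ≃ₘ⟮𝓡∂ 4, 𝓡∂ 4⟯ W) : W → W) = id := rfl
  rw [h, mfderiv_id]
  exact Submodule.map_id _

/-- **Stub 1's hypotheses are satisfiable (at `M = S⁴`, hemisphere bisection)** — so Stub 1 is not
vacuous; there its conclusion holds by `stub1_of_twins`. -/
theorem stub1_hypotheses_at_sphere :
    ∃ (W₁ : Type) (_ : TopologicalSpace W₁) (_ : ChartedSpace (EuclideanHalfSpace 4) W₁)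
      (_ : IsManifold (𝓡∂ 4) ∞ W₁) (_ : CompactSpace W₁) (W₂ : Type) (_ : TopologicalSpace W₂)
      (_ : ChartedSpace (EuclideanHalfSpace 4) W₂) (_ : IsManifold (𝓡∂ 4) ∞ W₂) (_ : CompactSpace W₂)
      (J₁ : SteinStructure W₁) (J₂ : SteinStructure W₂) (e₁ : W₁ → 𝕊⁴) (e₂ : W₂ → 𝕊⁴),
      Nonempty (𝕊⁴ ≃ₕ 𝕊⁴) ∧
      Manifold.IsSmoothEmbedding (𝓡∂ 4) (𝓡 4) ∞ e₁ ∧ Manifold.IsSmoothEmbedding (𝓡∂ 4) (𝓡 4) ∞ e₂ ∧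
      Set.range e₁ ∪ Set.range e₂ = Set.univ ∧
      Set.range e₁ ∩ Set.range e₂ = e₁ '' (𝓡∂ 4).boundary W₁ ∧
      Set.range e₁ ∩ Set.range e₂ = e₂ '' (𝓡∂ 4).boundary W₂ ∧
      (∀ w₁ w₂, e₁ w₁ = e₂ w₂ →
        Submodule.map (mfderiv (𝓡∂ 4) (𝓡 4) e₁ w₁).toLinearMap (contactPlane J₁.J w₁) =
        Submodule.map (mfderiv (𝓡∂ 4) (𝓡 4) e₂ w₂).toLinearMap (contactPlane J₂.J w₂)) ∧
      (∀ k, 0 < k → IsZero (singularHomology ℚ ℚ W₁ k) ∧ IsZero (singularHomology ℚ ℚ W₂ k)) := by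
  obtain ⟨W₁, _, _, _, _, W₂, _, _, _, _, J₁, J₂, e₁, e₂, h₁, h₂, hc, hs₁, hs₂, hξ, hac⟩ :=
    acyclicBisection_sphere
  exact ⟨W₁, _, _, _, _, W₂, _, _, _, _, J₁, J₂, e₁, e₂, ⟨ContinuousMap.HomotopyEquiv.refl _⟩, h₁,
    h₂, hc, hs₁, hs₂, hξ, hac⟩

/-! ### §9e Twin / non-twin decomposition of the crux (gen 4, formal)

The lever Stub 1 asserts that the halves of every acyclic bisection of a homotopy sphere are
CONTACT TWINS. Splitting the crux by excluded middle on that predicate isolates exactly what the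
line buys and what it leaves: the two residual stubs are worth the twin sector, with or without
the lever, and the lever's only role is to declare the non-twin sector empty. -/

/-- **Contact-twin data** for a pair of compact Stein domains: a diffeomorphism `Φ : W₁ ≅ W₂`
carrying the complex tangencies of `J₁` onto those of `J₂` at every boundary point — literally the
CONCLUSION of Stub 1 (`stub_minimalFactorisationTwins`). -/
def ContactTwins {W₁ : Type} [TopologicalSpace W₁] [ChartedSpace (EuclideanHalfSpace 4) W₁]
    [IsManifold (𝓡∂ 4) ∞ W₁] [CompactSpace W₁] {W₂ : Type} [TopologicalSpace W₂]
    [ChartedSpace (EuclideanHalfSpace 4) W₂] [IsManifold (𝓡∂ 4) ∞ W₂] [CompactSpace W₂]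
    (J₁ : SteinStructure W₁) (J₂ : SteinStructure W₂) : Prop :=
  ∃ Φ : W₁ ≃ₘ⟮𝓡∂ 4, 𝓡∂ 4⟯ W₂, ∀ w, w ∈ (𝓡∂ 4).boundary W₁ →
    Submodule.map (mfderiv (𝓡∂ 4) (𝓡∂ 4) Φ w).toLinearMap (contactPlane J₁.J w) =
      contactPlane J₂.J (Φ w)

/-- Twin data is reflexive (`Φ = refl`; this is `stub1_of_twins`). -/
theorem ContactTwins.refl {W : Type} [TopologicalSpace W] [ChartedSpace (EuclideanHalfSpace 4) W]
    [IsManifold (𝓡∂ 4) ∞ W] [CompactSpace W] (J : SteinStructure W) : ContactTwins J J :=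
  stub1_of_twins J

/-- **The twin sector of the crux**: acyclic common-contact Stein bisections of homotopy
4-spheres whose halves ARE contact twins give `S⁴`. (Contains: all doubles `D(W)`, all
contact-cork twists `W ∪_ĉ W̄` of doubles, the `S³/Q₈` bisection of `S⁴`, the positron sphere
`Σ_P` of §9d.) -/
def TwinSector : Prop :=
  ∀ (M : Type) [TopologicalSpace M] [T2Space M] [SecondCountableTopology M] [ChartedSpace E4 M]
    [IsManifold (𝓡 4) ∞ M] (_hM : M ≃ₕ 𝕊⁴)
    (W₁ : Type) [TopologicalSpace W₁] [ChartedSpace (EuclideanHalfSpace 4) W₁] [IsManifold (𝓡∂ 4) ∞ W₁]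
    [CompactSpace W₁] (W₂ : Type) [TopologicalSpace W₂] [ChartedSpace (EuclideanHalfSpace 4) W₂]
    [IsManifold (𝓡∂ 4) ∞ W₂] [CompactSpace W₂] (J₁ : SteinStructure W₁) (J₂ : SteinStructure W₂)
    (e₁ : W₁ → M) (e₂ : W₂ → M)
    (_he₁ : Manifold.IsSmoothEmbedding (𝓡∂ 4) (𝓡 4) ∞ e₁)
    (_he₂ : Manifold.IsSmoothEmbedding (𝓡∂ 4) (𝓡 4) ∞ e₂)
    (_hcover : range e₁ ∪ range e₂ = univ)
    (_hseam₁ : range e₁ ∩ range e₂ = e₁ '' (𝓡∂ 4).boundary W₁)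
    (_hseam₂ : range e₁ ∩ range e₂ = e₂ '' (𝓡∂ 4).boundary W₂)
    (_hξ : ∀ w₁ w₂, e₁ w₁ = e₂ w₂ →
      Submodule.map (mfderiv (𝓡∂ 4) (𝓡 4) e₁ w₁).toLinearMap (contactPlane J₁.J w₁) =
      Submodule.map (mfderiv (𝓡∂ 4) (𝓡 4) e₂ w₂).toLinearMap (contactPlane J₂.J w₂))
    (_hac : ∀ k, 0 < k → IsZero (singularHomology ℚ ℚ W₁ k) ∧ IsZero (singularHomology ℚ ℚ W₂ k)),
    ContactTwins J₁ J₂ → Nonempty (M ≃ₘ⟮𝓡 4, 𝓡 4⟯ 𝕊⁴)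

/-- **The non-twin sector of the crux**: the same for halves that are NOT contact twins. (Its
hypothesis class is EMPTY iff Stub 1; every kill candidate of §§9c–d — the Akbulut–Yildiz / HMP
unions if their contact structures match, `Σ_P` under horn 1, the outputs of (Q1)–(Q3) — would
live here, and all of them are expected to be standard spheres.) -/
def NonTwinSector : Prop :=
  ∀ (M : Type) [TopologicalSpace M] [T2Space M] [SecondCountableTopology M] [ChartedSpace E4 M]
    [IsManifold (𝓡 4) ∞ M] (_hM : M ≃ₕ 𝕊⁴)
    (W₁ : Type) [TopologicalSpace W₁] [ChartedSpace (EuclideanHalfSpace 4) W₁] [IsManifold (𝓡∂ 4) ∞ W₁]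
    [CompactSpace W₁] (W₂ : Type) [TopologicalSpace W₂] [ChartedSpace (EuclideanHalfSpace 4) W₂]
    [IsManifold (𝓡∂ 4) ∞ W₂] [CompactSpace W₂] (J₁ : SteinStructure W₁) (J₂ : SteinStructure W₂)
    (e₁ : W₁ → M) (e₂ : W₂ → M)
    (_he₁ : Manifold.IsSmoothEmbedding (𝓡∂ 4) (𝓡 4) ∞ e₁)
    (_he₂ : Manifold.IsSmoothEmbedding (𝓡∂ 4) (𝓡 4) ∞ e₂)
    (_hcover : range e₁ ∪ range e₂ = univ)
    (_hseam₁ : range e₁ ∩ range e₂ = e₁ '' (𝓡∂ 4).boundary W₁)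
    (_hseam₂ : range e₁ ∩ range e₂ = e₂ '' (𝓡∂ 4).boundary W₂)
    (_hξ : ∀ w₁ w₂, e₁ w₁ = e₂ w₂ →
      Submodule.map (mfderiv (𝓡∂ 4) (𝓡 4) e₁ w₁).toLinearMap (contactPlane J₁.J w₁) =
      Submodule.map (mfderiv (𝓡∂ 4) (𝓡 4) e₂ w₂).toLinearMap (contactPlane J₂.J w₂))
    (_hac : ∀ k, 0 < k → IsZero (singularHomology ℚ ℚ W₁ k) ∧ IsZero (singularHomology ℚ ℚ W₂ k)),
    ¬ ContactTwins J₁ J₂ → Nonempty (M ≃ₘ⟮𝓡 4, 𝓡 4⟯ 𝕊⁴)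

/-- **The crux is the conjunction of its twin and non-twin sectors** (excluded middle on
`ContactTwins J₁ J₂`). -/
theorem crux_iff_twin_and_nonTwin :
    ConvexBisection.AcyclicBisectionRigidity ↔ TwinSector ∧ NonTwinSector := by
  constructor
  · intro h
    refine ⟨?_, ?_⟩
    · intro M _ _ _ _ _ hM W₁ _ _ _ _ W₂ _ _ _ _ J₁ J₂ e₁ e₂ he₁ he₂ hcover hseam₁ hseam₂ hξ hac _
      exact h M hM ⟨W₁, _, _, _, _, W₂, _, _, _, _, J₁, J₂, e₁, e₂, he₁, he₂, hcover, hseam₁,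
        hseam₂, hξ, hac⟩
    · intro M _ _ _ _ _ hM W₁ _ _ _ _ W₂ _ _ _ _ J₁ J₂ e₁ e₂ he₁ he₂ hcover hseam₁ hseam₂ hξ hac _
      exact h M hM ⟨W₁, _, _, _, _, W₂, _, _, _, _, J₁, J₂, e₁, e₂, he₁, he₂, hcover, hseam₁,
        hseam₂, hξ, hac⟩
  · rintro ⟨hT, hN⟩ M _ _ _ _ _ hM hb
    obtain ⟨W₁, _, _, _, _, W₂, _, _, _, _, J₁, J₂, e₁, e₂, he₁, he₂, hcover, hseam₁, hseam₂, hξ,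
      hac⟩ := hb
    by_cases ht : ContactTwins J₁ J₂
    · exact hT M hM W₁ W₂ J₁ J₂ e₁ e₂ he₁ he₂ hcover hseam₁ hseam₂ hξ hac ht
    · exact hN M hM W₁ W₂ J₁ J₂ e₁ e₂ he₁ he₂ hcover hseam₁ hseam₂ hξ hac ht

/-- **Stub 1 says precisely that the non-twin sector is EMPTY**, so it yields `NonTwinSector`
vacuously — and contributes nothing else to the crux. -/
theorem nonTwinSector_of_stub1 (h₁ : Stub1) : NonTwinSector := by
  intro M _ _ _ _ _ hM W₁ _ _ _ _ W₂ _ _ _ _ J₁ J₂ e₁ e₂ he₁ he₂ hcover hseam₁ hseam₂ hξ hac ht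
  exact (ht (h₁ M hM W₁ W₂ J₁ J₂ e₁ e₂ he₁ he₂ hcover hseam₁ hseam₂ hξ hac)).elim

/-- **The twin sector is EQUIVALENT to Stub 2 ∧ Stub 3 — no lever needed.** (`→`: twin data on
`(W, W; J, J)` is reflexive; `←`: re-parametrise the second half by `e₂ ∘ Φ`
(`IsSmoothEmbedding.comp_diffeomorph`, `seamPlanes_comp_diffeomorph`) and case on
`ContractibleSpace W₁` — the line's composition with the twin datum as input instead of Stub 1.)
So the two residual stubs of `minimal-factorisation-rigidity` prove EXACTLY `TwinSector`. -/
theorem twinSector_iff_stub23 : TwinSector ↔ (Stub2 ∧ Stub3) := by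
  constructor
  · intro h
    refine ⟨?_, ?_⟩
    · intro M _ _ _ _ _ hM W _ _ _ _ _ J e₁ e₂ he₁ he₂ hcover hseam₁ hseam₂ hξ
      exact h M hM W W J J e₁ e₂ he₁ he₂ hcover hseam₁ hseam₂ hξ
        (fun k hk => ⟨isZero_singularHomology_of_contractible W hk.ne',
          isZero_singularHomology_of_contractible W hk.ne'⟩) (ContactTwins.refl J)
    · intro M _ _ _ _ _ hM W _ _ _ _ hW J e₁ e₂ he₁ he₂ hcover hseam₁ hseam₂ hξ hac
      exact h M hM W W J J e₁ e₂ he₁ he₂ hcover hseam₁ hseam₂ hξ (fun k hk => ⟨hac k hk, hac k hk⟩)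
        (ContactTwins.refl J)
  · rintro ⟨h₂, h₃⟩ M _ _ _ _ _ hM W₁ _ _ _ _ W₂ _ _ _ _ J₁ J₂ e₁ e₂ he₁ he₂ hcover hseam₁ hseam₂ hξ
      hac ⟨Φ, hΦ⟩
    have hn : (∞ : WithTop ℕ∞) ≠ 0 := by simp
    have he₂' : Manifold.IsSmoothEmbedding (𝓡∂ 4) (𝓡 4) ∞ (e₂ ∘ Φ) := he₂.comp_diffeomorph Φ
    have hsurj : Function.Surjective (Φ : W₁ → W₂) := fun y => ⟨Φ.symm y, Φ.apply_symm_apply y⟩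
    have hrange : range (e₂ ∘ Φ) = range e₂ := by
      rw [range_comp, hsurj.range_eq, image_univ]
    have hcover' : range e₁ ∪ range (e₂ ∘ Φ) = univ := by rw [hrange]; exact hcover
    have hseam₁' : range e₁ ∩ range (e₂ ∘ Φ) = e₁ '' (𝓡∂ 4).boundary W₁ := by
      rw [hrange]; exact hseam₁
    have hseam₂' : range e₁ ∩ range (e₂ ∘ Φ) = (e₂ ∘ Φ) '' (𝓡∂ 4).boundary W₁ := by
      rw [hrange, image_comp, Φ.image_boundary hn]; exact hseam₂
    have hξ' := seamPlanes_comp_diffeomorph (fun w => contactPlane J₁.J w)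
      (fun w => contactPlane J₂.J w) he₂ hseam₂ hξ Φ hΦ
    have hac₁ : ∀ k, 0 < k → IsZero (singularHomology ℚ ℚ W₁ k) := fun k hk => (hac k hk).1
    by_cases hW : ContractibleSpace W₁
    · exact h₂ M hM W₁ J₁ e₁ (e₂ ∘ Φ) he₁ he₂' hcover' hseam₁' hseam₂' hξ'
    · exact h₃ M hM W₁ hW J₁ e₁ (e₂ ∘ Φ) he₁ he₂' hcover' hseam₁' hseam₂' hξ' hac₁

/-- **What the line proves without its lever, and what is left.** Given Stubs 2–3 the crux is
EQUIVALENT to its non-twin sector. If Stub 1 is refuted — §§9c–d rate this likely — the exact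
statement the route inherits is `NonTwinSector`: acyclic common-contact Stein bisections of
homotopy spheres with NON-contact-diffeomorphic halves are standard (SPC4-shielded, so it can only
be attacked positively; its inhabitants, if any, are cork twists of `S⁴` along Stein-compatibly
embedded exotic acyclic pairs). -/
theorem crux_iff_nonTwinSector_of_stub23 (h₂ : Stub2) (h₃ : Stub3) :
    ConvexBisection.AcyclicBisectionRigidity ↔ NonTwinSector :=
  ⟨fun h => (crux_iff_twin_and_nonTwin.1 h).2,
    fun hN => crux_iff_twin_and_nonTwin.2 ⟨twinSector_iff_stub23.2 ⟨h₂, h₃⟩, hN⟩⟩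

/-- The line's composition through the decomposition: `Stub1 ∧ Stub2 ∧ Stub3 → crux`
(= `crux_of_stubs`). -/
theorem crux_of_stubs' (h₁ : Stub1) (h₂ : Stub2) (h₃ : Stub3) :
    ConvexBisection.AcyclicBisectionRigidity :=
  (crux_iff_nonTwinSector_of_stub23 h₂ h₃).2 (nonTwinSector_of_stub1 h₁)

/-- Both sectors are SPC4-shielded (shape `∀ M ≃ₕ S⁴, … → M ≅ S⁴`): neither can be refuted short
of an exotic 4-sphere; only the lever Stub 1 is exposed. -/
theorem twin_and_nonTwin_of_spc4 (h : SmoothPoincare4) : TwinSector ∧ NonTwinSector :=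
  crux_iff_twin_and_nonTwin.1 (of_spc4 h)

end Targets

/-! ### §9c The adversary's verdict on Stub 1 (informal; every input cited at page level)

Stub 1 (⊇ the card's `AcyclicTwinsDiffeomorphic`, ⊇ "UQF rel nothing") is NOT implied by SPC4
and is trivially true on twins (`stub1_of_twins`), so its whole content is: *two ℚ-acyclic Stein
fillings `(W₁,J₁)`, `(W₂,J₂)` of ONE contact ℚHS³ `(Y, ξ)` whose union `W₁ ∪_ψ W̄₂` is a
homotopy sphere are contact-diffeomorphic.* KILL CRITERION: one pair with `W₁ ≇ W₂` (for
contractible fillings the union is automatically a homotopy 4-sphere: van Kampen + Mayer–Vietoris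
+ Hurewicz/Whitehead).

**(N1) The Karakurt–Oba–Ukida pairs cannot kill it.** KOU arXiv:1607.07661 Thm 1.2 (p. 3): the
Mazur-type corks `Wⁿ` (`W¹` = Akbulut cork) carry Stein structures `J₁ⁿ` (Legendrian handlebody)
and `J₂ⁿ` (planar PALF, Ukida) with `π(c⁺(ξ₁ⁿ)) ≠ 0 = π(c⁺(ξ₂ⁿ))`. Since `ξ₂ⁿ` is supported by a
planar open book and planarity is a contactomorphism invariant (equivalently: `π ∘ φ_* = φ̄_* ∘ π`
for every diffeomorphism `φ`, as `φ_*` preserves `T⁺ = ⋂ Uᵏ HF⁺`), `ξ₁ⁿ` and `ξ₂ⁿ` are NOT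
CONTACTOMORPHIC by any diffeomorphism of `∂Wⁿ`: the pair `(Wⁿ,J₁ⁿ), (Wⁿ,J₂ⁿ)` never forms a
common-contact bisection. (This answers half of the route's cheapest falsifier (1):
"`τ^*ξ₁ ≅ ξ₂`?" — no.) Moreover `τ_*ξ₁ ≄ ξ₁`: Akbulut–Karakurt (Gökova 2011, arXiv:1104.2247; =
KOU's Thm 2.2 source) distinguish `c⁺` of the two handlebody structures exchanged by the cork
involution, which is how `τ_*` is shown non-trivial on `HF⁺` — so `J₁` is not a "contact cork"
structure either. OPEN and decisive: `τ_*ξ₂ ≟ ξ₂` (both planar, equal `c⁺`, same `d₃`; no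
Heegaard Floer invariant separates them). (Bookkeeping: `∂W¹ = S³_{+1}(P(−3,3,−3))`, hyperbolic
— Dai–Hedden–Mallick arXiv:2002.02326 p. 15, where `(∂W¹, τ)` is moreover shown to be a STRONG
cork: `τ` extends over no ℤ-homology ball; the Akbulut–Kirby Mazur manifold bounded by
`Σ(2,5,7)` is `W⁻(3)`, a different manifold, Cavallo arXiv:2605.15095 Thm 1.2 ff.)

**(Q1) Contact Stein corks + a Weinstein Akbulut–Ruberman cobordism kill Stub 1.** CLAIM: let
`(C, f)` be a cork with a Stein structure `J` such that `f` is isotopic to a contactomorphism of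
`ξ_J`, and let `H` be an invertible homology cobordism from `∂C` to `N` with the extension property
of AR arXiv:1410.1461 Thm 1 (proof p. 6: every self-diffeomorphism of `N` extends over `H`,
isotopic to the identity on `∂C`) which carries a WEINSTEIN cobordism structure on `(∂C, ξ_J)`,
`H = H_Λ` (1-handles and 2-handles along a Legendrian link `Λ` with framing `tb − 1`). Then Stub 1
is false. *Proof.* `W₁ = (C,J) ∪ H_Λ` and `W₂ = (C,J) ∪ H_{f⁻¹Λ} ≅ C ∪_f H` are contractible
Stein domains, NOT diffeomorphic (AR's argument, p. 6, verbatim), and contact surgery is natural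
under the contactomorphism `f`, so `(∂W₂, ξ_{W₂}) ≅ (∂W₁, ξ_{W₁})`; glue by that contactomorphism:
a homotopy 4-sphere with an acyclic common-contact bisection and non-diffeomorphic halves. ∎
Akbulut–Yildiz arXiv:1901.00806 Thm 1 (§3.1 p. 6, Figs c7–c12) exhibit such a Weinstein `H`
(roping pictures: `H`'s handles are Legendrian on top of the cork's diagram) for the Akbulut cork
with its HANDLEBODY structure `J₁` — for which, alas, `τ ∉ Cont(ξ_{J₁})` by (N1); for another `J`
the Weinstein-ness of some AR cobordism is the (mild, unproved) remaining input. §9d below shows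
that Stub 1 itself FORCES a contact Stein cork to exist.

**(Q2) One-class boundaries kill Stub 1 by any second filling.** Mark–Tosun arXiv:1603.07710
Thm 1.7 (p. 4): `+Σ(2,3,6m+1)` has exactly two tight structures up to isotopy, CONTACTOMORPHIC to
each other, both Stein fillable with `θ = −2`; Alfieri–Cavallo–Matkovič arXiv:2605.13812 Prop 1.7
+ note (p. 3): on `Σ(3,4,5)`, `Σ(2,5,7)` and `Σ(2,3,6k+1)` the ONLY tight structures are `ξ_can`
and its conjugate `ξ̄_can` — which have the SAME underlying un-cooriented plane field, i.e. the same
`contactPlane` in the crux's formalisation. Hence ANY two ℤ-acyclic Stein fillings of one of these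
Brieskorn spheres have equal boundary plane fields up to isotopy; two non-diffeomorphic ones (or a
contractible one and a Stein 2-handlebody with `π₁ ≠ 1`) kill Stub 1 on the spot. Known fillings:
`Σ(2,3,13)`, `Σ(2,3,25)`, `Σ(2,5,7)`, `Σ(3,4,5)` bound Mazur-type contractibles (Akbulut–Kirby,
Casson–Harer, Fickle) but the AK filling of `Σ(2,3,13)` is Stein in NEITHER orientation (MT Thm 1.8)
and the AK fillings `W⁻(3)`, `W⁻(4)` of `Σ(2,5,7)`, `Σ(3,4,5)` carry NO symplectic structure
(Cavallo 2026 Thm 1.1); Gompf's Conjecture 1.1 predicts no AC-trivial contractible Stein filling of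
any Brieskorn sphere; non-Mazur ℤ-acyclic Stein fillings are not excluded (Cavallo p. 1). See §10b
for the census consequence.

**(Q3) Pigeonhole.** Akbulut–Ruberman Thm 5.3 (p. 8): from a cork with infinitely many relative
smoothings (Gompf's infinite-order corks, arXiv:1603.05090) one gets a contractible `V` with
HYPERBOLIC boundary `N` and infinitely many pairwise non-diffeomorphic smoothings `V_j = C ∪_{fʲ} X`.
If infinitely many `V_j` are Stein, then — tight contact structures on the atoroidal `N` being
finite up to isotopy (Colin–Giroux–Honda 2009, Publ. IHÉS 109, Thm 0.2 / announcement
arXiv:math/0305186) — two of them fill contactomorphic structures and kill Stub 1. Missing in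
print: Stein structures on the `V_j` (a Weinstein structure on Ruberman's invertible cobordism
`X` relative to `(∂C, (fʲ)_*ξ)`).

**Verdict for the lead/planner.** Stub 1 is one explicit construction away from refutation along
three independent lines, none of which touches SPC4; the literature trend (AR 2016, AY 2019, HMP
2021: ever smaller exotic contractible STEIN pairs with common boundary) runs against it; and §9d
turns (Q1) into a dichotomy with an explicit bisection of a (probably standard) cork twist of
`S⁴`. The adversary rates Stub 1 PROBABLY FALSE as stated and recommends that the line keep only
what its proof sketch actually uses: twins *up to a Stein-compatible cork twist inside one half*
(which re-routes the difference into Stub 2's sector), or twins for PLANAR seams with a fixed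
supporting open book (Wendl), where minimal-factorisation rigidity is a checkable statement. -/

/-! ### §9d The positron dichotomy (gen 3; Hayden arXiv:2107.06856 + branched-cover contact geometry)

**Inputs (print, page level).** Hayden 2021, Thm 1.2 (p. 3): infinitely many corks `P` (the
positron cork and the family `Wₙ`, §2.3 p. 6; also the Mazur cork, Fig. mazur) arise as double
branched covers `P = Σ(B⁴, D)` of a HOLOMORPHIC slice disc `D ⊂ B⁴ ⊂ ℂ²`, and the cork twist
`τ` of `∂P` is the lift of an involution `ι` of the slice knot `(S³, K = ∂D)` that extends to no
diffeomorphism of the pair `(B⁴, D)`; the second disc `D′ = ι̂(D)` (`ι̂` any extension of `ι` to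
`B⁴`) satisfies `(B⁴,D) ≇ (B⁴,D′)` rel boundary (§2.1 p. 5). Thm 1.4 (p. 4): for the positron
cork, `D` and `D′` are the braided surfaces of two quasipositive factorisations `β`, `β′` of
BRAID-ISOTOPIC 5-braids — so BOTH are holomorphic and their boundaries are TRANSVERSELY ISOTOPIC
transverse knots. Classical: the double cover of `B⁴ ⊂ ℂ²` branched along a positively braided
(holomorphic) surface is a Stein filling of the double cover `(Σ(K), ξ_K)` of `(S³, ξ_std)` branched
along the transverse braid `K` (Loi–Piergallini 2001; Harvey–Kawamuro–Plamenevskaya 2009,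
Plamenevskaya 2006: `(Σ(K), ξ_K)` is well defined up to contact isotopy by the transverse isotopy
class of `K`).

**Proposition (two Stein structures exchanged by the cork twist).** The positron cork `P` carries
Stein structures `J_A`, `J_B` with `ξ_{J_A}` ISOTOPIC TO `τ_*ξ_{J_B}` on `∂P`. *Proof.* Take Thm 1.4's
model: `D = S(β)`, `D′ = S(β′)` the braided (holomorphic) surfaces, `A := Σ(B⁴, D)`, `B := Σ(B⁴, D′)`
Stein fillings of `(Σ(β̂), ξ_{β̂})`, `(Σ(β̂′), ξ_{β̂′})`, and `c̃ : ∂A → ∂B` the contactomorphism lifting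
the contact isotopy `c` of `S³` that realises the braid isotopy `β̂ ↦ β̂′`. Hayden's mechanism for
"the braid isotopy extends to no smooth isotopy `D → D′`" (§1.2 p. 4: *replacing one factorisation
by the other corresponds to performing the cork twist*; Thm 1.2 + Thm 4.4) is the marked-manifold
identity (★) `(B, c̃) ≅ (A, τ)`: a diffeomorphism `Ξ : A → B` with `Ξ|∂A = c̃ ∘ τ` (up to isotopy
and extendable diffeomorphisms). Put `P := A`, `J_B := J_D`, `J_A := Ξ^*J_{D′}`: then on `∂P`,
`ξ_{J_A} = (Ξ|∂)^*ξ_{β̂′} = τ^* c̃^* ξ_{β̂′} = τ^*ξ_{β̂} = τ_*ξ_{J_B}` (`τ` an involution up to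
isotopy). ∎ (If one prefers §2.1's model `D′ = ι̂(D)`, (★) is literally the lift `ι̃` of `ι̂`,
`ι̃|∂ = τ` by Thm 1.2, and the contact input is that `∂D`, `∂D′` are transversely isotopic with the
boundary identifications matched as in Thm 4.4 — which is what Thm 1.4 asserts.)

**Corollary (an unconditional member of the crux class).** The cork twist of the round sphere
along the doubled positron cork, `Σ_P := P ∪_τ P̄` (`S⁴ = D(P)` re-glued by `τ`), carries an acyclic
common-contact Stein bisection: halves `(P, J_B)` and `(P, J_A′)` with `J_A′` a collar modification
of `J_A` making `ξ_{J_A′} = τ_*ξ_{J_B}` exactly (Gray), glued by `τ ∈ Cont((∂P,ξ_{J_B}) → (∂P,ξ_{J_A′}))`.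
So `Σ_P ≃ₕ S⁴` is a TEST SPHERE of the crux needing no contact-cork hypothesis (contrast §7 (T3));
`Σ_P` is expected to be standard (twists of `S⁴` along doubled symmetric-link corks), in which
case the following dichotomy plays out INSIDE THE ROUND `S⁴`.

**Theorem (positron dichotomy).** Either Stub 1 is FALSE on the bisection above, or the positron
cork is a CONTACT STEIN CORK: there is `s ∈ Diff(∂P)` with `s_*ξ_{J_B} = ξ_{J_B}` that extends to a
homeomorphism but to no diffeomorphism of `P`. *Proof.* If Stub 1 holds on it, there is
`Φ ∈ Diff(P)` with `Φ_*ξ_{J_B} = ξ_{J_A′} = τ_*ξ_{J_B}` on `∂P`; put `s := τ⁻¹ ∘ Φ|∂P`. Then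
`s_*ξ_{J_B} = ξ_{J_B}`, and `s` extends over `P` iff `τ = Φ|∂P ∘ s⁻¹` does — it does not (cork);
`s` extends homeomorphically because `P` is contractible with homology-sphere boundary (Freedman). ∎
(Equivalently, in the two-manifold picture `W₁ = (A, J_D)`, `W₂ = (B, J_{D′})` glued by `c̃`: Stub 1
gives `Φ : A → B`, `s := c̃⁻¹ ∘ Φ|∂ ∈ Cont(ξ_{β̂})`, and `s` extends over `A` iff `c̃` extends to a
diffeomorphism `A → B`, iff — by (★) — `τ` extends: no.)
No MCG input is used. With (Q1): Stub 1 ⇒ contact Stein cork `(P, s, J_B)` ⇒ (given a Weinstein AR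
cobordism on `(∂P, ξ_{J_B})`) ¬Stub 1. So Stub 1 survives only in the narrow world where contact
Stein corks exist but admit no Weinstein Akbulut–Ruberman enlargement. DECISIVE COMPUTATION, now
concrete: is `τ_* c(ξ_K)` in the `Diff(P)|∂`-orbit of `c(ξ_K)`, for `ξ_K` the branched double cover
of Hayden's transverse 5-braid `β̂` (HKP/LOSS transverse invariants; DHM's computation of `τ_*` on
`HF` of the positron family)? A negative answer refutes Stub 1 outright, on `Σ_P`. -/

/-! ### §9f The `tb`-test for contact corks and the mapping-class refinement of §9d (gen 4, informal)

Every route to a kill of Stub 1 (Q1, the second horn of §9d, the route's own cheapest falsifier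
"`τ^*ξ₂ ≟ ξ₂` on the Akbulut cork") asks whether a cork twist is ISOTOPIC TO A CONTACTOMORPHISM of a
Stein-induced contact structure. Heegaard Floer contact classes decide this only up to the unknown
action of `MCG(Y)`; the following classical test is cheaper and one-sided.

**Lemma (`tb`-test).** Let `(C, J)` be a compact Stein domain with boundary `(Y, ξ) = (∂C, ξ_J)`,
`Y` an integral homology sphere, `f ∈ Diff⁺(Y)`, and `γ ⊂ Y` a knot bounding a smoothly embedded
disc in `C`. If `f` is smoothly isotopic to a contactomorphism `φ` of `ξ`, then EVERY Legendrian
knot `L ⊂ (Y, ξ)` in the smooth isotopy class of `f(γ)` has `tb(L) ≤ −1 − |rot(L)| ≤ −1`.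
*Proof.* `φ⁻¹(L)` is Legendrian and smoothly isotopic to `φ⁻¹f(γ) ≃ γ` (`φ⁻¹f` is isotopic to
the identity), hence bounds a smooth disc in `C` (push the isotopy into a collar). Slice–Bennequin
in the Stein filling `(C, J)` (Lisca–Matić 1997; Akbulut–Matveyev 1997: `tb + |rot| ≤ 2g − 1` for
the genus of any smooth surface in `C`) gives `tb(φ⁻¹L) + |rot(φ⁻¹L)| ≤ −1`, and `φ` preserves
`tb` (contact framing and Seifert framing) and `|rot|`. ∎
**Certificate.** ONE Legendrian representative of `f(γ)` with `tb ≥ 0` proves that `f` is NOT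
isotopic to any contactomorphism of `ξ_J`. For a cork drawn as a symmetric link `A ∪ B` (dotted
`A`, `0`-framed `B`, `f = τ` the link symmetry): `γ = μ_B` bounds the cocore of the 2-handle and
`τ(μ_B) = μ_A`; the Seifert framing of `μ_A` in `∂C` equals its diagram framing (correction
`ℓᵀQ⁻¹ℓ = 0` for `Q = (0 1; 1 0)`, `ℓ = (1, 0)`), so the test reads: *find a Legendrian
realisation of the meridian of the dotted circle with diagram-`tb ≥ 0` in a Stein picture of
`(C, J)`* (for an open-book / PALF presentation such as Karakurt–Oba–Ukida's planar `ξ₂`: realise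
`μ_A` on a page; then `tb = page framing − Seifert framing`, a linking-matrix computation). The
naive realisation (one passage over the 1-handle, two cusps) has `tb = −1`, so the test is
genuinely about the knot type of `μ_A` in `(∂C, ξ_J)`; it was not run here (no diagram tools on
this hub) and is recorded as the cheapest open computation of the whole line. The test is
ONE-SIDED: `tb̄(μ_A) ≤ −1` does not make `τ` contact — confirming a contact cork still needs a
contactomorphism in hand (e.g. Hayden's holomorphic model, §9d) — but a positive `tb` kills (Q1)'s
input for that `(C, J)`, and for `J₁` on the Akbulut cork it reproves Akbulut–Karakurt's
`τ_*ξ₁ ≄ ξ₁` without Floer homology if it applies.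

**Mapping-class refinement of the positron dichotomy.** In horn 2 of §9d the contact-cork map is
`s = τ⁻¹ ∘ Φ|∂P` for some `Φ ∈ Diff(P)`. Let `ρ : Diff(P) → π₀Diff⁺(∂P)`. If `im ρ = 1` — e.g.
when `∂P` is hyperbolic with `Isom(∂P) = ⟨τ⟩ ≅ ℤ/2` (Gabai–Meyerhoff–Thurston: `MCG = Isom`;
`τ ∉ im ρ` because `P` is a cork, and a mapping class isotopic to an extendable diffeomorphism
extends) — then `Φ|∂P ≃ id` and `s ≃ τ`: **`τ` itself is isotopic to a contactomorphism of
`ξ_{J_B}`**, and the `tb`-test applies with `f = τ`. So, GIVEN (I1) Hayden's identity (★) of §9d,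
(I2) `Isom(∂P) = ⟨τ⟩` (a SnapPy computation once `∂P` is known hyperbolic — expected; for the
Akbulut cork `∂W¹ = S³_{+1}(P(−3,3,−3))` hyperbolicity is in DHM arXiv:2002.02326), the statement
"Stub 1 holds on `Σ_P`" implies `tb̄(τγ; ξ_{J_B}) ≤ −1` for every `P`-slice knot `γ ⊂ ∂P`, and
(I3) ONE `P`-slice `γ` with a Legendrian representative of `τ(γ)` of `tb ≥ 0` in `(∂P, ξ_{J_B})`
REFUTES STUB 1 — with the standard sphere `Σ_P` (if, as expected, `Σ_P ≅ S⁴`) as the ambient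
homotopy sphere and `(P, J_B)`, `(P, J_A′)` as the non-contact-diffeomorphic halves. Neither (I2)
nor (I3) is in print to this file's knowledge (searched under degraded conditions, gen 4); both
are finite computations (SnapPy; a front for `ξ_{J_B}` from the quasipositive braid `β` via the
Harvey–Kawamuro–Plamenevskaya open book of a branched double cover). If instead `im ρ ≠ 1`, the
extendable classes must be divided out first: the test is then "`tb̄(τ g γ) ≤ −1` for all
`P`-slice `γ` and some extendable `g`", still finite over `Isom(∂P)`. -/

/-! ## §10 Reducible seams split; `Σ° × I` halves are never Stein (informal theorem, gen 3)

**Theorem (WLOG the seam is prime).** Let `M = e₁(W₁) ∪ e₂(W₂)` be an acyclic common-contact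
Stein bisection of a homotopy 4-sphere with seam `(Γ, ξ)`, and suppose `Γ = Γ₁ # Γ₂` along an
embedded sphere `S ⊂ Γ`. Then `S` bounds properly embedded 3-balls `D₁ ⊂ W₁` and `D₂ ⊂ W₂`
(Eliashberg 1990, *Filling by holomorphic discs*, Thm 5.1/§6: a 2-sphere in the `J`-convex
boundary of a Stein domain is filled by holomorphic discs and bounds an embedded ball; with Colin
1997 / Ding–Geiges: `ξ = ξ₁ # ξ₂` uniquely and `Wᵢ ≅ Wᵢ¹ ♮ Wᵢ²` as Stein fillings of `(Γ₁,ξ₁)`,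
`(Γ₂,ξ₂)`); `D₁ ∪_S D₂ ≅ S³` splits `M = M₁ # M₂`, each `Mⱼ ≃ₕ S⁴` carrying the acyclic
common-contact Stein bisection `W₁ʲ ∪ W₂ʲ` along `Γⱼ` (summands of ℚ-acyclic domains are
ℚ-acyclic; `π₁ M = π₁M₁ ∗ π₁M₂`). Hence the crux for prime seams implies the crux
(`S⁴ # S⁴ = S⁴`), and the seam-`S³` summand is the known base case (`SphereSeamStandard`).

**Corollary (`Σ° × I` is never Stein).** For an integral homology sphere `Σ ≠ S³`, the product
`Q = Σ° × I` (`Σ° = Σ ∖ B³`; `∂Q = Σ # Σ̄`) admits no Stein structure, indeed no weak symplectic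
filling structure of any contact structure on `∂Q`. *Proof.* The neck sphere
`S = ∂Σ° × {½}` would bound a proper 3-ball `D ⊂ Q`; `D` separates `Q` (`H¹(Q;ℤ/2) = 0`) with
`Σ° × 0`, `Σ° × 1` on different sides, so `S' = D ∪ (B³ × {½}) ≅ S³ ⊂ Σ × ℝ` separates the two
ends and `[S'] = ±[Σ × pt] ≠ 0` in `H₃(Σ × ℝ) ≅ ℤ`; but `S'` is simply connected, so it lifts to
the universal cover `Σ̃ × ℝ`, where `H₃ = 0` (`π₁Σ` infinite) or the projection multiplies `H₃` by
`|π₁Σ| > 1` (`Σ = Σ(2,3,5)`-type) — contradiction either way. ∎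
**Census consequence.** Every ℤHS `Σ ⊂ S⁴` (e.g. `Σ = ∂W` for a Mazur-type `W`, `S⁴ = D(W)`)
gives the SMOOTH acyclic bisection `S⁴ = (A ♮_γ B) ∪ (Σ° × I)` (`γ` an arc across the collar of
`Σ`; halves a homology ball with `π₁ = π₁A ∗ π₁B` and `Σ° × I` with `π₁ = π₁Σ ≠ 1` — never twins,
not even homotopy equivalent), and NONE of these is a Stein bisection. With §5c (lens sums:
smoothly present, Stein-absent by Etnyre–Tosun Thm 8, itself an instance of the splitting
theorem: a ℚHB filling of `L(p,q) # L(p,p−q)` would split into ℚHB fillings of both summands)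
this is the second place where the Stein hypothesis removes a smooth sector that homology allows;
both removed sectors are exactly the ones with NON-TWIN halves that the adversary could write down.
So far: every acyclic common-contact Stein bisection of a homotopy sphere known to this file has
twin halves `(W, J) = (W, J)` or (new, §9d) halves `(P, J_B)`, `(P, J_A)` on ONE smooth cork.

### §10b Brieskorn seams (gen 3; print of April–May 2026)

In an acyclic Stein bisection with seam an integral homology sphere `Γ`, both halves are
ℚ-acyclic Stein fillings of the SAME oriented `(Γ, ξ)`, hence ℤ-homology balls with perfect `π₁`
(Alfieri–Cavallo–Matkovič arXiv:2605.13812 Lemma 1.2, p. 2: a ℚHB Stein filling of a ℤHS is a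
ℤHB — Stein domains are 2-complexes). For BRIESKORN seams the 2026 classification bites hard:
* `Γ = −Σ(a₁,a₂,a₃)` (opposite of the canonical orientation): NO ℚHB symplectic filling for any
  contact structure (ACM Thm 1.4, p. 3) — this orientation never occurs; for `n > 3` fibres the
  same holds for every `η` without half convex Giroux torsion (Thm 1.5).
* `Γ = +Σ(a₁,…,aₙ)` with `ξ = ξ_can` or `ξ̄_can` (the only structures known to bound ℚHB fillings
  on any negative-definite Seifert space, p. 3): NO ℚHB symplectic filling unless
  `Γ ∈ {Σ(3,4,5), Σ(2,5,7), Σ(2,3,6k+1)}` (Thms 1.4, 1.5); on these three families `ξ_can`, `ξ̄_can`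
  are the only tight structures at all (Prop 1.7 + note), one un-cooriented plane field.
* Whether ANY of `Σ(3,4,5)`, `Σ(2,5,7)`, `Σ(2,3,6k+1)` bounds a ℚHB symplectic filling is OPEN
  (Cavallo arXiv:2605.15095 p. 1); the Akbulut–Kirby Mazur fillings are not symplectic
  (Cavallo Thm 1.1: `W⁻(m)`, `m = 2,3,4`, i.e. `Σ(2,3,13)`, `Σ(2,5,7)`, `Σ(3,4,5)`; Mark–Tosun
  Thm 1.8), and Gompf's Conjecture 1.1 (ACM Conj. 1.1, p. 2) predicts that no Brieskorn sphere
  bounds a pseudoconvex domain in `ℂ²` (⟺ a ℤHB Stein filling embedding in `ℂ²`, Gompf 2013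
  Cor. 3.1).
**Consequences.** (i) The Brieskorn sector of the crux is EMPTY except possibly for seams in the
three families with `ξ = ξ_can` as plane field, and no inhabitant is known; if the generalised
Gompf conjecture holds it is empty. (ii) In that sector Stub 1 ⟺ "ℤHB Stein fillings of
`(Σ, ξ_can)` are unique up to diffeomorphism" and the crux ⟺ "`W₁ ∪_ψ W̄₂ ≅ S⁴` for any two such
fillings and `ψ ∈ Cont(ξ_can)`" (`MCG(Σ(p,q,r)) = ℤ/2`). (iii) For the CENSUS of seams (route glue
R-b and Stub 3's sector): after lens spaces (§5), lens sums (§5c), `Σ° × I`-type reducible seams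
(§10) and `−Σ(2,3,12n+1)` (§5c), now ALL oppositely oriented 3-fibre Brieskorn spheres and all
canonically oriented ones outside three families are excluded — by the Stein hypothesis alone. -/

/-! ## §11 Transport and the characterisation form of the crux (gen 4, formal)

The embeddings of a bisection can be post-composed with any diffeomorphism of the ambient
manifold (tree lemma `Manifold.IsSmoothEmbedding.diffeomorph_comp`, ClosedBallProofs — the
target-side companion of the source-side `comp_diffeomorph` used in §9b); the pushed-forward
complex tangencies at a seam point are both moved by the same differential. Consequences: the
hypothesis `AcyclicBisection` is a diffeomorphism invariant, EVERY standard sphere satisfies it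
(the converse of the crux's implication is a theorem), and the crux is the claim that acyclic
Stein bisectability CHARACTERISES `S⁴` among homotopy 4-spheres. -/

section Transport

variable {M N : Type} [TopologicalSpace M] [ChartedSpace E4 M] [TopologicalSpace N]
  [ChartedSpace E4 N]

/-- Pushing a subspace forward by `d(Ψ ∘ e)` is pushing it by `de` and then by `dΨ` (chain rule;
`e` smooth, `Ψ` a diffeomorphism). -/
theorem map_mfderiv_diffeomorph_comp [IsManifold (𝓡 4) ∞ M] [IsManifold (𝓡 4) ∞ N]
    {W : Type} [TopologicalSpace W] [ChartedSpace (EuclideanHalfSpace 4) W] [IsManifold (𝓡∂ 4) ∞ W]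
    (Ψ : M ≃ₘ⟮𝓡 4, 𝓡 4⟯ N) {e : W → M} (he : ContMDiff (𝓡∂ 4) (𝓡 4) ∞ e) (w : W)
    (S : Submodule ℝ E4) :
    Submodule.map (mfderiv (𝓡∂ 4) (𝓡 4) (Ψ ∘ e) w).toLinearMap S =
      Submodule.map (mfderiv (𝓡 4) (𝓡 4) Ψ (e w)).toLinearMap
        (Submodule.map (mfderiv (𝓡∂ 4) (𝓡 4) e w).toLinearMap S) := by
  have hΨ : MDifferentiableAt (𝓡 4) (𝓡 4) Ψ (e w) := Ψ.mdifferentiable (by simp) (e w)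
  have he' : MDifferentiableAt (𝓡∂ 4) (𝓡 4) e w := he.mdifferentiableAt (by simp)
  rw [← Submodule.map_comp, mfderiv_comp w hΨ he']
  rfl

/-- **Transport of acyclic bisections along diffeomorphisms of the ambient manifold**: post-compose
both embeddings with `Ψ : M ≅ N`; covering, seam and acyclicity conditions move set-theoretically
(`Ψ` bijective), smooth-embedding-ness by `IsSmoothEmbedding.diffeomorph_comp`, and the contact
matching by `map_mfderiv_diffeomorph_comp` at the common seam point. -/
theorem AcyclicBisection.transport [IsManifold (𝓡 4) ∞ M] [IsManifold (𝓡 4) ∞ N]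
    (Ψ : M ≃ₘ⟮𝓡 4, 𝓡 4⟯ N) (h : AcyclicBisection M) : AcyclicBisection N := by
  obtain ⟨W₁, _, _, _, _, W₂, _, _, _, _, J₁, J₂, e₁, e₂, he₁, he₂, hcover, hseam₁, hseam₂, hξ, hac⟩ := h
  have hinj : Injective Ψ := Ψ.injective
  have hsurj : Surjective Ψ := Ψ.surjective
  refine ⟨W₁, _, _, _, _, W₂, _, _, _, _, J₁, J₂, Ψ ∘ e₁, Ψ ∘ e₂, he₁.diffeomorph_comp Ψ,
    he₂.diffeomorph_comp Ψ, ?_, ?_, ?_, ?_, hac⟩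
  · rw [range_comp, range_comp, ← image_union, hcover, image_univ, hsurj.range_eq]
  · rw [range_comp, range_comp, ← image_inter hinj, hseam₁, image_comp]
  · rw [range_comp, range_comp, ← image_inter hinj, hseam₂, image_comp]
  · intro w₁ w₂ hw
    have hw' : e₁ w₁ = e₂ w₂ := hinj hw
    rw [map_mfderiv_diffeomorph_comp Ψ he₁.contMDiff, map_mfderiv_diffeomorph_comp Ψ he₂.contMDiff,
      hξ w₁ w₂ hw', hw']

/-- **Acyclic Stein bisectability is a diffeomorphism invariant.** -/
theorem acyclicBisection_iff_of_diffeomorph [IsManifold (𝓡 4) ∞ M] [IsManifold (𝓡 4) ∞ N]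
    (Ψ : M ≃ₘ⟮𝓡 4, 𝓡 4⟯ N) : AcyclicBisection M ↔ AcyclicBisection N :=
  ⟨AcyclicBisection.transport Ψ, AcyclicBisection.transport Ψ.symm⟩

/-- **Every standard sphere is acyclically bisected**: `M ≅ S⁴ ⇒ AcyclicBisection M` (transport
of the hemisphere bisection `acyclicBisection_sphere`). This is the CONVERSE of the crux's
implication, and it holds unconditionally. -/
theorem acyclicBisection_of_diffeomorph_sphere [IsManifold (𝓡 4) ∞ M] (Ψ : M ≃ₘ⟮𝓡 4, 𝓡 4⟯ 𝕊⁴) :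
    AcyclicBisection M :=
  AcyclicBisection.transport Ψ.symm acyclicBisection_sphere

end Transport

/-- **Characterisation form of the crux.** `AcyclicBisectionRigidity` holds iff, for every
homotopy 4-sphere `M`, "`M` carries an acyclic common-contact Stein bisection" is EQUIVALENT to
"`M` is diffeomorphic to `S⁴`". (The inner `←` is `acyclicBisection_of_diffeomorph_sphere`; with
the sibling crux `AcyclicBisectionExists` the left side of the inner equivalence is always true
and one recovers `iff_spc4_of_exists`.) For provers: the statement to prove is a RECOGNITION
theorem for `S⁴` by a diffeomorphism-invariant geometric structure, of the same logical shape as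
"admits a metric of positive isotropic curvature" or "is a twisted double of `B⁴`" (Cerf). -/
theorem crux_iff_characterisation :
    ConvexBisection.AcyclicBisectionRigidity ↔
      ∀ (M : Type) [TopologicalSpace M] [T2Space M] [SecondCountableTopology M]
        [ChartedSpace E4 M] [IsManifold (𝓡 4) ∞ M],
        M ≃ₕ 𝕊⁴ → (AcyclicBisection M ↔ Nonempty (M ≃ₘ⟮𝓡 4, 𝓡 4⟯ 𝕊⁴)) :=
  ⟨fun h M _ _ _ _ _ e => ⟨h M e, fun ⟨Ψ⟩ => acyclicBisection_of_diffeomorph_sphere Ψ⟩,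
    fun h M _ _ _ _ _ e hb => (h M e).1 hb⟩

/-- **Counterexamples are whole diffeomorphism classes**: if `M` is a counterexample to the crux
(a homotopy sphere, acyclically bisected, not diffeomorphic to `S⁴`) then so is every `N ≅ M`.
With `exotic_of_not`: `¬ crux` ⟺ some DIFFEOMORPHISM CLASS of exotic 4-spheres is acyclically
Stein-bisectable. -/
theorem counterexample_transport {M N : Type} [TopologicalSpace M] [ChartedSpace E4 M]
    [IsManifold (𝓡 4) ∞ M] [TopologicalSpace N] [ChartedSpace E4 N] [IsManifold (𝓡 4) ∞ N]
    (Ψ : M ≃ₘ⟮𝓡 4, 𝓡 4⟯ N)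
    (h : Nonempty (M ≃ₕ 𝕊⁴) ∧ AcyclicBisection M ∧ IsEmpty (M ≃ₘ⟮𝓡 4, 𝓡 4⟯ 𝕊⁴)) :
    Nonempty (N ≃ₕ 𝕊⁴) ∧ AcyclicBisection N ∧ IsEmpty (N ≃ₘ⟮𝓡 4, 𝓡 4⟯ 𝕊⁴) := by
  obtain ⟨⟨e⟩, hb, hne⟩ := h
  refine ⟨⟨(Ψ.symm.toHomeomorph.toHomotopyEquiv).trans e⟩, hb.transport Ψ, ⟨fun Φ => ?_⟩⟩
  exact hne.elim (Ψ.trans Φ)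

/-- The negation of the crux in transport-closed form: an acyclically bisected homotopy sphere
ALL of whose diffeomorphic copies fail to be `S⁴` (trivially equivalent to `exotic_of_not`'s
conclusion, recorded to make the "diffeomorphism class" reading explicit). -/
theorem not_crux_iff :
    ¬ ConvexBisection.AcyclicBisectionRigidity ↔
      ∃ (M : Type) (_ : TopologicalSpace M) (_ : T2Space M) (_ : SecondCountableTopology M)
        (_ : ChartedSpace E4 M) (_ : IsManifold (𝓡 4) ∞ M),
        Nonempty (M ≃ₕ 𝕊⁴) ∧ AcyclicBisection M ∧ IsEmpty (M ≃ₘ⟮𝓡 4, 𝓡 4⟯ 𝕊⁴) := by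
  refine ⟨exotic_of_not, ?_⟩
  rintro ⟨M, _, _, _, _, _, ⟨e⟩, hb, hne⟩ h
  exact hne.elim (Classical.choice (h M e hb))

/-! ## §12 The double (identity-glued) sector (gen 4)

The sibling disprover of crux 4 proved that every double `P = D(W) = W ∪_id W` of a compact Stein
domain (tree predicate `Literature.Topology.FourManifolds.IsDouble`) is a Stein bisection along a
common contact seam with the SAME structure on both halves (`steinBisection_of_isDouble`, p69875).
Hence the crux contains the sector "homotopy-sphere doubles of ONE ℚ-acyclic Stein domain are
`S⁴`" — formal below.

**Informal theorem (the double sector is the contractible double sector).** If `W` is a compact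
connected 4-manifold with connected boundary and `H_k(W; ℚ) = 0` for `k > 0`, and the double
`D(W)` is simply connected, then `W` is CONTRACTIBLE. *Proof.* Van Kampen:
`π₁ D(W) = G ∗_H G` with `G = π₁ W`, `H = im(π₁ ∂W → G)` (both inclusions are the same map), and
each factor embeds in an amalgamated free product (the fold `G ∗_H G → G` is a retraction); so
`G = 1`. Then `H₁ W = 0`; `tors H₂(W) ≅ tors H^3(W) ≅ tors H₁(W, ∂W)` (universal coefficients +
Lefschetz duality) and `H₁(W, ∂W) ≅ ker(H̃₀ ∂W → H̃₀ W) = 0` (connected boundary), so `H₂ W` is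
torsion-free of rank `b₂ = 0`, i.e. `0`; `H₃ W ≅ H¹(W, ∂W) = 0`, `H₄ W = 0`. A simply connected
compact manifold (a CW complex) with vanishing reduced homology is contractible (Whitehead). ∎
(Connectedness of `W` and `∂W` is automatic for a half of a bisection of a homology 4-sphere,
§8 (iii).) **Consequences.** (i) The `ψ = id` slice of the crux (`DoubleSector` restricted to
homotopy spheres, which is all of it) coincides with the `ψ = id` slice of crux 4, i.e. with the
presentation-sphere sector of §4b — the crux adds NOTHING identity-glued beyond crux 4. (ii) Stub
3's torsion sector (`W` ℚ-acyclic, not contractible, twins) consists entirely of twisted doubles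
`W ∪_ĉ W̄` whose gluing contactomorphism `ĉ` extends over NEITHER copy of `W` as a diffeomorphism
(if it extended, re-gluing — tree lemma `IsBoundaryGluing.comp_diffeomorph` — would present `M`
as `D(W)`, simply connected, forcing `W` contractible): every inhabitant of Stub 3 is a RATIONAL
CONTACT CORK TWIST, like the `S³/Q₈` example of §5b (`ψ` moves the kernel line, so it does not
even extend homologically). (iii) Likewise in Stub 2's sector, `W ∪_ĉ W̄` with `ĉ` extendable is a
presentation sphere; the new content of Stub 2 beyond §4b is exactly the contact cork twists of
doubles, Gompf's Q2.2 in Stein clothing. -/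

section DoubleSector

open Summit.SmoothPoincare4.SmoothPoincare4.Theorems.ContractibleTwistedDoubleStandard.Negative
  (steinBisection_of_isDouble double_standard_of_crux mfderiv_apply_eq_of_comp_incl_eq)

/-- **The double sector of the crux**: doubles `P = W ∪_id W` (tree predicate `IsDouble`) of ONE
compact ℚ-acyclic Stein domain `(W, J)`, same structure on both halves, that are homotopy
4-spheres are diffeomorphic to `S⁴`. -/
def DoubleSector : Prop :=
  ∀ (W : Type) [TopologicalSpace W] [ChartedSpace (EuclideanHalfSpace 4) W] [IsManifold (𝓡∂ 4) ∞ W]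
    [CompactSpace W] (_J : SteinStructure W)
    (b : Literature.Topology.FourManifolds.BoundaryData (𝓡∂ 4) W (𝓡 3))
    (P : Type) [TopologicalSpace P] [T2Space P] [SecondCountableTopology P] [ChartedSpace E4 P]
    [IsManifold (𝓡 4) ∞ P],
    Literature.Topology.FourManifolds.IsDouble b (𝓡 4) P →
    (∀ k, 0 < k → IsZero (singularHomology ℚ ℚ W k)) → P ≃ₕ 𝕊⁴ → Nonempty (P ≃ₘ⟮𝓡 4, 𝓡 4⟯ 𝕊⁴)

/-- **The crux implies its double sector** (a double of a compact Stein domain is an acyclic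
common-contact Stein bisection as soon as the domain is ℚ-acyclic: `steinBisection_of_isDouble`).
On paper this sector is exactly the presentation-sphere sector of crux 4 (informal theorem above):
refutable only by an exotic presentation sphere `Σ(𝒫, ε)`. -/
theorem doubleSector_of_crux (h : ConvexBisection.AcyclicBisectionRigidity) : DoubleSector := by
  intro W _ _ _ _ J b P _ _ _ _ _ hD hac hP
  obtain ⟨jA, jB, hA, hB, hU, hL, hR, hC⟩ := steinBisection_of_isDouble b J hD
  exact h P hP ⟨W, _, _, _, _, W, _, _, _, _, J, J, jA, jB, hA, hB, hU, hL, hR, hC,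
    fun k hk => ⟨hac k hk, hac k hk⟩⟩

/-- The double sector also follows from Stub 2 ∧ Stub 3 (doubles are twin bisections:
`twinSector_iff_stub23` + reflexivity of twin data). -/
theorem doubleSector_of_stub23 (h₂ : Stub2) (h₃ : Stub3) : DoubleSector := by
  intro W _ _ _ _ J b P _ _ _ _ _ hD hac hP
  obtain ⟨jA, jB, hA, hB, hU, hL, hR, hC⟩ := steinBisection_of_isDouble b J hD
  exact twinSector_iff_stub23.2 ⟨h₂, h₃⟩ P hP W W J J jA jB hA hB hU hL hR hC
    (fun k hk => ⟨hac k hk, hac k hk⟩) (ContactTwins.refl J)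

/-- The CONTRACTIBLE double sector follows from crux 4 directly (sibling theorem
`double_standard_of_crux`, which needs neither acyclicity nor `P ≃ₕ S⁴` as hypotheses — they are
automatic for doubles of contractible domains). -/
theorem doubleSector_contractible_of_crux4 (h : ConvexBisection.ContractibleTwistedDoubleStandard)
    (W : Type) [TopologicalSpace W] [ChartedSpace (EuclideanHalfSpace 4) W] [IsManifold (𝓡∂ 4) ∞ W]
    [CompactSpace W] [ContractibleSpace W] (J : SteinStructure W)
    (b : Literature.Topology.FourManifolds.BoundaryData (𝓡∂ 4) W (𝓡 3))
    (P : Type) [TopologicalSpace P] [T2Space P] [SecondCountableTopology P] [ChartedSpace E4 P]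
    [IsManifold (𝓡 4) ∞ P] (hD : Literature.Topology.FourManifolds.IsDouble b (𝓡 4) P) :
    Nonempty (P ≃ₘ⟮𝓡 4, 𝓡 4⟯ 𝕊⁴) :=
  double_standard_of_crux h W J b P hD

/-! ### §12b Seam-compatible twins are doubles; the THREE-SECTOR DECOMPOSITION (gen 4, formal)

Twin data `Φ : W₁ ≅ W₂` is *seam-compatible* if along `∂W₁` it IS the seam identification
(`e₂ (Φ w) = e₁ w`). Then `M` is literally a double of `W₁` (pieces `e₁`, `e₂ ∘ Φ`), and `Φ` is
automatically a contact twin. Splitting the twin sector by this predicate gives the final shape: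
`crux ⟺ DoubleSector ∧ CorkTwistSector ∧ NonTwinSector` — presentation spheres, contact cork
twists of doubles, exotic-pair regluings — with the line's residual stubs worth exactly the first
two (`stub23_iff_double_and_corkTwist`). -/

/-- **Seam-compatible twin data**: a diffeomorphism of the halves which, along `∂W₁`, is the seam
identification `e₂⁻¹ ∘ e₁`. -/
def SeamCompatible {M W₁ W₂ : Type} [TopologicalSpace W₁] [ChartedSpace (EuclideanHalfSpace 4) W₁]
    [TopologicalSpace W₂] [ChartedSpace (EuclideanHalfSpace 4) W₂] (e₁ : W₁ → M) (e₂ : W₂ → M) :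
    Prop :=
  ∃ Φ : W₁ ≃ₘ⟮𝓡∂ 4, 𝓡∂ 4⟯ W₂, ∀ w, w ∈ (𝓡∂ 4).boundary W₁ → e₂ (Φ w) = e₁ w

section SeamCompatible

variable {M : Type} [TopologicalSpace M] [ChartedSpace E4 M] [IsManifold (𝓡 4) ∞ M]
  {W₁ : Type} [TopologicalSpace W₁] [ChartedSpace (EuclideanHalfSpace 4) W₁] [IsManifold (𝓡∂ 4) ∞ W₁]
  {W₂ : Type} [TopologicalSpace W₂] [ChartedSpace (EuclideanHalfSpace 4) W₂] [IsManifold (𝓡∂ 4) ∞ W₂]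

omit [IsManifold (𝓡 4) ∞ M] in
/-- **Seam-compatible twins present `M` as a DOUBLE of `W₁`** in the sense of the tree's
`IsDouble` (pieces embedded by `e₁` and `e₂ ∘ Φ`; the gluing relation collapses to the identity
of `∂W₁` by the seam condition and injectivity of `e₁`, `e₂`, `Φ`). -/
theorem isDouble_of_seamCompatible {e₁ : W₁ → M} {e₂ : W₂ → M}
    (he₁ : Manifold.IsSmoothEmbedding (𝓡∂ 4) (𝓡 4) ∞ e₁)
    (he₂ : Manifold.IsSmoothEmbedding (𝓡∂ 4) (𝓡 4) ∞ e₂)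
    (hcover : range e₁ ∪ range e₂ = univ)
    (hseam₁ : range e₁ ∩ range e₂ = e₁ '' (𝓡∂ 4).boundary W₁)
    (Φ : W₁ ≃ₘ⟮𝓡∂ 4, 𝓡∂ 4⟯ W₂) (hΦ : ∀ w, w ∈ (𝓡∂ 4).boundary W₁ → e₂ (Φ w) = e₁ w)
    (b : Literature.Topology.FourManifolds.BoundaryData (𝓡∂ 4) W₁ (𝓡 3)) :
    Literature.Topology.FourManifolds.IsDouble b (𝓡 4) M := by
  have hsurj : Function.Surjective (Φ : W₁ → W₂) := fun y => ⟨Φ.symm y, Φ.apply_symm_apply y⟩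
  have hrange : range (e₂ ∘ Φ) = range e₂ := by rw [range_comp, hsurj.range_eq, image_univ]
  refine ⟨e₁, e₂ ∘ Φ, he₁, he₂.comp_diffeomorph Φ, by rw [hrange]; exact hcover, fun a a' => ?_⟩
  constructor
  · intro h
    have hmem : e₁ a ∈ range e₁ ∩ range e₂ := ⟨⟨a, rfl⟩, ⟨Φ a', h.symm⟩⟩
    rw [hseam₁] at hmem
    obtain ⟨a₀, ha₀, hae⟩ := hmem
    have haa : a₀ = a := he₁.isEmbedding.injective hae
    subst haa
    have ha' : a₀ ∈ range b.incl := by rw [b.range_incl]; exact ha₀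
    obtain ⟨z, rfl⟩ := ha'
    refine ⟨z, rfl, ?_⟩
    have h2 : e₂ (Φ a') = e₂ (Φ (b.incl z)) := by
      rw [show (e₂ ∘ Φ) a' = e₂ (Φ a') from rfl] at h
      rw [← h, hΦ _ ha₀]
    exact Φ.injective (he₂.isEmbedding.injective h2)
  · rintro ⟨z, rfl, rfl⟩
    exact (hΦ _ (b.incl_mem_boundary z)).symm

/-- **Seam-compatible twins are contact twins**: if `Φ` restricts to the seam identification,
`dΦ` carries `ξ₁` onto `ξ₂` along `∂W₁` (the differentials of `e₂ ∘ Φ` and `e₁` agree on `T∂W₁`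
because the maps agree on `∂W₁` — the sibling's (A3) `mfderiv_apply_eq_of_comp_incl_eq` — then
cancel the injective `de₂`). Stated for any boundary plane fields `ξ₁ ≤ T∂W₁`, `ξ₂`. -/
theorem contactTwins_of_seamCompatible
    (b : Literature.Topology.FourManifolds.BoundaryData (𝓡∂ 4) W₁ (𝓡 3))
    (ξ₁ : W₁ → Submodule ℝ E4) (ξ₂ : W₂ → Submodule ℝ E4)
    (hξ₁ : ∀ w, ξ₁ w ≤ boundaryTangentSpace)
    {e₁ : W₁ → M} {e₂ : W₂ → M}
    (he₁ : Manifold.IsSmoothEmbedding (𝓡∂ 4) (𝓡 4) ∞ e₁)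
    (he₂ : Manifold.IsSmoothEmbedding (𝓡∂ 4) (𝓡 4) ∞ e₂)
    (hξ : ∀ w₁ w₂, e₁ w₁ = e₂ w₂ →
      Submodule.map (mfderiv (𝓡∂ 4) (𝓡 4) e₁ w₁).toLinearMap (ξ₁ w₁) =
      Submodule.map (mfderiv (𝓡∂ 4) (𝓡 4) e₂ w₂).toLinearMap (ξ₂ w₂))
    (Φ : W₁ ≃ₘ⟮𝓡∂ 4, 𝓡∂ 4⟯ W₂) (hΦ : ∀ w, w ∈ (𝓡∂ 4).boundary W₁ → e₂ (Φ w) = e₁ w) :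
    ∀ w, w ∈ (𝓡∂ 4).boundary W₁ →
      Submodule.map (mfderiv (𝓡∂ 4) (𝓡∂ 4) Φ w).toLinearMap (ξ₁ w) = ξ₂ (Φ w) := by
  intro w hw
  have hw' : w ∈ range b.incl := by rw [b.range_incl]; exact hw
  obtain ⟨z, rfl⟩ := hw'
  have hcomp : (e₂ ∘ Φ) ∘ b.incl = e₁ ∘ b.incl :=
    funext fun z => hΦ _ (b.incl_mem_boundary z)
  have hA : ContMDiff (𝓡∂ 4) (𝓡 4) ∞ (e₂ ∘ Φ) := (he₂.comp_diffeomorph Φ).contMDiff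
  have hagree : ∀ v ∈ ξ₁ (b.incl z),
      mfderiv (𝓡∂ 4) (𝓡 4) (e₂ ∘ Φ) (b.incl z) v = mfderiv (𝓡∂ 4) (𝓡 4) e₁ (b.incl z) v :=
    fun v hv => mfderiv_apply_eq_of_comp_incl_eq b hA he₁.contMDiff hcomp z (hξ₁ _ hv)
  have hd₂ : MDifferentiableAt (𝓡∂ 4) (𝓡 4) e₂ (Φ (b.incl z)) :=
    he₂.contMDiff.mdifferentiableAt (by simp)
  have hdΦ : MDifferentiableAt (𝓡∂ 4) (𝓡∂ 4) Φ (b.incl z) := Φ.mdifferentiable (by simp) _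
  have hchain : mfderiv (𝓡∂ 4) (𝓡 4) (e₂ ∘ Φ) (b.incl z) =
      (mfderiv (𝓡∂ 4) (𝓡 4) e₂ (Φ (b.incl z))).comp (mfderiv (𝓡∂ 4) (𝓡∂ 4) Φ (b.incl z)) :=
    mfderiv_comp _ hd₂ hdΦ
  have hseam := hξ (b.incl z) (Φ (b.incl z)) (hΦ _ (b.incl_mem_boundary z)).symm
  have hinj : Injective (mfderiv (𝓡∂ 4) (𝓡 4) e₂ (Φ (b.incl z))) :=
    Literature.Topology.FourManifolds.Manifold.IsImmersionAt.mfderiv_injective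
      (he₂.isImmersion.isImmersionAt _) (by simp)
  set D₁ : E4 →L[ℝ] E4 := mfderiv (𝓡∂ 4) (𝓡 4) e₁ (b.incl z) with hD₁
  set D₂ : E4 →L[ℝ] E4 := mfderiv (𝓡∂ 4) (𝓡 4) e₂ (Φ (b.incl z)) with hD₂
  set DΦ : E4 →L[ℝ] E4 := mfderiv (𝓡∂ 4) (𝓡∂ 4) Φ (b.incl z) with hDΦ
  have hagree' : ∀ v ∈ ξ₁ (b.incl z), D₂ (DΦ v) = D₁ v := by
    intro v hv
    have := hagree v hv
    rw [hchain] at this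
    exact this
  apply Submodule.map_injective_of_injective (f := D₂.toLinearMap) hinj
  refine Eq.trans ?_ hseam
  ext x
  simp only [Submodule.mem_map, ContinuousLinearMap.coe_coe]
  constructor
  · rintro ⟨u, ⟨v, hv, rfl⟩, rfl⟩
    exact ⟨v, hv, (hagree' v hv).symm⟩
  · rintro ⟨v, hv, rfl⟩
    exact ⟨DΦ v, ⟨v, hv, rfl⟩, hagree' v hv⟩

end SeamCompatible

/-- **The double-like sector**: bisections whose halves admit SEAM-COMPATIBLE twin data. -/
def DoubleLikeSector : Prop :=
  ∀ (M : Type) [TopologicalSpace M] [T2Space M] [SecondCountableTopology M] [ChartedSpace E4 M]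
    [IsManifold (𝓡 4) ∞ M] (_hM : M ≃ₕ 𝕊⁴)
    (W₁ : Type) [TopologicalSpace W₁] [ChartedSpace (EuclideanHalfSpace 4) W₁] [IsManifold (𝓡∂ 4) ∞ W₁]
    [CompactSpace W₁] (W₂ : Type) [TopologicalSpace W₂] [ChartedSpace (EuclideanHalfSpace 4) W₂]
    [IsManifold (𝓡∂ 4) ∞ W₂] [CompactSpace W₂] (J₁ : SteinStructure W₁) (J₂ : SteinStructure W₂)
    (e₁ : W₁ → M) (e₂ : W₂ → M)
    (_he₁ : Manifold.IsSmoothEmbedding (𝓡∂ 4) (𝓡 4) ∞ e₁)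
    (_he₂ : Manifold.IsSmoothEmbedding (𝓡∂ 4) (𝓡 4) ∞ e₂)
    (_hcover : range e₁ ∪ range e₂ = univ)
    (_hseam₁ : range e₁ ∩ range e₂ = e₁ '' (𝓡∂ 4).boundary W₁)
    (_hseam₂ : range e₁ ∩ range e₂ = e₂ '' (𝓡∂ 4).boundary W₂)
    (_hξ : ∀ w₁ w₂, e₁ w₁ = e₂ w₂ →
      Submodule.map (mfderiv (𝓡∂ 4) (𝓡 4) e₁ w₁).toLinearMap (contactPlane J₁.J w₁) =
      Submodule.map (mfderiv (𝓡∂ 4) (𝓡 4) e₂ w₂).toLinearMap (contactPlane J₂.J w₂))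
    (_hac : ∀ k, 0 < k → IsZero (singularHomology ℚ ℚ W₁ k) ∧ IsZero (singularHomology ℚ ℚ W₂ k)),
    SeamCompatible e₁ e₂ → Nonempty (M ≃ₘ⟮𝓡 4, 𝓡 4⟯ 𝕊⁴)

/-- **The cork-twist sector**: bisections whose halves are contact twins but admit NO
seam-compatible twin data — i.e. `M = W₁ ∪_ĉ W̄₁` re-glued by a contactomorphism `ĉ⁻¹Φ|∂` of
`(∂W₁, ξ₁)` that extends over `W₁` by no diffeomorphism: a CONTACT (rational) CORK TWIST of the
double `D(W₁)`. Inhabited by the `S³/Q₈` bisection of `S⁴` (§5b); its contractible part is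
inhabited iff contact Stein corks with homotopy-sphere twist exist (§9d horn 2, open). -/
def CorkTwistSector : Prop :=
  ∀ (M : Type) [TopologicalSpace M] [T2Space M] [SecondCountableTopology M] [ChartedSpace E4 M]
    [IsManifold (𝓡 4) ∞ M] (_hM : M ≃ₕ 𝕊⁴)
    (W₁ : Type) [TopologicalSpace W₁] [ChartedSpace (EuclideanHalfSpace 4) W₁] [IsManifold (𝓡∂ 4) ∞ W₁]
    [CompactSpace W₁] (W₂ : Type) [TopologicalSpace W₂] [ChartedSpace (EuclideanHalfSpace 4) W₂]
    [IsManifold (𝓡∂ 4) ∞ W₂] [CompactSpace W₂] (J₁ : SteinStructure W₁) (J₂ : SteinStructure W₂)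
    (e₁ : W₁ → M) (e₂ : W₂ → M)
    (_he₁ : Manifold.IsSmoothEmbedding (𝓡∂ 4) (𝓡 4) ∞ e₁)
    (_he₂ : Manifold.IsSmoothEmbedding (𝓡∂ 4) (𝓡 4) ∞ e₂)
    (_hcover : range e₁ ∪ range e₂ = univ)
    (_hseam₁ : range e₁ ∩ range e₂ = e₁ '' (𝓡∂ 4).boundary W₁)
    (_hseam₂ : range e₁ ∩ range e₂ = e₂ '' (𝓡∂ 4).boundary W₂)
    (_hξ : ∀ w₁ w₂, e₁ w₁ = e₂ w₂ →
      Submodule.map (mfderiv (𝓡∂ 4) (𝓡 4) e₁ w₁).toLinearMap (contactPlane J₁.J w₁) =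
      Submodule.map (mfderiv (𝓡∂ 4) (𝓡 4) e₂ w₂).toLinearMap (contactPlane J₂.J w₂))
    (_hac : ∀ k, 0 < k → IsZero (singularHomology ℚ ℚ W₁ k) ∧ IsZero (singularHomology ℚ ℚ W₂ k)),
    ContactTwins J₁ J₂ → ¬ SeamCompatible e₁ e₂ → Nonempty (M ≃ₘ⟮𝓡 4, 𝓡 4⟯ 𝕊⁴)

/-- In a bisection of a Hausdorff second-countable `M`, seam-compatible twin data is contact-twin
data (`contactTwins_of_seamCompatible` with a boundary datum of `W₁`, which exists because `W₁`
embeds in `M`: `nonempty_boundaryData_holds`). -/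
theorem contactTwins_of_seamCompatible_bisection {M : Type} [TopologicalSpace M] [T2Space M]
    [SecondCountableTopology M] [ChartedSpace E4 M] [IsManifold (𝓡 4) ∞ M]
    {W₁ : Type} [TopologicalSpace W₁] [ChartedSpace (EuclideanHalfSpace 4) W₁] [IsManifold (𝓡∂ 4) ∞ W₁]
    [CompactSpace W₁] {W₂ : Type} [TopologicalSpace W₂] [ChartedSpace (EuclideanHalfSpace 4) W₂]
    [IsManifold (𝓡∂ 4) ∞ W₂] [CompactSpace W₂] (J₁ : SteinStructure W₁) (J₂ : SteinStructure W₂)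
    {e₁ : W₁ → M} {e₂ : W₂ → M}
    (he₁ : Manifold.IsSmoothEmbedding (𝓡∂ 4) (𝓡 4) ∞ e₁)
    (he₂ : Manifold.IsSmoothEmbedding (𝓡∂ 4) (𝓡 4) ∞ e₂)
    (hξ : ∀ w₁ w₂, e₁ w₁ = e₂ w₂ →
      Submodule.map (mfderiv (𝓡∂ 4) (𝓡 4) e₁ w₁).toLinearMap (contactPlane J₁.J w₁) =
      Submodule.map (mfderiv (𝓡∂ 4) (𝓡 4) e₂ w₂).toLinearMap (contactPlane J₂.J w₂))
    (h : SeamCompatible e₁ e₂) : ContactTwins J₁ J₂ := by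
  obtain ⟨Φ, hΦ⟩ := h
  haveI : T2Space W₁ := he₁.isEmbedding.t2Space
  haveI : SecondCountableTopology W₁ := he₁.isEmbedding.secondCountableTopology
  obtain ⟨b⟩ := Literature.Topology.FourManifolds.nonempty_boundaryData_holds 3 W₁
  exact ⟨Φ, contactTwins_of_seamCompatible b (fun w => contactPlane J₁.J w)
    (fun w => contactPlane J₂.J w) (fun w => contactPlane_le_boundaryTangentSpace J₁.J w)
    he₁ he₂ hξ Φ hΦ⟩

/-- **The twin sector splits as double-like ∧ cork-twist** (excluded middle on `SeamCompatible`,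
using that seam-compatible data is twin data). -/
theorem twinSector_iff_doubleLike_and_corkTwist :
    TwinSector ↔ DoubleLikeSector ∧ CorkTwistSector := by
  constructor
  · intro h
    refine ⟨?_, ?_⟩
    · intro M _ _ _ _ _ hM W₁ _ _ _ _ W₂ _ _ _ _ J₁ J₂ e₁ e₂ he₁ he₂ hcover hseam₁ hseam₂ hξ hac hs
      exact h M hM W₁ W₂ J₁ J₂ e₁ e₂ he₁ he₂ hcover hseam₁ hseam₂ hξ hac
        (contactTwins_of_seamCompatible_bisection J₁ J₂ he₁ he₂ hξ hs)
    · intro M _ _ _ _ _ hM W₁ _ _ _ _ W₂ _ _ _ _ J₁ J₂ e₁ e₂ he₁ he₂ hcover hseam₁ hseam₂ hξ hac ht _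
      exact h M hM W₁ W₂ J₁ J₂ e₁ e₂ he₁ he₂ hcover hseam₁ hseam₂ hξ hac ht
  · rintro ⟨hD, hC⟩ M _ _ _ _ _ hM W₁ _ _ _ _ W₂ _ _ _ _ J₁ J₂ e₁ e₂ he₁ he₂ hcover hseam₁ hseam₂ hξ
      hac ht
    by_cases hs : SeamCompatible e₁ e₂
    · exact hD M hM W₁ W₂ J₁ J₂ e₁ e₂ he₁ he₂ hcover hseam₁ hseam₂ hξ hac hs
    · exact hC M hM W₁ W₂ J₁ J₂ e₁ e₂ he₁ he₂ hcover hseam₁ hseam₂ hξ hac ht hs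

/-- **The double-like sector IS the double sector** (`§12`): `→` a double `IsDouble b P` is a
bisection with seam-compatible twin data `Φ = refl` (`steinBisection_of_isDouble`); `←`
seam-compatible twins present `M` as a double of `W₁` (`isDouble_of_seamCompatible`). -/
theorem doubleLikeSector_iff_doubleSector : DoubleLikeSector ↔ DoubleSector := by
  constructor
  · intro h W _ _ _ _ J b P _ _ _ _ _ hD hac hP
    obtain ⟨jA, jB, hA, hB, hU, hR⟩ := hD
    obtain ⟨hA', hB', hU', hL, hR', hC⟩ := steinBisection_of_glue_aux b J hA hB hU hR
    refine h P hP W W J J jA jB hA hB hU hL hR' hC (fun k hk => ⟨hac k hk, hac k hk⟩)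
      ⟨Diffeomorph.refl _ _ _, fun w hw => ?_⟩
    have hw' : w ∈ range b.incl := by rw [b.range_incl]; exact hw
    obtain ⟨z, rfl⟩ := hw'
    exact ((hR _ _).2 ⟨z, rfl, rfl⟩).symm
  · intro h M _ _ _ _ _ hM W₁ _ _ _ _ W₂ _ _ _ _ J₁ J₂ e₁ e₂ he₁ he₂ hcover hseam₁ hseam₂ hξ hac
      ⟨Φ, hΦ⟩
    haveI : T2Space W₁ := he₁.isEmbedding.t2Space
    haveI : SecondCountableTopology W₁ := he₁.isEmbedding.secondCountableTopology
    obtain ⟨b⟩ := Literature.Topology.FourManifolds.nonempty_boundaryData_holds 3 W₁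
    exact h W₁ J₁ b M (isDouble_of_seamCompatible he₁ he₂ hcover hseam₁ Φ hΦ b)
      (fun k hk => (hac k hk).1) hM
where
  /-- the sibling's `steinBisection_of_glue`, re-exported with its hypotheses explicit -/
  steinBisection_of_glue_aux {W : Type} [TopologicalSpace W]
      [ChartedSpace (EuclideanHalfSpace 4) W] [IsManifold (𝓡∂ 4) ∞ W] [CompactSpace W]
      {P : Type} [TopologicalSpace P] [ChartedSpace E4 P]
      (b : Literature.Topology.FourManifolds.BoundaryData (𝓡∂ 4) W (𝓡 3)) (S : SteinStructure W)
      {jA jB : W → P} (hA : Manifold.IsSmoothEmbedding (𝓡∂ 4) (𝓡 4) ∞ jA)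
      (hB : Manifold.IsSmoothEmbedding (𝓡∂ 4) (𝓡 4) ∞ jB) (hU : range jA ∪ range jB = univ)
      (hR : ∀ a a', jA a = jB a' ↔ ∃ z, a = b.incl z ∧ a' = b.incl z) :
      Manifold.IsSmoothEmbedding (𝓡∂ 4) (𝓡 4) ∞ jA ∧ Manifold.IsSmoothEmbedding (𝓡∂ 4) (𝓡 4) ∞ jB ∧
        range jA ∪ range jB = univ ∧ range jA ∩ range jB = jA '' (𝓡∂ 4).boundary W ∧
        range jA ∩ range jB = jB '' (𝓡∂ 4).boundary W ∧
        (∀ w₁ w₂, jA w₁ = jB w₂ →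
          Submodule.map (mfderiv (𝓡∂ 4) (𝓡 4) jA w₁).toLinearMap (contactPlane S.J w₁) =
            Submodule.map (mfderiv (𝓡∂ 4) (𝓡 4) jB w₂).toLinearMap (contactPlane S.J w₂)) :=
    Summit.SmoothPoincare4.SmoothPoincare4.Theorems.ContractibleTwistedDoubleStandard.Negative.steinBisection_of_glue
      b S hA hB hU hR

/-- **THREE-SECTOR DECOMPOSITION OF THE CRUX.** `AcyclicBisectionRigidity` is the conjunction
of: (1) `DoubleSector` — homotopy-sphere doubles `D(W)` of one ℚ-acyclic Stein domain are `S⁴`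
(on paper: `W` is then contractible and `D(W) = Σ(𝒫, ε)` — PRESENTATION SPHERES, crux 4's
identity-glued slice); (2) `CorkTwistSector` — contact cork twists `W ∪_ĉ W̄` of such doubles,
`ĉ` a contactomorphism extending over neither copy (contains `S³/Q₈` ⊂ `S⁴`, §5b; Gompf's Q2.2
in Stein clothing); (3) `NonTwinSector` — regluings of non-contact-diffeomorphic acyclic Stein
pairs (EMPTY iff Stub 1; home of every kill candidate of §§9c–f). All three are SPC4-shielded. -/
theorem crux_iff_three_sectors :
    ConvexBisection.AcyclicBisectionRigidity ↔ DoubleSector ∧ CorkTwistSector ∧ NonTwinSector := by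
  rw [crux_iff_twin_and_nonTwin, twinSector_iff_doubleLike_and_corkTwist,
    doubleLikeSector_iff_doubleSector, and_assoc]

/-- **What the line's residual stubs are worth, finally**: `Stub2 ∧ Stub3 ⟺ DoubleSector ∧
CorkTwistSector` — presentation spheres plus contact cork twists of doubles, no more, no less. -/
theorem stub23_iff_double_and_corkTwist : (Stub2 ∧ Stub3) ↔ DoubleSector ∧ CorkTwistSector := by
  rw [← twinSector_iff_stub23, twinSector_iff_doubleLike_and_corkTwist,
    doubleLikeSector_iff_doubleSector]

end DoubleSector

/-! ## §13 Round-2 levers (gen 5): `achiral-relator-reduction` and `exchange-recognition`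

Round 1 ended with all three lines dead (lever `Stub 1` = "halves are contact twins" false in
print: Hayden arXiv:2003.13681 Thm 1.3 — two non-diffeomorphic contractible STEIN domains
`W = Σ(B⁴, C)`, `W′ = Σ(B⁴, C′)` filling one contact structure on the ℤHS `Σ₂(K)`; glued,
`M_H = W ∪ W̄′ ≃ₕ S⁴` is an acyclic common-contact bisection whose halves are not even diffeomorphic),
so `NonTwinSector` (§9e) is INHABITED — the gen-3 verdict of §9c come true, by a fourth route.
Two round-2 cards (ideator 5, 2026-08-16) act on the glued manifold instead. This section grades
their first lemmas the cdisprove way: §13a the Transfer `C⁺ = DoubleReduction` of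
`achiral-relator-reduction` is crux-implied with `W = 𝔻⁴` (formal) — its content is the METHOD `T`;
§13b `exchange-recognition`'s typed first lemma is a tree theorem (formal) and its exchange lemma,
its answer to the lead's Q3 (`M_H ≅ S⁴`) and its reading of §9d (`Σ_P ≅ S⁴`) are CORRECT (checked
here against Hayden's p. 5); §13c **`T` (monotone achiral reducibility) is FALSE on the planar
page at `k = 5`**, killed by the card's own type-vector obstruction on explicit relators in
`Mod(P₅, ∂)` (machine search, kit j011482; the abstract invariant is formal below); §13d new
torsion test spheres fall out of the same search. -/

section RoundTwo

open Summit.SmoothPoincare4.SmoothPoincare4.Theorems.ContractibleTwistedDoubleStandard.Negative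
  (double_standard_of_crux contractibleSpace_closedBall_four)
open Literature.Topology.FourManifolds

/-! ### §13a `DoubleReduction` (card `achiral-relator-reduction`, Transfer `C⁺`) is the crux in a costume -/

/-- **Card `achiral-relator-reduction`, Transfer `C⁺ = DoubleReduction` (verbatim shape of the
ideator's Sketch §3)**: every acyclically common-contact Stein-bisected homotopy 4-sphere is a
DOUBLE `D(W) = W ∪_id W` (tree predicate `IsDouble`) of SOME compact contractible Stein domain. -/
def DoubleReduction : Prop :=
  ∀ (M : Type) [TopologicalSpace M] [T2Space M] [SecondCountableTopology M] [ChartedSpace E4 M]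
    [IsManifold (𝓡 4) ∞ M], M ≃ₕ 𝕊⁴ → AcyclicBisection M →
    ∃ (W : Type) (_ : TopologicalSpace W) (_ : ChartedSpace (EuclideanHalfSpace 4) W)
      (_ : IsManifold (𝓡∂ 4) ∞ W) (_ : CompactSpace W) (_ : ContractibleSpace W) (_ : SteinStructure W)
      (b : BoundaryData (𝓡∂ 4) W (𝓡 3)), IsDouble b (𝓡 4) M

/-- **The crux implies `DoubleReduction` — with `W = 𝔻⁴`.** A standard sphere `M ≅ S⁴` is the
double of the closed 4-ball (`isDouble_sphere_holds 3`, transported along `M ≅ S⁴` by the tree's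
`IsBoundaryGluing.diffeomorph_comp`), and `𝔻⁴` is a compact contractible Stein domain
(`steinStructureClosedBall`, `contractibleSpace_closedBall_four`). So `C⁺` is NOT a weakening of
the crux's conclusion in any usable sense: as a STATEMENT it is crux-implied (hence SPC4-implied,
`doubleReduction_of_spc4`, unrefutable short of an exotic `S⁴`) and, given crux 4,
crux-EQUIVALENT (`crux_iff_doubleReduction_of_crux4`). The card says as much between the lines
("WHY EASIER: C⁺ is reached CONSTRUCTIVELY by … T"): all content is in the METHOD `T`, §13c. -/
theorem doubleReduction_of_crux (h : ConvexBisection.AcyclicBisectionRigidity) : DoubleReduction := by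
  intro M _ _ _ _ _ hM hb
  obtain ⟨Ψ⟩ := h M hM hb
  haveI := contractibleSpace_closedBall_four
  refine ⟨Metric.closedBall (0 : E4) 1, inferInstance, inferInstance, inferInstance, inferInstance,
    inferInstance, steinStructureClosedBall, closedBallBoundaryData 3, ?_⟩
  exact (isDouble_sphere_holds (n := 3)).isBoundaryGluing.diffeomorph_comp Ψ.symm

/-- Hence `DoubleReduction` is SPC4-implied. -/
theorem doubleReduction_of_spc4 (h : SmoothPoincare4) : DoubleReduction :=
  doubleReduction_of_crux (of_spc4 h)

/-- **The card's composition, re-derived**: `DoubleReduction ∧ crux 4 ⇒ crux` (a double of a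
contractible Stein domain is a Stein bisection, `steinBisection_of_isDouble`, then crux 4 — the
sibling's `double_standard_of_crux`). -/
theorem crux_of_doubleReduction (hD : DoubleReduction)
    (h4 : ConvexBisection.ContractibleTwistedDoubleStandard) :
    ConvexBisection.AcyclicBisectionRigidity := by
  intro M _ _ _ _ _ hM hb
  obtain ⟨W, _, _, _, _, _, S, b, hdouble⟩ := hD M hM hb
  exact double_standard_of_crux h4 W S b M hdouble

/-- **Modulo crux 4, `C⁺` IS the crux**: the Transfer gains nothing as a statement (triage (iv)
"costume" for the STATEMENT; the LEVER `T` is a different matter, §13c). -/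
theorem crux_iff_doubleReduction_of_crux4 (h4 : ConvexBisection.ContractibleTwistedDoubleStandard) :
    ConvexBisection.AcyclicBisectionRigidity ↔ DoubleReduction :=
  ⟨doubleReduction_of_crux, fun hD => crux_of_doubleReduction hD h4⟩

/-- `DoubleReduction` also sits between the crux and its own double sector:
`DoubleReduction ∧ DoubleSector`-for-contractible-`W` would already give the crux; recorded as the
one-directional `DoubleReduction → (crux 4 → DoubleSector)` for completeness. -/
theorem doubleSector_of_doubleReduction (hD : DoubleReduction)
    (h4 : ConvexBisection.ContractibleTwistedDoubleStandard) : DoubleSector :=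
  doubleSector_of_crux (crux_of_doubleReduction hD h4)

/-! ### §13b `exchange-recognition`: typed lemma trivial, exchange lemma and `M_H ≅ S⁴` correct (informal check)

**The typed first lemma.** `ComplementRecognition` ("if `M` and `S⁴` are both the gluing
`W₁ ∪_φ W₂` then `M ≅ S⁴`") is uniqueness of gluings, a THEOREM of the tree
(`nonempty_diffeomorph_of_isBoundaryGluing_holds`, Hirsch Thm 8.2.1) once `φ` is typed as a
diffeomorphism (the card's Sketch types a bare `Equiv`; a seam map is a diffeomorphism, and the
tree fact is stated for `≃ₘ`) — `complementRecognition` below. It carries no content; the line's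
content is the untyped EXCHANGE LEMMA (gap G-Kirby: no dotted-circle calculus in the tree).

**The exchange lemma is correct** (checked): for `Λ = A ∪ B ⊂ S³` with `A` and `B` unlinks
separately (`|A| = |B|`), `W_A = {A•, B⁰}` and `W_B = {A⁰, B•}` have canonically identified
boundaries (one surgery description), and in `W_A ∪_id W̄_B` the upside-down 2-handles of `W_B`
attach along `0`-framed meridians of `A`, i.e. meridians of `W_A`'s dotted circles — they cancel
the 1-handles; what remains is the `0`-framed UNLINK `B ⊂ S³` capped by 3-handles and the 4-handle
(Laudenbach–Poénaru): `S⁴`. (Not even Property R is needed in the exchange form.)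

**Hayden's inhabitant of the non-twin sector is the ROUND sphere** (the lead's open question Q3,
answered by the card; verified here at page level). Hayden arXiv:2003.13681 §2, p. 5: *"let `L` be
a three-component link of unknots `A`, `B`, and `C` such that `A ∪ B` is a Hopf link and each of
the links `A ∪ C` and `B ∪ C` is a two-component unlink … by viewing `A` as a dotted circle … and
attaching a zero-framed 2-handle along `B`, we obtain a non-standard handle diagram for `B⁴` … `C`
bounds an embedded disk in `S³ ∖ A` … pushed into the interior of `S¹ × B³` … giving rise to the
desired disk `D` … we may reverse the roles of `A` and `B` in this construction, yielding another
disk `D′`."* Lifting to double covers branched along the unknot `C` (Akbulut–Kirby): `A`, `B` bound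
discs disjoint from `C`, so each lifts to a 2-component unlink `Ã`, `B̃`; `W = Σ(B⁴, D) = {Ã•, B̃⁰}`,
`W′ = Σ(B⁴, D′) = {Ã⁰, B̃•}` on ONE 4-component link, boundaries identified by the lift of
`id_{(S³, K)}` — an exchange pair glued by the identity. Hence `M_H = W ∪_id W̄′ ≅ S⁴` (for every
`m` of Hayden's family and, verbatim, for every cyclic degree), with NO 2-knot / Gordon–Gluck input.
Consequence for the crux: `NonTwinSector` is inhabited by a bisection of the round sphere into two
non-diffeomorphic contractible Stein pieces — no kill; consequence for provers: a proof of the crux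
must recognise `S⁴` behind genuinely different halves (exactly as behind the non-extending seam
map of the `S³/Q₈` twins, §5b).

**Symmetric cork twists are exchange gluings** (card (2), checked): for a cork `W = {A•, B⁰}` on a
symmetric link with `τ` the swap, `W ∪_τ W̄ = W_A ∪_id W̄_B ≅ S⁴`. So the positron sphere
`Σ_P = P ∪_τ P̄` of §9d (Akbulut–Matveyev's positron IS a symmetric two-component presentation) is
`S⁴`: the positron dichotomy of §9d plays out inside the round sphere, as anticipated there; and
§5d (d) (rational Price twists `M_p` standard) is the `b = 1`, non-unlink version of the same
cancellation (there Property R IS needed: `B` is not visibly unknotted after the twist).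

**`K2′` (`w = 1` in the Mazur–Mazur sector).** The card's falsifier (2) — the `S³/Q₈` example
`X_L ∪_ψ X̄_L` — PASSES: by §5d (a),(d) (`X_L = X₂ = S¹×D³ ∪ h²` along the once-stabilised regular
fibre; `ψ = τ₂` the fibre swap) the transported dual attaches along a Heegaard core of
`∂(S¹×D³)` meeting the belt sphere once, `w = 1`, for `p = 2` and indeed for every `Y(p)`. Live
falsifier: (1) Gompf's infinite-order twists `f^k` (arXiv:1603.05090). ADVERSARY'S CAVEAT on the
Transfer `C⁺` (exchange normal form "up to Legendrian handle moves and symmetries of `Λ`"): not a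
closed condition and, read as a statement ending in `M ≅ S⁴`, SPC4-shaped; its checkable content
is instance-wise (`w` per example). No cheap kill, no cheap confirmation; the new torsion spheres
of §13d are the next instances to feed it. -/

/-- **Card `exchange-recognition`, first lemma `ComplementRecognition`, gluing map typed as a
DIFFEOMORPHISM**: a theorem of the tree (uniqueness of gluings). -/
theorem complementRecognition
    (M : Type) [TopologicalSpace M] [ChartedSpace E4 M] [IsManifold (𝓡 4) ∞ M]
    (W₁ : Type) [TopologicalSpace W₁] [T2Space W₁] [SecondCountableTopology W₁]
    [ChartedSpace (EuclideanHalfSpace 4) W₁] [IsManifold (𝓡∂ 4) ∞ W₁] [CompactSpace W₁]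
    (W₂ : Type) [TopologicalSpace W₂] [T2Space W₂] [SecondCountableTopology W₂]
    [ChartedSpace (EuclideanHalfSpace 4) W₂] [IsManifold (𝓡∂ 4) ∞ W₂] [CompactSpace W₂]
    (b₁ : BoundaryData (𝓡∂ 4) W₁ (𝓡 3)) (b₂ : BoundaryData (𝓡∂ 4) W₂ (𝓡 3))
    (φ : b₁.carrier ≃ₘ⟮𝓡 3, 𝓡 3⟯ b₂.carrier)
    (hM : IsBoundaryGluing b₁ b₂ φ (𝓡 4) M) (hS : IsBoundaryGluing b₁ b₂ φ (𝓡 4) 𝕊⁴) :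
    Nonempty (M ≃ₘ⟮𝓡 4, 𝓡 4⟯ 𝕊⁴) :=
  nonempty_diffeomorph_of_isBoundaryGluing_holds hM hS

/-! ### §13c The lever `T` of `achiral-relator-reduction` is FALSE on the planar page (`k = 5`)

`T` (the card's Transfer, its "Hardest"): *for minimal positive factorisations `F`, `F′` of one
`φ ∈ Mod(S, ∂S)` with `π₁ Σ(F, F′) = 1`, the cyclic word `w = F·F̄′` is monotone reducible* —
reducible to `∅` by achiral Hurwitz moves, cyclic rotation, global conjugation and DELETIONS of
adjacent mutually inverse pairs, never insertions. The card's own obstruction ((7), falsifier (1)):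
types (= `Mod(S,∂S)`-conjugacy classes of the twists) are preserved by every move and a deletion
removes one positive and one negative letter of the SAME type, so reducibility needs
`types(F) = types(F′)` as multisets (formal, any group: `typeCount_eq_zero_of_monotoneReducible`
below, with `S` = one type).

**Theorem (gen 5; machine-verified relation, kit j011482, scripts `modpk.py`, `search_types.py`,
`witness.py` on the item).** In `Mod(P₅, ∂)` (`P₅` = disc with holes `1..4`, outer boundary = `∂₅`;
`t_S` = right twist about the round curve enclosing the holes `S`; `t*₁₃₄ := t_{σ₁⁻¹(c₂₃₄)}`,
`t*₁₃ := t_{σ₁⁻¹(c₂₃)}`, `σ₁` the half twist of holes `1, 2`):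
  `t₂₃₄ · t₁₂₃ · t*₁₃₄ · t₃ = t₂₃ · t_{∂₅} · t₃₄ · t*₁₃ =: φ₀`.
Both sides are POSITIVE factorisations `F`, `F′` of `φ₀`; the open book `(P₅, φ₀)` is `S³/Q₈`
(`π₁ = F₄/⟪arc data⟫` of order `8`, `H₁ = (ℤ/2)²`); `X_F`, `X_{F′}` are ℚ-acyclic
(`|det| = |H₁| = 2`, `π₁ = ℤ/2`), hence of MINIMAL length `4 = k − 1` (every Stein filling `X` of a
ℚHS³ has `b₁(X) = 0` — no 3-handles — so `#F = χ(X) − χ(P₅) ≥ 1 + 3`, with equality iff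
ℚ-acyclic); `Σ(F, F′) = X_F ∪ X̄_{F′}` has `π₁ = F₄/⟪cycles of F, F′⟫ = 1` (Todd–Coxeter, complete)
— a homotopy 4-sphere, planar-bisected along `S³/Q₈` (presumably the §5b bisection of the ROUND
sphere; not identified here). TYPES: `F ↦ {234, 123, 134, 3}`, `F′ ↦ {23, 1234, 34, 13}` —
DISJOINT multisets. Hence NO deletion is available anywhere in the achiral Hurwitz orbit of
`F·F̄′`, and **`T` fails for `(P₅, φ₀; F, F′)`**. ∎  (Mechanism: `F·F̄′` is the balance of two
lantern relations of `P₅` sharing a `{1,4}`-curve — blocks `{1},{23},{4},{5}` and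
`{1},{3},{4},{25}` — each lantern trades 4 letters for 3, the balance trades 4 for 4 and changes
every type.) Not an isolated accident: with the 18 shortest curves (the sibling census's pool)
there are 19 same-`φ` buckets mixing two type multisets, 153 with 38 curves; EVERY mixed pair
examined (171 / 1377) is a simply connected `Σ(F,F′)` with `π₁(X) = ℤ/2` halves, seam `S³/Q₈`
(1053 of 1377) or a `(ℤ/2)²`-homology sphere with `|π₁| > 6·10⁴`, the sweep's coset cap (324 of 1377; §13d).

**Where the obstruction can bite at all (the abelian analysis).** `H₁(Mod(P_k, ∂); ℤ) ≅ ℤ^{C(k,2)}`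
via the pair-separation counts `λ_{ij}` (forget all boundary components but `i, j`: `Mod(annulus) = ℤ`;
`λ_{ij}(t_c) = 1` iff `c` separates `∂_i` from `∂_j`), so for factorisations of one `φ` the GRAM
MATRIX `M_Fᵀ M_F` of the hole-incidence matrix `M_F ∈ {0,1}^{n×n}` (`n = k − 1`) is an invariant of
`φ`. (i) UNIMODULAR (= contractible, ℤHS seam) sector: `M_{F′} M_F⁻¹ ∈ O(n, ℤ)` is a signed
permutation, so `types(F) = types(F′)` AUTOMATICALLY — the obstruction is SILENT exactly where the
card's evidence lives (`k = 4`: `Mod(D₃,∂)`-ambiguity is impossible for every `det`, table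
`gram_types.py 3`; and the sibling chain's remark "κ^{ab} = 0 is a theorem in the unimodular
sector"). (ii) `|det| = 2`: at `n = 4` exactly 10 Gram classes carry two type multisets (all 20
involve a boundary-parallel type), and `Mod(P₅, ∂)` realises all 10 (above). (iii) `n = 5`
(`k = 6`): 720 Gram-ambiguous classes AVOID boundary-parallel types altogether (`det` 2 and 4);
they ARE realised in `Mod(P₆, ∂)` (session 2: 372 simply connected pairs on the 33-curve pool; escape (a) below).

**Escape routes, each with its price** (for triage/planner; the adversary does not choose).
(a) Forbid boundary-parallel vanishing cycles: survives the obstruction at `k = 5` — and DIES AT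
`k = 6` (session 2, `typejob/k6job.py`, local run, 33-curve pool): the 720 boundary-parallel-free
Gram-ambiguous classes ARE realised in `Mod(P₆, ∂)` — 450 mixed buckets, 372 simply connected
`Σ(F, F′)`, all `|det| = 2`, halves `π₁ = ℤ/2`, seams `S³/Q₈`-type (order 8, 220) or
cap-exceeding (152), 16 distinct type-multiset pairs; explicit:
`F = (t_{σ₁(c₂₃₄)}, t₃₄₅, t₂₃, t₁₂, t_{σ₄⁻¹(c₁₂₃₄)})` (types `134, 345, 23, 12, 1235`),
`F′ = (t_{σ₁(c₂₃₄₅)}, t₃₄, t₁₂₃, t_{σ₄⁻¹(c₂₃₄)}, t₁₂)` (types `1345, 34, 123, 235, 12`), same `φ`,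
`π₁ Σ = 1` — every cycle of size `2..4`, none boundary-parallel. (Boundary-parallel cycles were
honest data anyway: Oba's Mazur-type `X_n` on `P₄` carry one — sibling triage r1-1 (i).) (b)
Stabilise the common open book until mismatched letters become one `Mod(S′, ∂)`-class: ONE band
joining `∂₃` to `∂₅` makes all eight cycles of the witness NON-SEPARATING on `Σ_{1,4}`, hence one
type — but then `T^{stab}` has no type obstruction left ANYWHERE (non-separating curves are a single
class in every genus `≥ 1`), i.e. the lever loses the card's Transfer property (b) "can be KILLED
without an exotic `S⁴`" and becomes exactly as unfalsifiable as the crux; the `As(Q_Dehn)` length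
filtration the card mentions is then the only remaining handle, uncomputed. (c) Restrict `T` to the
unimodular sector (`det ±1`, contractible halves): consistent with all evidence (`k = 4` BFS,
0 resisting) and obstruction-free by (i) — but the torsion sector (inhabited: `S³/Q₈`, `Y(p)`, §13d)
is then simply dropped from the line and must be owned elsewhere (it is Stub 3's old sector).
VERDICT: `T` as stated — dead (explicit counterexample, no exotic sphere involved: the cleanest
separation of "lever false" from "crux false", which the card itself asked for, one layer up from
where it looked). `T|_{det = ±1}` and `T^{stab}` — alive, the former testable, the latter not. -/

/-- The card's move set on words over a group (our transcription of its `MonotoneReducible`: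
constructors `nil / cancel / hurwitz / hurwitzInv / rotate / conj`). -/
inductive MonotoneReducible {G : Type*} [Group G] : List G → Prop
  | nil : MonotoneReducible []
  | cancel (l₁ l₂ : List G) (g : G) :
      MonotoneReducible (l₁ ++ l₂) → MonotoneReducible (l₁ ++ g :: g⁻¹ :: l₂)
  | hurwitz (l₁ l₂ : List G) (a b : G) :
      MonotoneReducible (l₁ ++ b :: (b⁻¹ * a * b) :: l₂) → MonotoneReducible (l₁ ++ a :: b :: l₂)
  | hurwitzInv (l₁ l₂ : List G) (a b : G) :
      MonotoneReducible (l₁ ++ (a * b * a⁻¹) :: a :: l₂) → MonotoneReducible (l₁ ++ a :: b :: l₂)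
  | rotate (l : List G) (k : ℕ) : MonotoneReducible (l.rotate k) → MonotoneReducible l
  | conj (l : List G) (g : G) :
      MonotoneReducible (l.map fun x => g * x * g⁻¹) → MonotoneReducible l

/-- The signed `S`-count of a word: letters in `S` minus letters whose inverse is in `S`. -/
def typeCount {G : Type*} [Group G] (S : G → Prop) [DecidablePred S] (l : List G) : ℤ :=
  (l.countP fun x => S x : ℤ) - (l.countP fun x => S x⁻¹ : ℤ)

section TypeCount

variable {G : Type*} [Group G] (S : G → Prop) [DecidablePred S]

theorem typeCount_nil : typeCount S ([] : List G) = 0 := by simp [typeCount]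

theorem typeCount_append (l₁ l₂ : List G) :
    typeCount S (l₁ ++ l₂) = typeCount S l₁ + typeCount S l₂ := by
  simp [typeCount, List.countP_append]; ring

theorem typeCount_cons (g : G) (l : List G) :
    typeCount S (g :: l) = ((if S g then 1 else 0) - (if S g⁻¹ then 1 else 0)) + typeCount S l := by
  by_cases h1 : S g <;> by_cases h2 : S g⁻¹ <;> simp [typeCount, h1, h2] <;> ring

theorem typeCount_perm {l l' : List G} (h : l.Perm l') : typeCount S l = typeCount S l' := by
  simp [typeCount, h.countP_eq]

variable (hS : ∀ g x : G, S x ↔ S (g * x * g⁻¹))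
include hS

/-- Conjugation-invariant `S`: the count is invariant under global conjugation of the word. -/
theorem typeCount_map_conj (g : G) (l : List G) :
    typeCount S (l.map fun x => g * x * g⁻¹) = typeCount S l := by
  induction l with
  | nil => simp [typeCount]
  | cons x l ih =>
    rw [List.map_cons, typeCount_cons, typeCount_cons, ih]
    have h1 : S (g * x * g⁻¹) ↔ S x := (hS g x).symm
    have h2 : S (g * x * g⁻¹)⁻¹ ↔ S x⁻¹ := by
      rw [show (g * x * g⁻¹)⁻¹ = g * x⁻¹ * g⁻¹ by group]
      exact (hS g x⁻¹).symm
    simp only [h1, h2]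

/-- **The type count is an invariant of the card's move set and vanishes on monotone-reducible
words** (induction on the derivation: deletions remove `g, g⁻¹`; Hurwitz moves replace a letter by
a conjugate; rotation permutes; global conjugation by `typeCount_map_conj`). -/
theorem typeCount_eq_zero_of_monotoneReducible {l : List G} (h : MonotoneReducible l) :
    typeCount S l = 0 := by
  induction h with
  | nil => exact typeCount_nil S
  | cancel l₁ l₂ g _ ih =>
    rw [typeCount_append] at ih
    rw [typeCount_append, typeCount_cons, typeCount_cons, inv_inv]
    linarith
  | hurwitz l₁ l₂ a b _ ih =>
    rw [typeCount_append, typeCount_cons, typeCount_cons] at ih ⊢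
    have h1 : S (b⁻¹ * a * b) ↔ S a := by
      have := hS b⁻¹ a; simpa using this.symm
    have h2 : S (b⁻¹ * a * b)⁻¹ ↔ S a⁻¹ := by
      rw [show (b⁻¹ * a * b)⁻¹ = b⁻¹ * a⁻¹ * b by group]
      have := hS b⁻¹ a⁻¹; simpa using this.symm
    simp only [h1, h2] at ih
    linarith
  | hurwitzInv l₁ l₂ a b _ ih =>
    rw [typeCount_append, typeCount_cons, typeCount_cons] at ih ⊢
    have h1 : S (a * b * a⁻¹) ↔ S b := (hS a b).symm
    have h2 : S (a * b * a⁻¹)⁻¹ ↔ S b⁻¹ := by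
      rw [show (a * b * a⁻¹)⁻¹ = a * b⁻¹ * a⁻¹ by group]
      exact (hS a b⁻¹).symm
    simp only [h1, h2] at ih
    linarith
  | rotate l k _ ih => rwa [typeCount_perm S (List.rotate_perm l k)] at ih
  | conj l g _ ih => rwa [typeCount_map_conj S hS] at ih

/-- **Contrapositive, the form used above**: a word with non-zero type count for some
conjugation-invariant `S` is NOT monotone reducible — in whatever group it lives and whether or not
it represents the identity there. With `G = Mod(P₅, ∂)`, `l = F·F̄′` of the theorem above and
`S` = the conjugacy class of `t₂₃₄` (type `{2,3,4}`): `typeCount = 1 ≠ 0`. -/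
theorem not_monotoneReducible_of_typeCount_ne_zero {l : List G} (h : typeCount S l ≠ 0) :
    ¬ MonotoneReducible l :=
  fun hr => h (typeCount_eq_zero_of_monotoneReducible S hS hr)

end TypeCount

/-! ### §13d New torsion test spheres with aspherical seams (T6)

By-product of the §13c search (log `search_L2`, 38-curve pool): 324 of the 1377 mixed pairs are
homotopy 4-spheres `Σ(F, F′)` planar-bisected into two ℚ-acyclic planar Stein fillings with
`π₁ = ℤ/2` along a `(ℤ/2)²`-homology 3-sphere whose fundamental group exceeds every coset cap tried
(`6·10⁵`; presumably infinite: an aspherical small Seifert or graph seam of the `Y(p)`-census kind,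
§5d). Explicit instance: `F = (t₁, t_{σ₁⁻¹(c₂₃₄)}, t_{σ₂(c₃₄)}, t_{σ₁²(c₂₃)})` (types
`{1},{134},{24},{23}`), `F′ = (t_{σ₁⁻¹(c₂₃)}, t_{σ₁σ₂⁻¹(c₃₄)}, t₂, t_{σ₁²(c₂₃₄)})` (types
`{13},{14},{2},{234}`), same `φ`, `H₁(Σ) = 0`, `π₁(Σ) = 1`. These are the first EXPLICIT members of
the torsion sector with non-spherical seam written as bisections (T6; compare (T5) = §5d's `M_p`,
whose membership needs a contact matching still open for `p ≥ 3` — here the matching is automatic: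
two positive factorisations of ONE monodromy). Standardness NOT examined (Kirby: is
`V(F,F′) = X_F ∪ {(c′ⱼ, pf+1)} ≅ ♮⁴ S²×D²`?); they are the natural next input both for
`exchange-recognition`'s wrapping number `w` and for any Stub-3-type recognition lemma, and — being
outside every filling-uniqueness statement in print — the cheapest place left where this crux could
still surprise. -/


/-! ### §13e After the kill: `T_ℤ`, the stable lever, and a non-abelian necessary condition (gen 5, session 2)

Within the hour of §13c the chain moved: triage r2-1/r2-2 FAIL `achiral-relator-reduction` on the
§13c word ("(S2)"); the ideator filed v2 `unimodular-relator-reduction` — lever `T_ℤ` = `T`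
restricted to the UNIMODULAR sector (`det M_F = ±1`, contractible halves, ℤHS seam), where §13c's
abelian analysis (i) shows the type obstruction is silent, plus the LATTICE LEMMA (ii): in the
torsion sector with `H₁(Σ) = 0` the two row lattices are transverse, hence different, hence the type
multisets differ AUTOMATICALLY — `T` fails on the ENTIRE torsion sector, not just on the witness
(a clean strengthening of §13c, endorsed); and it decoded the witness as a binding-RELABELLING
symmetry twist `F′ = (3 5)·F` (so `Σ(F,F′)` is the `S³/Q₈` bisection of `S⁴`, as guessed).
`hurwitz-deletion-presentation` (ideator 6) passes triage in its STABLE form `HN^{stab}` (positive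
stabilisation in the move set — one band `∂₃–∂₅` voids the type obstruction on the witness).

**Status of the two surviving word levers (adversary's view).** (1) `T_ℤ` (unstabilised, unimodular):
no abelian invariant can kill it; its decisive test is a deep MIXED Hurwitz search on
certified-inequivalent unimodular homotopy-sphere pairs (10511's 8 certified `k = 5` pairs; this
seat's enumeration reproduces that census exactly — 37848 unimodular words, 5485 multi-buckets, 368
with seam `≠ S³` on the 18-curve pool, `typejob/tz_bfs.py` — but a pure-Python mixed BFS explores
only depth 2–3 per pair in minutes and cannot certify irreducibility: NOT pursued here; the
necessary condition below is the tool for whoever does). (2) `HN^{stab}`: its first test (the §13c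
word after one `∂₃–∂₅` stabilisation; then the 324 T6 words) needs a genus-capable faithful
`Mod(Σ_{g,b}, ∂)` engine (this file's `modpk.py` is planar arc-data only); OPS REQUEST for the
planner: vendor `flipper`/`curver` (pure-Python mapping class group packages) into the kit image.

**Theorem (first-deletion criterion; formal below, any group).** If a nonempty word `l` is
monotone reducible then it contains letters `x`, `y` with `y = h x⁻¹ h⁻¹` for some `h` in the
subgroup `H = ⟨letters of l⟩`. (Every letter of every word in the achiral Hurwitz orbit is a
conjugate of an original letter BY AN ELEMENT OF `H`; the first deletion needs two adjacent mutually
inverse such letters; rotation and global conjugation are harmless.) For `l = F·F̄′` in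
`Mod(S, ∂S)` (a conjugate of a positive twist is never a negative twist): **some vanishing cycle
`c′ⱼ` of `F′` lies in the `H`-ORBIT of some vanishing cycle `cᵢ` of `F`,
`H = ⟨t_{c₁},…,t_{c_ℓ}, t_{c′₁},…,t_{c′_ℓ}⟩`** — `H`-conjugacy of twists, strictly finer than
`Mod`-conjugacy (= type, §13c) and NOT an abelian invariant: exactly the kind of "non-abelian
irreducibility certificate" card v2 says is unknown. It recurses (after the first deletion the
remaining letters generate a smaller `H₁ ≤ H`, and so on), so a full monotone reduction needs a
perfect matching `c′_{π(i)} ∈ H_i · c_i` along a DECREASING chain of subgroups. How to use it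
against `T_ℤ`: find an `H`-invariant separating the curves — e.g. if all `2ℓ` cycles miss an
essential arc or curve `δ`, then `i(·, δ)` is `H`-invariant and must agree on some `(cᵢ, c′ⱼ)`;
more generally any `H`-invariant measured lamination. (Not run: needs the inequivalent pairs.) -/

section FirstDeletion

variable {G : Type*} [Group G]

/-- Letters of `l.map (g * · * g⁻¹)` are conjugates of letters of `l`. -/
theorem mem_map_conj {l : List G} {g z : G} (hz : z ∈ l.map fun x => g * x * g⁻¹) :
    ∃ x ∈ l, z = g * x * g⁻¹ := by
  obtain ⟨x, hx, rfl⟩ := List.mem_map.1 hz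
  exact ⟨x, hx, rfl⟩

/-- **First-deletion criterion (non-abelian necessary condition for the lever `T` / `T_ℤ`).** If a
NONEMPTY word `l` over a group is monotone reducible (card `achiral-relator-reduction` /
`unimodular-relator-reduction` move set), then it contains two letters `x`, `y` (at some positions)
such that `y` is conjugate to `x⁻¹` by an element `h` of the subgroup GENERATED BY THE LETTERS of
`l`: `y = h * x⁻¹ * h⁻¹`. Reason: every letter of every word in the achiral Hurwitz orbit of `l`
is a conjugate `u t u⁻¹` of an original letter `t` by some `u ∈ ⟨letters⟩` (the moves conjugate
letters by letters), rotations and global conjugations change nothing, and the first deletion needs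
two adjacent mutually inverse such letters. With `G = Mod(S, ∂S)` and `l = F·F̄′`: some vanishing
cycle `c′ⱼ` of `F′` must lie in the orbit `H·cᵢ` of some vanishing cycle of `F` under
`H = ⟨t_{c₁}, …, t_{c′_ℓ}⟩` — `H`-conjugacy, strictly finer than the `Mod`-conjugacy (= type)
obstruction of `typeCount_eq_zero_of_monotoneReducible`, and not an abelian invariant. -/
theorem exists_conj_inv_of_monotoneReducible {l : List G} (h : MonotoneReducible l) (hl : l ≠ []) :
    ∃ x ∈ l, ∃ y ∈ l, ∃ g ∈ Subgroup.closure {z | z ∈ l}, y = g * x⁻¹ * g⁻¹ := by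
  induction h with
  | nil => exact (hl rfl).elim
  | cancel l₁ l₂ g _ _ =>
    refine ⟨g, by simp, g⁻¹, by simp, 1, one_mem _, by group⟩
  | hurwitz l₁ l₂ a b _ ih =>
    -- word w = l₁ ++ a :: b :: l₂ ; premise word w' = l₁ ++ b :: (b⁻¹ * a * b) :: l₂
    have hne : l₁ ++ b :: (b⁻¹ * a * b) :: l₂ ≠ [] := by simp
    obtain ⟨x', hx', y', hy', g', hg', hy'eq⟩ := ih hne
    -- closure of w' ⊆ closure of w
    set Sw : Set G := {z | z ∈ l₁ ++ a :: b :: l₂} with hSw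
    have ha : a ∈ Subgroup.closure Sw := Subgroup.subset_closure (by simp [hSw])
    have hb : b ∈ Subgroup.closure Sw := Subgroup.subset_closure (by simp [hSw])
    have hsub : Subgroup.closure {z | z ∈ l₁ ++ b :: (b⁻¹ * a * b) :: l₂} ≤ Subgroup.closure Sw := by
      refine (Subgroup.closure_le _).2 ?_
      intro z hz
      simp only [Set.mem_setOf_eq, List.mem_append, List.mem_cons] at hz
      rcases hz with hz | rfl | rfl | hz
      · exact Subgroup.subset_closure (by simp [hSw, hz])
      · exact hb
      · exact Subgroup.mul_mem _ (Subgroup.mul_mem _ (Subgroup.inv_mem _ hb) ha) hb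
      · exact Subgroup.subset_closure (by simp [hSw, hz])
    -- every letter of w' is u * (letter of w) * u⁻¹ with u ∈ closure Sw
    have hletter : ∀ z ∈ l₁ ++ b :: (b⁻¹ * a * b) :: l₂,
        ∃ t ∈ l₁ ++ a :: b :: l₂, ∃ u ∈ Subgroup.closure Sw, z = u * t * u⁻¹ := by
      intro z hz
      simp only [List.mem_append, List.mem_cons] at hz
      rcases hz with hz | rfl | rfl | hz
      · exact ⟨z, by simp [hz], 1, one_mem _, by group⟩
      · exact ⟨z, by simp, 1, one_mem _, by group⟩
      · exact ⟨a, by simp, b⁻¹, Subgroup.inv_mem _ hb, by group⟩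
      · exact ⟨z, by simp [hz], 1, one_mem _, by group⟩
    obtain ⟨x, hx, u, hu, rfl⟩ := hletter x' hx'
    obtain ⟨y, hy, v, hv, rfl⟩ := hletter y' hy'
    refine ⟨x, hx, y, hy, v⁻¹ * g' * u, ?_, ?_⟩
    · exact Subgroup.mul_mem _ (Subgroup.mul_mem _ (Subgroup.inv_mem _ hv) (hsub hg')) hu
    · -- v * y * v⁻¹ = g' * (u * x * u⁻¹)⁻¹ * g'⁻¹  ⇒  y = (v⁻¹ g' u) x⁻¹ (v⁻¹ g' u)⁻¹
      have := hy'eq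
      calc y = v⁻¹ * (v * y * v⁻¹) * v := by group
        _ = v⁻¹ * (g' * (u * x * u⁻¹)⁻¹ * g'⁻¹) * v := by rw [this]
        _ = v⁻¹ * g' * u * x⁻¹ * (v⁻¹ * g' * u)⁻¹ := by group
  | hurwitzInv l₁ l₂ a b _ ih =>
    have hne : l₁ ++ (a * b * a⁻¹) :: a :: l₂ ≠ [] := by simp
    obtain ⟨x', hx', y', hy', g', hg', hy'eq⟩ := ih hne
    set Sw : Set G := {z | z ∈ l₁ ++ a :: b :: l₂} with hSw
    have ha : a ∈ Subgroup.closure Sw := Subgroup.subset_closure (by simp [hSw])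
    have hb : b ∈ Subgroup.closure Sw := Subgroup.subset_closure (by simp [hSw])
    have hsub : Subgroup.closure {z | z ∈ l₁ ++ (a * b * a⁻¹) :: a :: l₂} ≤ Subgroup.closure Sw := by
      refine (Subgroup.closure_le _).2 ?_
      intro z hz
      simp only [Set.mem_setOf_eq, List.mem_append, List.mem_cons] at hz
      rcases hz with hz | rfl | rfl | hz
      · exact Subgroup.subset_closure (by simp [hSw, hz])
      · exact Subgroup.mul_mem _ (Subgroup.mul_mem _ ha hb) (Subgroup.inv_mem _ ha)
      · exact ha
      · exact Subgroup.subset_closure (by simp [hSw, hz])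
    have hletter : ∀ z ∈ l₁ ++ (a * b * a⁻¹) :: a :: l₂,
        ∃ t ∈ l₁ ++ a :: b :: l₂, ∃ u ∈ Subgroup.closure Sw, z = u * t * u⁻¹ := by
      intro z hz
      simp only [List.mem_append, List.mem_cons] at hz
      rcases hz with hz | rfl | rfl | hz
      · exact ⟨z, by simp [hz], 1, one_mem _, by group⟩
      · exact ⟨b, by simp, a, ha, rfl⟩
      · exact ⟨z, by simp, 1, one_mem _, by group⟩
      · exact ⟨z, by simp [hz], 1, one_mem _, by group⟩
    obtain ⟨x, hx, u, hu, rfl⟩ := hletter x' hx'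
    obtain ⟨y, hy, v, hv, rfl⟩ := hletter y' hy'
    refine ⟨x, hx, y, hy, v⁻¹ * g' * u, ?_, ?_⟩
    · exact Subgroup.mul_mem _ (Subgroup.mul_mem _ (Subgroup.inv_mem _ hv) (hsub hg')) hu
    · have := hy'eq
      calc y = v⁻¹ * (v * y * v⁻¹) * v := by group
        _ = v⁻¹ * (g' * (u * x * u⁻¹)⁻¹ * g'⁻¹) * v := by rw [this]
        _ = v⁻¹ * g' * u * x⁻¹ * (v⁻¹ * g' * u)⁻¹ := by group
  | rotate l k _ ih =>
    have hne : l.rotate k ≠ [] := by simpa using hl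
    obtain ⟨x, hx, y, hy, g, hg, hyeq⟩ := ih hne
    have hset : {z | z ∈ l.rotate k} = {z | z ∈ l} := by ext z; simp [List.mem_rotate]
    exact ⟨x, List.mem_rotate.1 hx, y, List.mem_rotate.1 hy, g, hset ▸ hg, hyeq⟩
  | conj l g _ ih =>
    have hne : (l.map fun x => g * x * g⁻¹) ≠ [] := by simpa using hl
    obtain ⟨x', hx', y', hy', g', hg', hy'eq⟩ := ih hne
    obtain ⟨x, hx, rfl⟩ := mem_map_conj hx'
    obtain ⟨y, hy, rfl⟩ := mem_map_conj hy'
    -- closure of the conjugated letters = conjugate of the closure: g' = g * h * g⁻¹ with h ∈ closure(l)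
    have hcl : Subgroup.closure {z | z ∈ l.map fun x => g * x * g⁻¹} =
        (Subgroup.closure {z | z ∈ l}).map (MulAut.conj g).toMonoidHom := by
      rw [MonoidHom.map_closure]
      congr 1
      ext z
      simp only [Set.mem_setOf_eq, Set.mem_image, MulEquiv.coe_toMonoidHom, MulAut.conj_apply,
        List.mem_map]
    rw [hcl] at hg'
    obtain ⟨h0, hh0, rfl⟩ := Subgroup.mem_map.1 hg'
    refine ⟨x, hx, y, hy, h0, hh0, ?_⟩
    have := hy'eq
    simp only [MulEquiv.coe_toMonoidHom, MulAut.conj_apply] at this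
    -- g * y * g⁻¹ = (g h0 g⁻¹) (g x g⁻¹)⁻¹ (g h0 g⁻¹)⁻¹
    calc y = g⁻¹ * (g * y * g⁻¹) * g := by group
      _ = g⁻¹ * (g * h0 * g⁻¹ * (g * x * g⁻¹)⁻¹ * (g * h0 * g⁻¹)⁻¹) * g := by rw [this]
      _ = h0 * x⁻¹ * h0⁻¹ := by group


end FirstDeletion

end RoundTwo

end Summit.SmoothPoincare4.SmoothPoincare4.Cruxes.AcyclicBisectionRigidity.Disproof

end
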